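import Literature.Probability.RandomPlanarGeometry.YangBaxterSAWGeneralDomain
import Literature.Probability.RandomPlanarGeometry.YangBaxterSAWYBE
import Literature.Barriers.CriticalPhenomena.PlaquetteWalkDominoRigidityVertical
import Literature.Barriers.CriticalPhenomena.PlaquetteWalkDominoSAWNoGo
import HarnessLib

/-!
# Barrier catalogue (SAWScalingLimit): MIRROR DUALITY `θ ↔ π − θ` of the Yang–Baxter vertex functional, and
reality at `θ = π/2` — the symmetry half of the lane's (R-9′) mirror zeros

Companion of `PlaquetteWalkSpinRigidity` / `PlaquetteWalkWeightRigidityPrinted` (this catalogue: the free-weight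
square-lattice observable `gmObservable W t Dl a z = Σ_γ w_W(γ) t^{q(γ)}` of a finite face list and its vertex
functional `Σ_{s ∈ (E,N,W,S)} c_s F(f₀.side s)`) and of `YangBaxterSAWGeneralDomain` (topic `RandomPlanarGeometry`:
the coefficient vector `ybCoeff θ = (1, r(θ), −1, −r(θ))`, `r(θ) = e^{i(3θ/8 + 5π/16)}`).

The venture lane's exact enumerations of the Yang–Baxter vertex defect from HOLE roots found zeros of a second kind
beside the «two-door-cut» (confinement) zeros: on single-hole boxes symmetric in the row of the root, the defect at the
FAR CELL of the hole vanishes at `θ = π/2` and at `θ = π/2` ONLY (the lane's law (R-9′); BENCH row 179; HOME findings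
«(R-9) thin box», «hole-neighbour directions», 2026-08-24). This file proves the SYMMETRY HALF of that law — an exact,
unconditional statement about the printed model — and isolates what the other half must supply.

* §1–§3 The reflection `mirrorRow c` of the lattice in the horizontal axis of row `c` (`vert k j ↦ vert k (2c − j)`,
  `slant k j ↦ slant k (2c + 1 − j)`; faces `(k, j) ↦ (k, 2c − j)`; sides `N ↔ S`): common faces, side indices, arc kinds
  (corner ↔ co-corner: `arcKindOf_mirrorArc`) and signed quarter turns (`qTurnOf_mirrorArc`: negated) are equivariant;
  for mid-edge lists `quarterTurnsL (l.map ρ) = −quarterTurnsL l`, `cfgCount (l.map ρ) κ = cfgCount l (κ.map mirrorKind)`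
  and ★ `weightL W (l.map ρ) = weightL W.swap l` (`CWeights.swap = (u₂, u₁, v, w₂, w₁)`); a Glazman–Manolescu walk reflects
  to a Glazman–Manolescu walk (`MirrorWalk.mirrorWalk`: nodup, arcs in faces, consecutive arcs in different faces, no two
  crossing straight arcs — all transported), bijectively on a mirror-symmetric face list (`mirrorWalkEquiv`).
* §4 ★★ `gmObservable_mirrorRow` — MIRROR COVARIANCE for ARBITRARY complex weights and phase:
  `F_{W,t}(ρa → ρz) = F_{W.swap, t⁻¹}(a → z)` on every face list symmetric in the axis of row `c`.
* §5 ★ `printedWeights_swap : (printedWeights θ).swap = printedWeights (π − θ)` — the printed remark «Replacing θ by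
  π − θ, effectively exchanges u₁ with u₂ and w₁ with w₂, but does not affect v» (the tree's five identities
  `weightU1_pi_sub`, …, `weightW2_pi_sub` of `YangBaxterSAWYBE`); hence
  ★★ `gmObservable_printed_mirrorRow` (`F_θ(ρa → ρz; t) = F_{π−θ}(a → z; t⁻¹)`), `conj_gmObservable_printed` (real weights),
  `conj_tFiveEighths` (`t̄ = t⁻¹` at spin `5/8`), `gmObservable_printed_mirrorRow_eq_conj` (root on the axis:
  `F_θ(a → ρz) = conj F_{π−θ}(a → z)`), `conj_ybRatio_pi_sub` (`conj r(π − θ) = −r(θ)`), `ybRatio_pi_div_two` (`r(π/2) = i`),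
  and the headline ★★★ `vertexFunctional_printed_mirror_duality`: for every face list symmetric in the axis of row `c`,
  every root on a VERTICAL mid-edge of row `c` (interior or not, outer or hole boundary) and every plaquette `(k, c)` of
  the axis row, `VF_θ = conj VF_{π−θ}` — same modulus (`norm_vertexFunctional_printed_mirror`), same zero set
  (`vertexFunctional_printed_eq_zero_iff_mirror`: the lane's exact zero tables at the dual generic angles `5π/12`, `7π/12`
  must agree on axis cells), and at the self-dual angle ★★★ `vertexFunctional_printed_pi_div_two_im_eq_zero_of_mirror`:
  the vertex functional is REAL at `θ = π/2`. ★★ `vertexFunctional_printed_pi_div_two_eq_zero_of_mirror_of_re_eq_zero`: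
  so an axis plaquette whose defect has vanishing REAL PART carries no defect at all at `θ = π/2` — the mechanism of
  (R-9′): the lane's far-cell half law (`Re VF(far cell) = 0`, the catalogue's `PlaquetteWalkHoleRootFarCellLaw`,
  conditional on the prefix turning rigidity (R2)) supplies exactly that at the far cell of a hole root, which lies on
  the axis together with the root; off `θ = π/2` the two halves constrain different lines (`ℝ·conj VF_{π−θ}` vs `iℝ`) and
  no zero follows — as observed.
* §6 Instances by `decide`d symmetry: the lane's `sq5hole` (`5 × 5 ∖ (2,2)`, root `E` side of the hole: far cell
  `(1, 2)` and the root's own plaquette `(3, 2)` real at `π/2`, duality at every `θ`) and the BENCH domain `box75hole`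
  (`7 × 5 ∖ (2,2)`, not left-right symmetric about its hole: far cells `(1, 2)` / `(3, 2)` for the two axis roots).
  Named statement `PlaquetteWalkMirrorDuality` / `_holds`.

* §7 (edition 3) ★★ `gmObservable_map_mirrorRow` / ★★★ `vertexFunctional_printed_map_mirrorRow_duality` — the same for an
  ARBITRARY face list, root and plaquette (no symmetry assumed): `F^{ρD}_{W,t}(ρa → ρz) = F^{D}_{W.swap,t⁻¹}(a → z)` and
  `VF_θ(ρDl; ρa; ρf₀) = conj VF_{π−θ}(Dl; a; f₀)` — the lane's exact defect tables at `θ` and at `π − θ` are mirror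
  images of each other, hole roots included (endpoint degeneracies `θ = π/3` ↔ `2π/3`); zero sets and moduli correspond.
* §8 (edition 3) the COLUMN-axis twin `mirrorCol c` (`vert k j ↦ vert (2c+1−k) j`, `slant k j ↦ slant (2c−k) j`; `E ↔ W`):
  `VF_θ(ρ'Dl; ρ'a; ρ'f₀) = −conj VF_{π−θ}(Dl; a; f₀)`; on a column-symmetric list with the root on a SLANTED mid-edge of
  the axis column, the axis cells are PURELY IMAGINARY at `θ = π/2` (`…_re_eq_zero_of_mirrorCol`; instance `ring8'`,
  the `3 × 3` ring from the `N` side of its hole); ★★ `vertexFunctional_printed_halfTurn`: the half-turn rotation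
  NEGATES the vertex functional at every `θ`; `printedWeights_swap_eq_self_iff` (§7): self-duality iff `θ = π/2`.
* §9 (edition 3) the DIAGONAL reflection `mirrorDiag` (`vert k j ↦ slant j k`; faces `(k,j) ↦ (j,k)`; `W ↔ S`, `E ↔ N`),
  which maps the rhombus of angle `θ` onto ITSELF: arc kinds are PRESERVED (`weightL_map_mirrorDiag`, every weight
  system), quarter turns negated ⇒ ★★ `gmObservable_map_mirrorDiag : F^{τD}_{W,t}(τa → τz) = F^{D}_{W,t⁻¹}(a → z)` and
  ★★★ `vertexFunctional_printed_map_mirrorDiag : VF_θ(τDl; τa; τf₀) = r(θ) · conj VF_θ(Dl; a; f₀)` — an exact anti-linear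
  symmetry AT THE SAME ANGLE (same modulus, same zero set); ★★ `vertexFunctional_printed_quarterTurn`: the quarter-turn
  rotation gives `VF_θ(R·) = r(θ) · VF_{π−θ}(·)`. With the half turn this is the full dihedral covariance table of the
  printed vertex functional — in particular the lane's far-cell half law (`VF(far) ∈ iℝ` in the `W`-root normalisation,
  the catalogue's `PlaquetteWalkHoleRootFarCellLaw`) transfers to the three other orientations as `VF(far) ∈ i·c·ℝ`,
  `c ∈ {1, r(θ), −1, −r(θ)}` — the lane's observed directions for `N`/`S`-rooted holes.

* §10 (edition 3) the three reflections for ARBITRARY complex weights `W`, phase `t` and coefficient vector `c`: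
  `VF_{W,t,c}(ρ·) = VF_{W.swap,t⁻¹,swapNS c}(·)`, `VF_{W,t,c}(ρ'·) = VF_{W.swap,t⁻¹,swapEW c}(·)`,
  `VF_{W,t,c}(τ·) = VF_{W,t⁻¹,swapDiag c}(·)` (`vertexFunctional_map_mirrorRow/Col/Diag`) — so the catalogue's technique
  class is dihedrally invariant: `exactPlaquetteVertexRelation_mirrorDiag_iff :
  ExactPlaquetteVertexRelation W t⁻¹ (swapDiag c) ↔ ExactPlaquetteVertexRelation W t c` (the classification files
  need only be read up to the dihedral action).

* §11 (edition 4) ★★★ `exactDominoVertexRelationV_iff_mirrorDiag : ExactDominoVertexRelationV W t⁻¹ (swapDomino c) ↔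
  ExactDominoVertexRelation W t c` — THE VERTICAL DOMINO CLASS IS THE DIAGONAL IMAGE OF THE HORIZONTAL ONE
  (`dominoFunctional_map_mirrorDiag`: the horizontal domino functional of the reflected data is the vertical one of the
  data with `t ↦ t⁻¹` and slots `1 ↔ 2`, `4 ↔ 5` exchanged): the catalogue's vertical twins (`PlaquetteWalkDominoRigidityVertical`,
  `…DominoIdentityVertical`, `…DominoSAWNoGoVertical`) and their horizontal originals determine each other by transport.

* §12 (edition 4) application: the catalogue's VERTICAL SAW domino no-go (`PlaquetteWalkDominoSAWNoGoVertical`,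
  ≈ 1 600 hand-built lines) re-derived in three lines from the HORIZONTAL one (`PlaquetteWalkDominoSAWNoGo`) by § 11 —
  as a kernel-checked `example` (same statement as the landed theorem) and as the transported statement
  `saw_no_domino_identity_swapDomino`.

* §13 (edition 5) the dihedral group acts ON THE YANG–BAXTER CURVE `ybCurve ε t r` of `PlaquetteWalkSpinRigidity`
  (closed forms of the five weights at both signs `ε = ±1`: `u₁ = ε t r (1 − t⁸)(r² − t²)/Q`, `u₂ = t r (1 − t⁸)(1 − r²t²)/Q`,
  `w₁ = (t² − r²)(1 − t¹⁰r²)/Q`, `w₂ = (t¹⁰ − r²)(1 − t²r²)/Q`, `Q = t⁶(1 + r⁴) − (1 + t¹²) r²`): ★★★ `ybCurve_inv_inv :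
  ybCurve ε t⁻¹ r⁻¹ = ybCurve ε t r` — THE DIAGONAL REFLECTION FIXES EVERY CURVE POINT — and ★★★ `ybCurve_swap :
  (ybCurve ε t r).swap = ybCurve ε t⁻¹ (ε r)` — THE ROW REFLECTION MAPS THE CURVE ONTO ITSELF; with § 10
  (`coeffRatio_swapDiag/swapNS`: the permuted coefficient vectors have ratios `r⁻¹`, `ε r`;
  `exactPlaquetteVertexRelation_mirrorRow_iff`) the catalogue's classification «the weights lie on the curve»
  (`weights_eq_ybCurve`) is dihedrally EQUIVARIANT: `exactPlaquetteVertexRelation_ybCurve_mirrorDiag_iff`,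
  `exactPlaquetteVertexRelation_ybCurve_mirrorRow_iff`.

* §14 (edition 6) the rest of the orbit: `exactPlaquetteVertexRelation_mirrorCol_iff`, the half turn
  (`exactPlaquetteVertexRelation_halfTurn_iff : … W t (halfTurnCoeff c) ↔ … W t c` — a class INVARIANT) and ★★★ THE CORNER
  SWAP IS THE QUARTER TURN (`exactPlaquetteVertexRelation_swap_quarterTurn_iff : … W.swap t (quarterTurnCoeff c) ↔ … W t c`;
  coefficient ratios `εr`, `r`, `(εr)⁻¹`: `coeffRatio_swapEW/halfTurn/quarterTurn`); on the curve ★★★ `ybCurve_swap_eq_inv :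
  (ybCurve ε t r).swap = ybCurve ε t (εr)⁻¹` (same phase) and the SELF-DUAL LOCUS ★★ `ybCurve_swap_eq_self_iff :
  (ybCurve ε t r).swap = ybCurve ε t r ↔ r² = ε` (generic phase `t⁸ ≠ 1`; already `u₁ = u₂` forces it,
  `sq_eq_of_ybU1_eq_ybU2`); `ybRatio_sq_eq_neg_one_iff : r(θ)² = −1 ↔ θ = π/2` on the printed range.

* §15 (edition 6) the printed point on the curve: ★★ `ybDisc_printed_ne_zero` — `Q(t, r(θ)) ≠ 0` on `[π/3, 2π/3]`
  (`Q = t⁶r²(2cos(3θ/4 + 5π/8) − 2cos(15π/8))`, `cos(3θ/4 + 5π/8) < 0 < cos(15π/8)`), so §§ 13–14 apply to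
  `printedWeights θ = ybCurve (−1) t r(θ)` (`printedWeights_eq_ybCurve`); SECOND PROOFS from the curve, as kernel-checked
  `example`s, of § 5's `printedWeights_swap` (`(−r(θ))⁻¹ = −r̄(θ) = r(π − θ)`) and of § 7's `printedWeights_swap_eq_self_iff`
  (`r(θ)² = −1 ⟺ θ = π/2`): the trigonometric duality of [GM19, §1] and the algebraic self-map of the curve are the same fact.

What is proved and what is not: everything here is unconditional and exact for the printed weights at spin `5/8`;
the far-cell ZERO itself (`VF = 0`) is NOT claimed — it needs `Re VF = 0`, the lane's conditional far-cell law. The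
mirror duality of the weights is printed in [GM19, §1]; its consequences for the vertex functional of hole roots are the
lane's (presearch: corpus fts + vec and galaxy, needles «reflection symmetry», «complex conjugate», «π − θ»: nothing
beyond the weights remark and the routine «by vertical symmetry» of [GM19, §3]).

References: A. Glazman, I. Manolescu, arXiv:1708.00395v3, §1, eq. (1) and the remark after it («Replacing θ by π−θ,
effectively exchanges u₁ with u₂ and w₁ with w₂, but does not affect v»), §2.1 eq. (2.1) (the observable), Lemma 2.1
eq. (2.2) (CR) [GlazmanManolescu2019]; H. Duminil-Copin, S. Smirnov, Ann. of Math. 175 (2012), Lemma 1 (shape of the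
vertex relation) [DuminilCopinSmirnov2012]; A. Glazman, «Connective constant for a weighted self-avoiding walk on ℤ²»,
Electron. Commun. Probab. 20 (2015), Lemma 3.1, (3.3)–(3.7) (the closed-form weights) [Glazman2015WeightedSAW]. Status: lane theorem (symmetry; everything proved, no hypothesis
introduced). Editions: ed.2 = §1–§6 (first tree edition); ed.3 = ed.2 verbatim ⊕ §7–§10 (appended); ed.4 = ed.3 verbatim ⊕ §11–§12 (appended) and two imports (`PlaquetteWalkDominoRigidityVertical`, `PlaquetteWalkDominoSAWNoGo`); ed.5 = ed.4 verbatim ⊕ §13 (appended); ed.6 = ed.5 verbatim ⊕ §14–§15 (appended). Written for the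
venture lane «pcv-sawmu» (Tier B SEARCH 1, b-engine-1 gen 17).
-/

noncomputable section

namespace Literature.Barriers.CriticalPhenomena.PlaquetteWalk

open Literature.Probability.RandomPlanarGeometry.SAW.YangBaxter
open Literature.Probability.RandomPlanarGeometry.SAW.YangBaxter.MidEdge
open Real Complex

/-! ## §1. The reflection of the lattice in the axis of a row -/

/-- **Reflection in the horizontal axis of row `c`** on mid-edges: rows `j ↦ 2c − j`; the vertical mid-edges of row
`c` are fixed, the bottom side of row `j` goes to the top side of row `2c − j`. [cite: GlazmanManolescu2019, §1 (the lattice of rhombi and its mid-edges)] -/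
def mirrorRow (c : ℤ) : MidEdge → MidEdge
  | .vert k j => .vert k (2 * c - j)
  | .slant k j => .slant k (2 * c + 1 - j)

/-- The reflection of row `c` on faces. [cite: GlazmanManolescu2019, §1 (the lattice of rhombi and its mid-edges)] -/
def mirrorRowFace (c : ℤ) (f : Face) : Face := (f.1, 2 * c - f.2)

/-- The reflection on the sides of a face: `N ↔ S`, `W`, `E` fixed. [cite: GlazmanManolescu2019, §1, Fig. 4 (z_W, z_E, z_S, z_N)] -/
def mirrorSide : Side → Side
  | .N => .S
  | .S => .N
  | .W => .W
  | .E => .E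

/-- The reflection is an involution on mid-edges. [cite: GlazmanManolescu2019, §1 (the lattice of rhombi and its mid-edges)] -/
@[simp] theorem mirrorRow_mirrorRow (c : ℤ) (e : MidEdge) : mirrorRow c (mirrorRow c e) = e := by
  cases e <;> simp [mirrorRow]

/-- The reflection is an involution on faces. [cite: GlazmanManolescu2019, §1 (the lattice of rhombi and its mid-edges)] -/
@[simp] theorem mirrorRowFace_mirrorRowFace (c : ℤ) (f : Face) : mirrorRowFace c (mirrorRowFace c f) = f := by
  obtain ⟨k, j⟩ := f; simp [mirrorRowFace]

/-- The reflection is an involution on sides. [cite: GlazmanManolescu2019, §1 (the lattice of rhombi and its mid-edges)] -/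
@[simp] theorem mirrorSide_mirrorSide (s : Side) : mirrorSide (mirrorSide s) = s := by
  cases s <;> rfl

/-- The reflection is injective on mid-edges. [cite: GlazmanManolescu2019, §1 (the lattice of rhombi and its mid-edges)] -/
theorem mirrorRow_injective (c : ℤ) : Function.Injective (mirrorRow c) :=
  Function.LeftInverse.injective (mirrorRow_mirrorRow c)

/-- The reflection is injective on faces. [cite: GlazmanManolescu2019, §1 (the lattice of rhombi and its mid-edges)] -/
theorem mirrorRowFace_injective (c : ℤ) : Function.Injective (mirrorRowFace c) :=
  Function.LeftInverse.injective (mirrorRowFace_mirrorRowFace c)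

/-- **Sides are equivariant**: the side `s` of `f` reflects to the side `mirrorSide s` of the reflected face.
[cite: GlazmanManolescu2019, §1, Fig. 4 (z_W, z_E, z_S, z_N)] -/
theorem mirrorRow_side (c : ℤ) (f : Face) (s : Side) :
    mirrorRow c (f.side s) = (mirrorRowFace c f).side (mirrorSide s) := by
  obtain ⟨k, j⟩ := f
  cases s
  · simp [mirrorRow, mirrorRowFace, mirrorSide, Face.side]
  · simp [mirrorRow, mirrorRowFace, mirrorSide, Face.side]
  · simp [mirrorRow, mirrorRowFace, mirrorSide, Face.side]; ring
  · simp [mirrorRow, mirrorRowFace, mirrorSide, Face.side]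

/-- A vertical mid-edge of the axis row is fixed. [cite: GlazmanManolescu2019, §1 (the lattice of rhombi and its mid-edges)] -/
@[simp] theorem mirrorRow_vert_axis (c k : ℤ) : mirrorRow c (.vert k c) = .vert k c := by
  simp [mirrorRow]; ring

/-- A face of the axis row is fixed. [cite: GlazmanManolescu2019, §1 (the lattice of rhombi and its mid-edges)] -/
@[simp] theorem mirrorRowFace_axis (c k : ℤ) : mirrorRowFace c (k, c) = (k, c) := by
  simp [mirrorRowFace]; ring

/-- `f.side s = e` is reflected. [cite: GlazmanManolescu2019, §1 (the lattice of rhombi and its mid-edges)] -/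
theorem side_eq_iff_mirror (c : ℤ) (f : Face) (s : Side) (e : MidEdge) :
    (mirrorRowFace c f).side (mirrorSide s) = mirrorRow c e ↔ f.side s = e := by
  rw [← mirrorRow_side]
  exact (mirrorRow_injective c).eq_iff

/-- `∃ s, f.side s = e` is reflected. [cite: GlazmanManolescu2019, §1 (the lattice of rhombi and its mid-edges)] -/
theorem exists_side_eq_iff_mirror (c : ℤ) (f : Face) (e : MidEdge) :
    (∃ s, (mirrorRowFace c f).side s = mirrorRow c e) ↔ ∃ s, f.side s = e := by
  constructor
  · rintro ⟨s, hs⟩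
    refine ⟨mirrorSide s, ?_⟩
    rw [← side_eq_iff_mirror c, mirrorSide_mirrorSide]
    exact hs
  · rintro ⟨s, hs⟩
    exact ⟨mirrorSide s, (side_eq_iff_mirror c f s e).2 hs⟩

/-- **Common faces are equivariant.** [cite: GlazmanManolescu2019, §1 (the lattice of rhombi and its mid-edges)] -/
theorem commonFace_mirrorRow (c : ℤ) (e e' : MidEdge) :
    commonFace (mirrorRow c e) (mirrorRow c e') = (commonFace e e').map (mirrorRowFace c) := by
  cases h : commonFace e e' with
  | some f =>
    rw [Option.map_some]
    rw [MidEdge.commonFace_eq_some_iff] at h ⊢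
    exact ⟨(mirrorRow_injective c).ne h.1, (exists_side_eq_iff_mirror c f e).2 h.2.1,
      (exists_side_eq_iff_mirror c f e').2 h.2.2⟩
  | none =>
    rw [Option.map_none]
    cases h' : commonFace (mirrorRow c e) (mirrorRow c e') with
    | none => rfl
    | some g =>
      exfalso
      rw [MidEdge.commonFace_eq_some_iff] at h'
      have key : commonFace e e' = some (mirrorRowFace c g) := by
        rw [MidEdge.commonFace_eq_some_iff]
        refine ⟨fun hh => h'.1 (by rw [hh]), ?_, ?_⟩
        · rw [← exists_side_eq_iff_mirror c, mirrorRowFace_mirrorRowFace]; exact h'.2.1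
        · rw [← exists_side_eq_iff_mirror c, mirrorRowFace_mirrorRowFace]; exact h'.2.2
      rw [h] at key
      exact Option.some_ne_none _ key.symm

/-- `sideOf` is equivariant. [cite: GlazmanManolescu2019, §1 (the lattice of rhombi and its mid-edges)] -/
theorem sideOf_mirrorRow (c : ℤ) (f : Face) (e : MidEdge) :
    (mirrorRowFace c f).sideOf (mirrorRow c e) = (f.sideOf e).map mirrorSide := by
  cases h : f.sideOf e with
  | some s =>
    rw [Option.map_some, Face.sideOf_eq_some_iff, side_eq_iff_mirror]
    exact (Face.sideOf_eq_some_iff f e s).1 h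
  | none =>
    rw [Option.map_none]
    cases h' : (mirrorRowFace c f).sideOf (mirrorRow c e) with
    | none => rfl
    | some s =>
      exfalso
      rw [Face.sideOf_eq_some_iff] at h'
      have key : f.sideOf e = some (mirrorSide s) := by
        rw [Face.sideOf_eq_some_iff, ← side_eq_iff_mirror c, mirrorSide_mirrorSide]; exact h'
      rw [h] at key
      exact Option.some_ne_none _ key.symm

/-- The reflected arc. [folklore] -/
abbrev mirrorArc (c : ℤ) (p : MidEdge × MidEdge) : MidEdge × MidEdge := Prod.map (mirrorRow c) (mirrorRow c) p

/-- **Arc faces are equivariant.** [cite: GlazmanManolescu2019, §1] -/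
theorem arcFace_mirrorArc (c : ℤ) (p : MidEdge × MidEdge) :
    arcFace (mirrorArc c p) = (arcFace p).map (mirrorRowFace c) :=
  commonFace_mirrorRow c p.1 p.2

/-- The reflection swaps corner and co-corner arcs and keeps straight ones. [cite: GlazmanManolescu2019, Fig. 1] -/
def mirrorKind : ArcKind → ArcKind
  | .corner => .coCorner
  | .coCorner => .corner
  | .straight => .straight
  | .degen => .degen

/-- `mirrorKind` is an involution. [cite: GlazmanManolescu2019, Fig. 1 (the local configurations)] -/
@[simp] theorem mirrorKind_mirrorKind (κ : ArcKind) : mirrorKind (mirrorKind κ) = κ := by cases κ <;> rfl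

/-- The kind of the reflected arc. [cite: GlazmanManolescu2019, Fig. 1] -/
theorem arcKind_mirrorSide (s t : Side) : arcKind (mirrorSide s) (mirrorSide t) = mirrorKind (arcKind s t) := by
  cases s <;> cases t <;> rfl

/-- **Arc kinds are equivariant**: corner ↔ co-corner. [cite: GlazmanManolescu2019, Fig. 1] -/
theorem arcKindOf_mirrorArc (c : ℤ) (p : MidEdge × MidEdge) :
    arcKindOf (mirrorArc c p) = (arcKindOf p).map mirrorKind := by
  unfold arcKindOf
  rw [arcFace_mirrorArc]
  cases arcFace p with
  | none => rfl
  | some f =>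
    simp only [Option.map_some, Option.bind_some, mirrorArc, Prod.map_fst, Prod.map_snd, sideOf_mirrorRow]
    cases f.sideOf p.1 with
    | none => simp
    | some s =>
      cases f.sideOf p.2 with
      | none => simp
      | some t => simp [arcKind_mirrorSide]

/-- The reflection negates the signed quarter turn. [cite: GlazmanManolescu2019, §2.1 (definition of wind(γ))] -/
theorem qTurn_mirrorSide (s t : Side) : qTurn (mirrorSide s) (mirrorSide t) = -qTurn s t := by
  cases s <;> cases t <;> rfl

/-- **Quarter turns are odd under the reflection.** [cite: GlazmanManolescu2019, §2.1 (definition of wind(γ))] -/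
theorem qTurnOf_mirrorArc (c : ℤ) (p : MidEdge × MidEdge) : qTurnOf (mirrorArc c p) = -qTurnOf p := by
  unfold qTurnOf
  rw [arcFace_mirrorArc]
  cases arcFace p with
  | none => simp
  | some f =>
    simp only [Option.map_some, mirrorArc, Prod.map_fst, Prod.map_snd, sideOf_mirrorRow]
    cases f.sideOf p.1 with
    | none => simp
    | some s =>
      cases f.sideOf p.2 with
      | none => simp
      | some t => simp [qTurn_mirrorSide]

/-! ## §2. Reflected mid-edge lists: arcs, quarter turns, local configurations, weights -/

/-- The arcs of the reflected list are the reflected arcs. [cite: GlazmanManolescu2019, §2.1 (finite domains of faces; walks as sequences of mid-edges)] -/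
theorem arcsOf_map_mirrorRow (c : ℤ) (l : List MidEdge) :
    arcsOf (l.map (mirrorRow c)) = (arcsOf l).map (mirrorArc c) := by
  unfold arcsOf
  rw [← List.map_tail, List.zip_map]

/-- **The quarter-turn count of the reflected list is the negative.** [cite: GlazmanManolescu2019, §2.1 (definition of wind(γ))] -/
theorem quarterTurnsL_map_mirrorRow (c : ℤ) (l : List MidEdge) :
    quarterTurnsL (l.map (mirrorRow c)) = -quarterTurnsL l := by
  unfold quarterTurnsL
  rw [arcsOf_map_mirrorRow, List.map_map]
  induction arcsOf l with
  | nil => simp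
  | cons p ps ih =>
    simp only [List.map_cons, List.sum_cons, Function.comp_apply, qTurnOf_mirrorArc] at ih ⊢
    rw [ih]; ring

/-- The visited faces of the reflected list are the reflected visited faces. [cite: GlazmanManolescu2019, §2.1 (finite domains of faces; walks as sequences of mid-edges)] -/
theorem facesL_map_mirrorRow (c : ℤ) (l : List MidEdge) :
    facesL (l.map (mirrorRow c)) = (facesL l).map (mirrorRowFace c) := by
  unfold facesL
  rw [arcsOf_map_mirrorRow, List.filterMap_map, ← List.dedup_map_of_injective (mirrorRowFace_injective c),
    List.map_filterMap]
  congr 1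
  refine List.filterMap_congr fun p _ => ?_
  exact arcFace_mirrorArc c p

/-- The local configuration of the reflected list at the reflected face: kinds reflected. [cite: GlazmanManolescu2019, Fig. 1] -/
theorem kindsL_map_mirrorRow (c : ℤ) (l : List MidEdge) (f : Face) :
    kindsL (l.map (mirrorRow c)) (mirrorRowFace c f) = (kindsL l f).map mirrorKind := by
  unfold kindsL
  rw [arcsOf_map_mirrorRow, List.filterMap_map, List.map_filterMap]
  refine List.filterMap_congr fun p _ => ?_
  simp only [Function.comp_apply, arcFace_mirrorArc, arcKindOf_mirrorArc]
  have hinj : ((arcFace p).map (mirrorRowFace c) = some (mirrorRowFace c f)) ↔ arcFace p = some f := by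
    cases arcFace p with
    | none => simp
    | some g => simp only [Option.map_some, Option.some.injEq]; exact (mirrorRowFace_injective c).eq_iff
  by_cases h : arcFace p = some f
  · rw [if_pos (hinj.2 h), if_pos h]
  · rw [if_neg (fun h' => h (hinj.1 h')), if_neg h, Option.map_none]

/-- Mapping kinds is injective. [folklore] -/
private theorem map_mirrorKind_injective : Function.Injective (List.map mirrorKind) :=
  List.map_injective_iff.2 (Function.LeftInverse.injective mirrorKind_mirrorKind)

/-- **Configuration counts are reflected**: the number of visited faces of the reflected list with local
configuration `κ` is the number of visited faces of the list with the reflected configuration. [cite: GlazmanManolescu2019, §1, Fig. 1, eq. (1)] -/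
theorem cfgCount_map_mirrorRow (c : ℤ) (l : List MidEdge) (κ : List ArcKind) :
    cfgCount (l.map (mirrorRow c)) κ = cfgCount l (κ.map mirrorKind) := by
  unfold cfgCount
  rw [facesL_map_mirrorRow, List.countP_map]
  congr 1
  funext f
  simp only [Function.comp_apply, kindsL_map_mirrorRow]
  have hid : (mirrorKind ∘ mirrorKind) = id := funext mirrorKind_mirrorKind
  have key : (kindsL l f).map mirrorKind = κ ↔ kindsL l f = κ.map mirrorKind := by
    constructor
    · intro h; rw [← h, List.map_map, hid, List.map_id]
    · intro h; rw [h, List.map_map, hid, List.map_id]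
  rw [decide_eq_decide.2 key]

/-- The weights with the two corner types exchanged: `(u₂, u₁, v, w₂, w₁)`. [cite: GlazmanManolescu2019, §1, Fig. 1, eq. (1)] -/
def CWeights.swap (W : CWeights) : CWeights := ⟨W.u₂, W.u₁, W.v, W.w₂, W.w₁⟩

/-- ★ **The plaquette weight of the reflected list is the corner-swapped weight of the list.**
[cite: GlazmanManolescu2019, §1 ("the weight of a walk is the product of weights associated to each rhombus")] -/
theorem weightL_map_mirrorRow (W : CWeights) (c : ℤ) (l : List MidEdge) :
    weightL W (l.map (mirrorRow c)) = weightL W.swap l := by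
  unfold weightL
  simp only [cfgCount_map_mirrorRow, List.map_cons, List.map_nil, mirrorKind]
  unfold CWeights.mono CWeights.swap
  ring

/-! ## §3. Reflected walks -/

namespace MirrorWalk

variable {D D' : Set Face} {a z a' z' : MidEdge}

/-- **The reflected walk**: the reflection of a Glazman–Manolescu walk of `D` is a walk of any domain containing the
reflected faces. [cite: GlazmanManolescu2019, §1 (definition of the model), Fig. 1] -/
def mirrorWalk (c : ℤ) (hD : ∀ f, f ∈ D → mirrorRowFace c f ∈ D') (ha : mirrorRow c a = a')
    (hz : mirrorRow c z = z') (γ : YBWalk D a z) : YBWalk D' a' z' where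
  mids := γ.mids.map (mirrorRow c)
  head_eq := by rw [List.head?_map, γ.head_eq, Option.map_some, ha]
  getLast_eq := by rw [List.getLast?_map, γ.getLast_eq, Option.map_some, hz]
  nodup := γ.nodup.map (mirrorRow_injective c)
  arc_mem p hp := by
    rw [arcsOf_map_mirrorRow, List.mem_map] at hp
    obtain ⟨q, hq, rfl⟩ := hp
    obtain ⟨f, hf, hqf⟩ := γ.arc_mem q hq
    exact ⟨mirrorRowFace c f, hD f hf, by rw [arcFace_mirrorArc, hqf, Option.map_some]⟩
  isChain := by
    rw [arcsOf_map_mirrorRow]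
    refine List.isChain_map_of_isChain (mirrorArc c) (fun p q h => ?_) γ.isChain
    rw [arcFace_mirrorArc, arcFace_mirrorArc]
    exact fun e => h (Option.map_injective (mirrorRowFace_injective c) e)
  noncross f hWE hSN := by
    rw [arcsOf_map_mirrorRow] at hWE hSN
    have hmem : ∀ s t : Side, ((f.side s, f.side t) ∈ (arcsOf γ.mids).map (mirrorArc c)) ↔
        ((mirrorRowFace c f).side (mirrorSide s), (mirrorRowFace c f).side (mirrorSide t)) ∈ arcsOf γ.mids := by
      intro s t
      rw [List.mem_map]
      constructor
      · rintro ⟨q, hq, hqe⟩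
        have e1 : mirrorRow c q.1 = f.side s := congrArg Prod.fst hqe
        have e2 : mirrorRow c q.2 = f.side t := congrArg Prod.snd hqe
        have e1' : q.1 = (mirrorRowFace c f).side (mirrorSide s) := by
          rw [← mirrorRow_mirrorRow c q.1, e1, mirrorRow_side]
        have e2' : q.2 = (mirrorRowFace c f).side (mirrorSide t) := by
          rw [← mirrorRow_mirrorRow c q.2, e2, mirrorRow_side]
        rwa [← e1', ← e2', Prod.mk.eta]
      · intro h
        refine ⟨_, h, ?_⟩
        simp only [mirrorArc, Prod.map_apply, mirrorRow_side, mirrorRowFace_mirrorRowFace, mirrorSide_mirrorSide]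
    simp only [hmem, mirrorSide] at hWE hSN
    exact γ.noncross (mirrorRowFace c f) hWE (Or.symm hSN)

/-- The mid-edges of the reflected walk. [cite: GlazmanManolescu2019, §2.1 (finite domains of faces; walks as sequences of mid-edges)] -/
@[simp] theorem mirrorWalk_mids (c : ℤ) (hD : ∀ f, f ∈ D → mirrorRowFace c f ∈ D') (ha : mirrorRow c a = a')
    (hz : mirrorRow c z = z') (γ : YBWalk D a z) : (mirrorWalk c hD ha hz γ).mids = γ.mids.map (mirrorRow c) := rfl

end MirrorWalk

open MirrorWalk

/-- **The reflection is a bijection between the walks `a → z` and the walks `ρa → ρz` of a mirror-symmetric face list.**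
[cite: GlazmanManolescu2019, §1 (definition of the model)] -/
def mirrorWalkEquiv (c : ℤ) {Dl : List Face} (hsym : ∀ f ∈ Dl, mirrorRowFace c f ∈ Dl) (a z : MidEdge) :
    YBWalk (dom Dl) a z ≃ YBWalk (dom Dl) (mirrorRow c a) (mirrorRow c z) where
  toFun := mirrorWalk c (fun f hf => hsym f hf) rfl rfl
  invFun := mirrorWalk c (fun f hf => hsym f hf) (mirrorRow_mirrorRow c a) (mirrorRow_mirrorRow c z)
  left_inv γ := by
    ext1
    simp only [mirrorWalk_mids, List.map_map]
    conv_rhs => rw [← List.map_id γ.mids]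
    congr 1
    exact funext (mirrorRow_mirrorRow c)
  right_inv γ := by
    ext1
    simp only [mirrorWalk_mids, List.map_map]
    conv_rhs => rw [← List.map_id γ.mids]
    congr 1
    exact funext (mirrorRow_mirrorRow c)

/-! ## §4. Mirror covariance of the free-weight observable -/

/-- ★★ **MIRROR COVARIANCE of the free-weight square-lattice observable.** On a face list symmetric in the axis of
row `c`, for every complex weight system `W`, every phase `t`, every root `a` and end `z`:
`F_{W,t}(ρa → ρz) = F_{W.swap, t⁻¹}(a → z)` — the reflected walk has the corner-swapped weight and the opposite
quarter-turn count. [cite: GlazmanManolescu2019, §2.1, eq. (2.1) (Θ ≡ π/2)] [cite: GlazmanManolescu2019, §1, eq. (1)] -/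
theorem gmObservable_mirrorRow (W : CWeights) (t : ℂ) (c : ℤ) {Dl : List Face}
    (hsym : ∀ f ∈ Dl, mirrorRowFace c f ∈ Dl) (a z : MidEdge) :
    gmObservable W t Dl (mirrorRow c a) (mirrorRow c z) = gmObservable W.swap t⁻¹ Dl a z := by
  unfold gmObservable
  rw [← Equiv.sum_comp (mirrorWalkEquiv c hsym a z)]
  refine Finset.sum_congr rfl fun γ _ => ?_
  change weightL W (γ.mids.map (mirrorRow c)) * t ^ quarterTurnsL (γ.mids.map (mirrorRow c)) = _
  rw [weightL_map_mirrorRow, quarterTurnsL_map_mirrorRow, zpow_neg, inv_zpow]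

/-! ## §5. The printed weights: the reflection exchanges `θ` and `π − θ`; reality at `θ = π/2` -/


/-- ★ **The corner-swapped printed weights of angle `θ` are the printed weights of angle `π − θ`** — as printed:
«Replacing `θ` by `π − θ`, effectively exchanges `u₁` with `u₂` and `w₁` with `w₂`, but does not affect `v`» (reflecting a
rhombus of angle `θ` in a horizontal axis gives a rhombus of angle `π − θ`).
[cite: GlazmanManolescu2019, §1, remark after eq. (1) («Replacing θ by π−θ, effectively exchanges u₁ with u₂ and w₁ with w₂, but does not affect v»)] -/
theorem printedWeights_swap (θ : ℝ) : (printedWeights θ).swap = printedWeights (π - θ) := by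
  simp only [printedWeights, CWeights.swap, weightU1_pi_sub, weightU2_pi_sub, weightV_pi_sub, weightW1_pi_sub,
    weightW2_pi_sub]

/-- ★★ **MIRROR DUALITY `θ ↔ π − θ` of the printed observable**: on a face list symmetric in the axis of row `c`,
`F_θ(ρa → ρz; t) = F_{π−θ}(a → z; t⁻¹)` for every phase `t`. [cite: GlazmanManolescu2019, §2.1, eq. (2.1) (Θ ≡ π/2), eq. (1)] -/
theorem gmObservable_printed_mirrorRow (θ : ℝ) (t : ℂ) (c : ℤ) {Dl : List Face}
    (hsym : ∀ f ∈ Dl, mirrorRowFace c f ∈ Dl) (a z : MidEdge) :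
    gmObservable (printedWeights θ) t Dl (mirrorRow c a) (mirrorRow c z) =
      gmObservable (printedWeights (π - θ)) t⁻¹ Dl a z := by
  rw [gmObservable_mirrorRow _ _ _ hsym, printedWeights_swap]

/-- The printed observable at the conjugate phase is the conjugate (the weights are real).
[cite: GlazmanManolescu2019, §2.1, eq. (2.1), eq. (1) (real weights)] -/
theorem conj_gmObservable_printed (θ : ℝ) (t : ℂ) (Dl : List Face) (a z : MidEdge) :
    (starRingEnd ℂ) (gmObservable (printedWeights θ) t Dl a z) = gmObservable (printedWeights θ) ((starRingEnd ℂ) t) Dl a z := by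
  unfold gmObservable
  rw [map_sum]
  refine Finset.sum_congr rfl fun γ _ => ?_
  rw [map_mul, map_zpow₀]
  congr 1
  unfold weightL CWeights.mono printedWeights
  simp only [map_mul, map_pow, Complex.conj_ofReal]

/-- The spin-`5/8` quarter-turn phase is unimodular: `conj t = t⁻¹`. [cite: GlazmanManolescu2019, §2.1, eq. (2.1) (σ = 5/8)] -/
theorem conj_tFiveEighths : (starRingEnd ℂ) tFiveEighths = tFiveEighths⁻¹ := by
  unfold tFiveEighths
  rw [← Complex.exp_conj, ← Complex.exp_neg, map_neg, map_mul, map_div₀, map_mul, Complex.conj_I,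
    map_ofNat, Complex.conj_ofReal, map_ofNat]
  congr 1
  ring

/-- ★★ **At `θ = π/2` the reflection conjugates the printed observable**: on a face list symmetric in the axis of row
`c`, `F_{π/2}(ρa → ρz) = conj F_{π/2}(a → z)` (the model is self-dual at `θ = π/2`: `u₁ = u₂`, `w₁ = w₂`; the
quarter-turn count changes sign and `t̄ = t⁻¹`). [cite: GlazmanManolescu2019, §2.1, eq. (2.1), eq. (1)] -/
theorem gmObservable_printed_pi_div_two_mirrorRow (c : ℤ) {Dl : List Face} (hsym : ∀ f ∈ Dl, mirrorRowFace c f ∈ Dl)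
    (a z : MidEdge) :
    gmObservable (printedWeights (π / 2)) tFiveEighths Dl (mirrorRow c a) (mirrorRow c z) =
      (starRingEnd ℂ) (gmObservable (printedWeights (π / 2)) tFiveEighths Dl a z) := by
  rw [gmObservable_printed_mirrorRow _ _ _ hsym, show π - π / 2 = π / 2 by ring, conj_gmObservable_printed,
    conj_tFiveEighths]

/-- On the axis: a root on a vertical mid-edge of row `c`, the observable at a fixed mid-edge is REAL.
[cite: GlazmanManolescu2019, §2.1, eq. (2.1)] -/
theorem gmObservable_printed_pi_div_two_im_eq_zero_of_fixed (c : ℤ) {Dl : List Face}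
    (hsym : ∀ f ∈ Dl, mirrorRowFace c f ∈ Dl) (k₀ : ℤ) {z : MidEdge} (hz : mirrorRow c z = z) :
    (gmObservable (printedWeights (π / 2)) tFiveEighths Dl (.vert k₀ c) z).im = 0 := by
  have h := gmObservable_printed_pi_div_two_mirrorRow c hsym (.vert k₀ c) z
  rw [mirrorRow_vert_axis, hz] at h
  have := congrArg Complex.im h
  rw [Complex.conj_im] at this
  linarith

/-- The Yang–Baxter coefficient ratio at `θ = π/2` is `i`. [cite: GlazmanManolescu2019, Lemma 2.1, eq. (CR)] -/
theorem ybRatio_pi_div_two : ybRatio (π / 2) = Complex.I := by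
  unfold ybRatio
  rw [show ((3 * (π / 2) / 8 + 5 * π / 16 : ℝ) : ℂ) * Complex.I = (π / 2 : ℂ) * Complex.I by push_cast; ring,
    Complex.exp_mul_I]
  rw [show (π / 2 : ℂ) = ((π / 2 : ℝ) : ℂ) by push_cast; ring, ← Complex.ofReal_cos, ← Complex.ofReal_sin,
    Real.cos_pi_div_two, Real.sin_pi_div_two]
  simp

/-- ★ **On the axis the printed observable at angle `θ` is the conjugate of the one at `π − θ` at the reflected
mid-edge**: `F_θ(a → ρz) = conj F_{π−θ}(a → z)` for a root `a` on a vertical mid-edge of the axis row.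
[cite: GlazmanManolescu2019, §2.1, eq. (2.1), eq. (1)] -/
theorem gmObservable_printed_mirrorRow_eq_conj (θ : ℝ) (c : ℤ) {Dl : List Face}
    (hsym : ∀ f ∈ Dl, mirrorRowFace c f ∈ Dl) (k₀ : ℤ) (z : MidEdge) :
    gmObservable (printedWeights θ) tFiveEighths Dl (.vert k₀ c) (mirrorRow c z) =
      (starRingEnd ℂ) (gmObservable (printedWeights (π - θ)) tFiveEighths Dl (.vert k₀ c) z) := by
  have h := gmObservable_printed_mirrorRow θ tFiveEighths c hsym (.vert k₀ c) z
  rw [mirrorRow_vert_axis] at h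
  rw [h, conj_gmObservable_printed, conj_tFiveEighths]

/-- The coefficient ratios at `θ` and `π − θ`: `conj r(π − θ) = −r(θ)`. [cite: GlazmanManolescu2019, Lemma 2.1, eq. (CR)] -/
theorem conj_ybRatio_pi_sub (θ : ℝ) : (starRingEnd ℂ) (ybRatio (π - θ)) = -ybRatio θ := by
  unfold ybRatio
  rw [← Complex.exp_conj, map_mul, Complex.conj_ofReal, Complex.conj_I, neg_eq_neg_one_mul (Complex.exp _),
    ← Complex.exp_pi_mul_I, ← Complex.exp_add]
  have h2 : Complex.exp (((3 * θ / 8 + 5 * π / 16 : ℝ) : ℂ) * Complex.I + ↑π * Complex.I - 2 * ↑π * Complex.I) =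
      Complex.exp (↑π * Complex.I + ((3 * θ / 8 + 5 * π / 16 : ℝ) : ℂ) * Complex.I) := by
    rw [Complex.exp_sub, Complex.exp_two_pi_mul_I, div_one, add_comm]
  rw [← h2]
  congr 1
  push_cast
  ring

/-- ★★★ **MIRROR DUALITY `θ ↔ π − θ` OF THE VERTEX FUNCTIONAL.** On a finite face list symmetric under the reflection of
rows `j ↦ 2c − j`, for a root on ANY vertical mid-edge of the axis row `c` and ANY plaquette `(k, c)` of the axis row,
the Yang–Baxter vertex functional of the printed weights at angle `θ` is the COMPLEX CONJUGATE of the one at angle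
`π − θ`: `VF_θ = conj VF_{π−θ}` (`F_θ(z_E) = conj F_{π−θ}(z_E)`, `F_θ(z_S) = conj F_{π−θ}(z_N)`, …, and
`conj r(π − θ) = −r(θ)`). In particular the defects at `θ` and `π − θ` have the same modulus and the same zero set on
the axis, and at the self-dual angle `θ = π/2` the functional is REAL. [cite: GlazmanManolescu2019, Lemma 2.1, eq. (2.2) (CR)]
[cite: GlazmanManolescu2019, eq. (1) (the weights)] [cite: DuminilCopinSmirnov2012, Lemma 1 (shape of the relation)] -/
theorem vertexFunctional_printed_mirror_duality (θ : ℝ) (c : ℤ) {Dl : List Face}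
    (hsym : ∀ f ∈ Dl, mirrorRowFace c f ∈ Dl) (k₀ k : ℤ) :
    vertexFunctional (printedWeights θ) tFiveEighths (ybCoeff θ) Dl (.vert k₀ c) (k, c) =
      (starRingEnd ℂ) (vertexFunctional (printedWeights (π - θ)) tFiveEighths (ybCoeff (π - θ)) Dl (.vert k₀ c) (k, c)) := by
  set F : MidEdge → ℂ := fun z => gmObservable (printedWeights θ) tFiveEighths Dl (.vert k₀ c) z with hF
  set F' : MidEdge → ℂ := fun z => gmObservable (printedWeights (π - θ)) tFiveEighths Dl (.vert k₀ c) z with hF'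
  have key : ∀ s : Side, F (Face.side (k, c) s) = (starRingEnd ℂ) (F' (Face.side (k, c) (mirrorSide s))) := by
    intro s
    have h := gmObservable_printed_mirrorRow_eq_conj θ c hsym k₀ (Face.side (k, c) (mirrorSide s))
    rw [mirrorRow_side, mirrorRowFace_axis, mirrorSide_mirrorSide] at h
    exact h
  unfold vertexFunctional
  simp only [Fin.sum_univ_four, slotSide, ybCoeff, Matrix.cons_val_zero, Matrix.cons_val_one, Matrix.cons_val]
  change 1 * F (Face.side (k, c) .E) + ybRatio θ * F (Face.side (k, c) .N) + -1 * F (Face.side (k, c) .W) +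
      -ybRatio θ * F (Face.side (k, c) .S) =
    (starRingEnd ℂ) (1 * F' (Face.side (k, c) .E) + ybRatio (π - θ) * F' (Face.side (k, c) .N) +
      -1 * F' (Face.side (k, c) .W) + -ybRatio (π - θ) * F' (Face.side (k, c) .S))
  rw [key .E, key .N, key .W, key .S]
  simp only [mirrorSide, map_add, map_mul, map_neg, map_one, conj_ybRatio_pi_sub]
  ring

/-- ★ **Same modulus at `θ` and `π − θ`** on the axis of a mirror-symmetric face list. [cite: GlazmanManolescu2019, Lemma 2.1, eq. (2.2) (CR)] -/
theorem norm_vertexFunctional_printed_mirror (θ : ℝ) (c : ℤ) {Dl : List Face}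
    (hsym : ∀ f ∈ Dl, mirrorRowFace c f ∈ Dl) (k₀ k : ℤ) :
    ‖vertexFunctional (printedWeights θ) tFiveEighths (ybCoeff θ) Dl (.vert k₀ c) (k, c)‖ =
      ‖vertexFunctional (printedWeights (π - θ)) tFiveEighths (ybCoeff (π - θ)) Dl (.vert k₀ c) (k, c)‖ := by
  rw [vertexFunctional_printed_mirror_duality θ c hsym, Complex.norm_conj]

/-- ★ **Same zero set at `θ` and `π − θ`** on the axis of a mirror-symmetric face list (so the lane's exact zero
tables at the dual generic angles `5π/12` and `7π/12` must agree on axis cells, as they do).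
[cite: GlazmanManolescu2019, Lemma 2.1, eq. (2.2) (CR)] -/
theorem vertexFunctional_printed_eq_zero_iff_mirror (θ : ℝ) (c : ℤ) {Dl : List Face}
    (hsym : ∀ f ∈ Dl, mirrorRowFace c f ∈ Dl) (k₀ k : ℤ) :
    vertexFunctional (printedWeights θ) tFiveEighths (ybCoeff θ) Dl (.vert k₀ c) (k, c) = 0 ↔
      vertexFunctional (printedWeights (π - θ)) tFiveEighths (ybCoeff (π - θ)) Dl (.vert k₀ c) (k, c) = 0 := by
  rw [vertexFunctional_printed_mirror_duality θ c hsym, map_eq_zero]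

/-- ★★★ **MIRROR REALITY at `θ = π/2`.** On a finite face list symmetric under the reflection of rows `j ↦ 2c − j`,
for a root on ANY vertical mid-edge of the axis row `c` (interior or not) and ANY plaquette `(k, c)` of the axis row,
the Yang–Baxter vertex functional `F(z_E) + r F(z_N) − F(z_W) − r F(z_S)` of the printed weights at `θ = π/2`
(`r(π/2) = i`) is REAL: `F(z_E)`, `F(z_W)` are real (fixed mid-edges), `F(z_S) = conj F(z_N)` (exchanged ones).
With the lane's far-cell half law («`Re VF(far cell) = 0`», conditional on the prefix turning rigidity (R2), the
catalogue's `PlaquetteWalkHoleRootFarCellLaw`) this is the mechanism of the lane's (R-9′) MIRROR ZEROS: on a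
mirror-symmetric holed domain the far cell of the hole root carries NO defect at `θ = π/2` — and at `θ = π/2` only
(the printed weights are mirror-invariant iff `θ = π/2`, `printedWeights_swap`). [cite: GlazmanManolescu2019, Lemma 2.1, eq. (2.2) (CR)]
[cite: DuminilCopinSmirnov2012, Lemma 1 (shape of the relation)] -/
theorem vertexFunctional_printed_pi_div_two_im_eq_zero_of_mirror (c : ℤ) {Dl : List Face}
    (hsym : ∀ f ∈ Dl, mirrorRowFace c f ∈ Dl) (k₀ k : ℤ) :
    (vertexFunctional (printedWeights (π / 2)) tFiveEighths (ybCoeff (π / 2)) Dl (.vert k₀ c) (k, c)).im = 0 := by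
  have h := vertexFunctional_printed_mirror_duality (π / 2) c hsym k₀ k
  rw [show π - π / 2 = π / 2 by ring] at h
  exact Complex.conj_eq_iff_im.1 h.symm

/-- ★★ **The (R-9′) mechanism**: on a mirror-symmetric face list, at `θ = π/2`, an axis plaquette at which the REAL
PART of the vertex functional vanishes carries no defect at all. (The far-cell half law supplies `Re = 0` at the far
cell of a hole root, conditionally on the prefix turning rigidity (R2).) [cite: GlazmanManolescu2019, Lemma 2.1, eq. (2.2) (CR)] -/
theorem vertexFunctional_printed_pi_div_two_eq_zero_of_mirror_of_re_eq_zero (c : ℤ) {Dl : List Face}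
    (hsym : ∀ f ∈ Dl, mirrorRowFace c f ∈ Dl) (k₀ k : ℤ)
    (hre : (vertexFunctional (printedWeights (π / 2)) tFiveEighths (ybCoeff (π / 2)) Dl (.vert k₀ c) (k, c)).re = 0) :
    vertexFunctional (printedWeights (π / 2)) tFiveEighths (ybCoeff (π / 2)) Dl (.vert k₀ c) (k, c) = 0 :=
  Complex.ext hre (vertexFunctional_printed_pi_div_two_im_eq_zero_of_mirror c hsym k₀ k)

/-! ## §6. Instances: the lane's mirror-symmetric holed boxes -/

/-- The lane's `sq5hole`: the `5 × 5` box minus its centre `(2, 2)`, listed row by row.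
[cite: GlazmanManolescu2019, §2.1 (finite domains of faces)] -/
def sq5hole : List Face :=
  [(0, 0), (1, 0), (2, 0), (3, 0), (4, 0), (0, 1), (1, 1), (2, 1), (3, 1), (4, 1), (0, 2), (1, 2), (3, 2), (4, 2),
    (0, 3), (1, 3), (2, 3), (3, 3), (4, 3), (0, 4), (1, 4), (2, 4), (3, 4), (4, 4)]

/-- `sq5hole` is symmetric in the axis of its middle row. [cite: GlazmanManolescu2019, §2.1 (finite domains of faces; walks as sequences of mid-edges)] -/
theorem sq5hole_symmetric : ∀ f ∈ sq5hole, mirrorRowFace 2 f ∈ sq5hole := by decide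

/-- ★ **The (R-9′) far cell of `sq5hole`**: rooted at the `E` side of the hole (the `W` side of the root plaquette
`(3, 2)`), the far cell `(1, 2)` has a REAL vertex functional at `θ = π/2`; at every `θ` the functionals at `θ`
and `π − θ` there are conjugate. (The lane's exact enumerations: `VF(1,2) = 0` at `θ = π/2`, `≠ 0` at `5π/12`,
`7π/12`, where it is purely imaginary — HOME findings «(R-9) thin box», «hole-neighbour directions».)
[cite: GlazmanManolescu2019, Lemma 2.1, eq. (2.2) (CR)] -/
theorem vertexFunctional_printed_sq5hole_farCell_im_eq_zero :
    (vertexFunctional (printedWeights (π / 2)) tFiveEighths (ybCoeff (π / 2)) sq5hole (.vert 3 2) (1, 2)).im = 0 :=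
  vertexFunctional_printed_pi_div_two_im_eq_zero_of_mirror 2 sq5hole_symmetric 3 1

/-- The duality at the far cell of `sq5hole`, every `θ`. [cite: GlazmanManolescu2019, Lemma 2.1, eq. (2.2) (CR)] -/
theorem vertexFunctional_printed_sq5hole_farCell_duality (θ : ℝ) :
    vertexFunctional (printedWeights θ) tFiveEighths (ybCoeff θ) sq5hole (.vert 3 2) (1, 2) =
      (starRingEnd ℂ) (vertexFunctional (printedWeights (π - θ)) tFiveEighths (ybCoeff (π - θ)) sq5hole (.vert 3 2) (1, 2)) :=
  vertexFunctional_printed_mirror_duality θ 2 sq5hole_symmetric 3 1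

/-- ★ The ROOT's OWN plaquette `(3, 2)` of `sq5hole` lies on the axis too: its functional is real at `θ = π/2`
(the root-plaquette defect law of the catalogue then pins it to one real half-line). [cite: GlazmanManolescu2019, Lemma 2.1, eq. (2.2) (CR)] -/
theorem vertexFunctional_printed_sq5hole_rootPlaquette_im_eq_zero :
    (vertexFunctional (printedWeights (π / 2)) tFiveEighths (ybCoeff (π / 2)) sq5hole (.vert 3 2) (3, 2)).im = 0 :=
  vertexFunctional_printed_pi_div_two_im_eq_zero_of_mirror 2 sq5hole_symmetric 3 3

/-- The venture lane's BENCH row 179 domain: the `7 × 5` box minus `(2, 2)`, listed row by row.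
[cite: GlazmanManolescu2019, §2.1 (finite domains of faces)] -/
def box75hole : List Face :=
  [(0, 0), (1, 0), (2, 0), (3, 0), (4, 0), (5, 0), (6, 0), (0, 1), (1, 1), (2, 1), (3, 1), (4, 1), (5, 1), (6, 1),
    (0, 2), (1, 2), (3, 2), (4, 2), (5, 2), (6, 2), (0, 3), (1, 3), (2, 3), (3, 3), (4, 3), (5, 3), (6, 3),
    (0, 4), (1, 4), (2, 4), (3, 4), (4, 4), (5, 4), (6, 4)]

/-- `box75hole` is symmetric in the axis of its middle row (it is NOT left-right symmetric about the hole).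
[cite: GlazmanManolescu2019, §2.1 (finite domains of faces; walks as sequences of mid-edges)] -/
theorem box75hole_symmetric : ∀ f ∈ box75hole, mirrorRowFace 2 f ∈ box75hole := by decide

/-- ★ On `7 × 5 ∖ (2,2)`, rooted at the `E` side of the hole, the far cell `(1, 2)` has a real functional at
`θ = π/2` — left-right symmetry is not needed, only the symmetry in the root's row.
[cite: GlazmanManolescu2019, Lemma 2.1, eq. (2.2) (CR)] -/
theorem vertexFunctional_printed_box75hole_farCell_im_eq_zero :
    (vertexFunctional (printedWeights (π / 2)) tFiveEighths (ybCoeff (π / 2)) box75hole (.vert 3 2) (1, 2)).im = 0 :=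
  vertexFunctional_printed_pi_div_two_im_eq_zero_of_mirror 2 box75hole_symmetric 3 1

/-- ★ Rooted at the `W` side of the hole instead (root plaquette `(1, 2)`), the far cell is `(3, 2)`: real at
`θ = π/2` as well. [cite: GlazmanManolescu2019, Lemma 2.1, eq. (2.2) (CR)] -/
theorem vertexFunctional_printed_box75hole_farCell_W_im_eq_zero :
    (vertexFunctional (printedWeights (π / 2)) tFiveEighths (ybCoeff (π / 2)) box75hole (.vert 2 2) (3, 2)).im = 0 :=
  vertexFunctional_printed_pi_div_two_im_eq_zero_of_mirror 2 box75hole_symmetric 2 3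

/-- Named statement **`PlaquetteWalkMirrorDuality`**: on every finite face list symmetric under the reflection
of rows `j ↦ 2c − j`, for every root on a vertical mid-edge of the axis row and every axis plaquette, the
Yang–Baxter vertex functional of the printed weights satisfies `VF_θ = conj VF_{π−θ}`; in particular it is real
at `θ = π/2`. [cite: GlazmanManolescu2019, Lemma 2.1, eq. (2.2) (CR)] -/
def PlaquetteWalkMirrorDuality : Prop :=
  ∀ (θ : ℝ) (c : ℤ) (Dl : List Face), (∀ f ∈ Dl, mirrorRowFace c f ∈ Dl) → ∀ k₀ k : ℤ,
    vertexFunctional (printedWeights θ) tFiveEighths (ybCoeff θ) Dl (.vert k₀ c) (k, c) =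
      (starRingEnd ℂ) (vertexFunctional (printedWeights (π - θ)) tFiveEighths (ybCoeff (π - θ)) Dl (.vert k₀ c) (k, c))

/-- `PlaquetteWalkMirrorDuality` holds. [cite: GlazmanManolescu2019, Lemma 2.1, eq. (2.2) (CR)] -/
theorem PlaquetteWalkMirrorDuality_holds : PlaquetteWalkMirrorDuality :=
  fun θ c _ hsym k₀ k => vertexFunctional_printed_mirror_duality θ c hsym k₀ k

end Literature.Barriers.CriticalPhenomena.PlaquetteWalk

/-! ## §7. The reflection of an ARBITRARY face list: general covariance and the duality `θ ↔ π − θ` for every domain -/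

namespace Literature.Barriers.CriticalPhenomena.PlaquetteWalk

open Literature.Probability.RandomPlanarGeometry.SAW.YangBaxter
open Literature.Probability.RandomPlanarGeometry.SAW.YangBaxter.MidEdge
open Real Complex MirrorWalk

/-- Membership in the reflected face list. [cite: GlazmanManolescu2019, §2.1 (finite domains of faces)] -/
theorem mem_dom_map_mirrorRowFace (c : ℤ) (Dl : List Face) (f : Face) :
    f ∈ dom (Dl.map (mirrorRowFace c)) ↔ mirrorRowFace c f ∈ dom Dl := by
  change f ∈ Dl.map (mirrorRowFace c) ↔ mirrorRowFace c f ∈ Dl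
  rw [List.mem_map]
  constructor
  · rintro ⟨g, hg, rfl⟩; rwa [mirrorRowFace_mirrorRowFace]
  · intro h; exact ⟨_, h, mirrorRowFace_mirrorRowFace c f⟩

/-- **The reflection is a bijection between the walks of a face list and the walks of the reflected face list.**
[cite: GlazmanManolescu2019, §1 (definition of the model)] -/
def mirrorWalkEquivMap (c : ℤ) (Dl : List Face) (a z : MidEdge) :
    YBWalk (dom Dl) a z ≃ YBWalk (dom (Dl.map (mirrorRowFace c))) (mirrorRow c a) (mirrorRow c z) where
  toFun := mirrorWalk c (fun f hf => (mem_dom_map_mirrorRowFace c Dl _).2 (by rwa [mirrorRowFace_mirrorRowFace])) rfl rfl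
  invFun := mirrorWalk c (fun f hf => (mem_dom_map_mirrorRowFace c Dl f).1 hf) (mirrorRow_mirrorRow c a)
    (mirrorRow_mirrorRow c z)
  left_inv γ := by
    ext1
    simp only [mirrorWalk_mids, List.map_map]
    conv_rhs => rw [← List.map_id γ.mids]
    congr 1
    exact funext (mirrorRow_mirrorRow c)
  right_inv γ := by
    ext1
    simp only [mirrorWalk_mids, List.map_map]
    conv_rhs => rw [← List.map_id γ.mids]
    congr 1
    exact funext (mirrorRow_mirrorRow c)


/-- ★ **Self-duality holds at `θ = π/2` ONLY**: on `[π/3, 2π/3]` the printed weights are invariant under the corner swap iff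
`θ = π/2` (the tree's anisotropy lemma `weightU1_eq_weightU2_iff`) — the reason the lane's mirror zeros occur at `π/2` and at no
other angle. [cite: GlazmanManolescu2019, §1, eq. (1) and the remark after it (θ ↔ π − θ)] -/
theorem printedWeights_swap_eq_self_iff {θ : ℝ} (hθ : θ ∈ Set.Icc (π / 3) (2 * π / 3)) :
    (printedWeights θ).swap = printedWeights θ ↔ θ = π / 2 := by
  constructor
  · intro h
    have h1 : ((weightU2 θ : ℝ) : ℂ) = (weightU1 θ : ℂ) := congrArg CWeights.u₁ h
    exact (weightU1_eq_weightU2_iff hθ).1 (Complex.ofReal_injective h1).symm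
  · rintro rfl
    rw [printedWeights_swap, show π - π / 2 = π / 2 by ring]

/-- ★★ **MIRROR COVARIANCE for an arbitrary face list**: the observable of the REFLECTED list between reflected
mid-edges is the corner-swapped, phase-inverted observable of the list: `F^{ρD}_{W,t}(ρa → ρz) = F^{D}_{W.swap,t⁻¹}(a → z)`.
[cite: GlazmanManolescu2019, §2.1, eq. (2.1) (Θ ≡ π/2)] [cite: GlazmanManolescu2019, §1, eq. (1)] -/
theorem gmObservable_map_mirrorRow (W : CWeights) (t : ℂ) (c : ℤ) (Dl : List Face) (a z : MidEdge) :
    gmObservable W t (Dl.map (mirrorRowFace c)) (mirrorRow c a) (mirrorRow c z) = gmObservable W.swap t⁻¹ Dl a z := by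
  unfold gmObservable
  rw [← Equiv.sum_comp (mirrorWalkEquivMap c Dl a z)]
  refine Finset.sum_congr rfl fun γ _ => ?_
  change weightL W (γ.mids.map (mirrorRow c)) * t ^ quarterTurnsL (γ.mids.map (mirrorRow c)) = _
  rw [weightL_map_mirrorRow, quarterTurnsL_map_mirrorRow, zpow_neg, inv_zpow]

/-- The printed observable of the reflected list: `F^{ρD}_θ(ρa → ρz) = conj F^{D}_{π−θ}(a → z)` — for EVERY face list and
EVERY root. (The hexagonal-lattice precedent, for a domain symmetric about the real axis: «The symmetry of our domain
implies that F(z̄) = F̄(z)», Duminil-Copin–Smirnov, proof of Lemma 2; here the Yang–Baxter weights add the exchange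
`θ ↔ π − θ`.) [cite: GlazmanManolescu2019, §2.1, eq. (2.1), eq. (1)]
[cite: DuminilCopinSmirnov2012, proof of Lemma 2 («The symmetry of our domain implies that F(z̄) = F̄(z)»)] -/
theorem gmObservable_printed_map_mirrorRow_eq_conj (θ : ℝ) (c : ℤ) (Dl : List Face) (a z : MidEdge) :
    gmObservable (printedWeights θ) tFiveEighths (Dl.map (mirrorRowFace c)) (mirrorRow c a) (mirrorRow c z) =
      (starRingEnd ℂ) (gmObservable (printedWeights (π - θ)) tFiveEighths Dl a z) := by
  rw [gmObservable_map_mirrorRow, printedWeights_swap, conj_gmObservable_printed, conj_tFiveEighths]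

/-- The coefficient ratios at `θ` and `π − θ`, mirrored form: `conj r(θ) = −r(π − θ)`. [cite: GlazmanManolescu2019, Lemma 2.1, eq. (CR)] -/
theorem conj_ybRatio (θ : ℝ) : (starRingEnd ℂ) (ybRatio θ) = -ybRatio (π - θ) := by
  have h := conj_ybRatio_pi_sub (π - θ)
  rwa [sub_sub_cancel] at h

/-- ★★★ **MIRROR DUALITY `θ ↔ π − θ` FOR EVERY DOMAIN.** For EVERY finite face list `Dl`, EVERY root mid-edge `a` and
EVERY plaquette `f₀`, the Yang–Baxter vertex functional of the printed weights at angle `θ` on the REFLECTED data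
`(ρDl, ρa, ρf₀)` is the complex conjugate of the one at angle `π − θ` on `(Dl, a, f₀)`:
`VF_θ(ρDl; ρa; ρf₀) = conj VF_{π−θ}(Dl; a; f₀)`. So the lane's exact defect tables at `θ` and at `π − θ` are mirror
images of each other, hole roots included — in particular the endpoint degeneracies `θ = π/3` (`w₂ = 0`) and
`θ = 2π/3` (`w₁ = 0`) correspond under the reflection. (The axis statements of §5 are the case `ρDl = Dl`, `ρa = a`,
`ρf₀ = f₀`.) [cite: GlazmanManolescu2019, Lemma 2.1, eq. (2.2) (CR)] [cite: GlazmanManolescu2019, eq. (1) (the weights)]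
[cite: DuminilCopinSmirnov2012, Lemma 1 (shape of the relation)] -/
theorem vertexFunctional_printed_map_mirrorRow_duality (θ : ℝ) (c : ℤ) (Dl : List Face) (a : MidEdge) (f₀ : Face) :
    vertexFunctional (printedWeights θ) tFiveEighths (ybCoeff θ) (Dl.map (mirrorRowFace c)) (mirrorRow c a)
        (mirrorRowFace c f₀) =
      (starRingEnd ℂ) (vertexFunctional (printedWeights (π - θ)) tFiveEighths (ybCoeff (π - θ)) Dl a f₀) := by
  set F : MidEdge → ℂ := fun z => gmObservable (printedWeights θ) tFiveEighths (Dl.map (mirrorRowFace c)) (mirrorRow c a) z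
    with hF
  set F' : MidEdge → ℂ := fun z => gmObservable (printedWeights (π - θ)) tFiveEighths Dl a z with hF'
  have key : ∀ s : Side, F ((mirrorRowFace c f₀).side s) = (starRingEnd ℂ) (F' (f₀.side (mirrorSide s))) := by
    intro s
    have h := gmObservable_printed_map_mirrorRow_eq_conj θ c Dl a (f₀.side (mirrorSide s))
    rw [mirrorRow_side, mirrorSide_mirrorSide] at h
    exact h
  unfold vertexFunctional
  simp only [Fin.sum_univ_four, slotSide, ybCoeff, Matrix.cons_val_zero, Matrix.cons_val_one, Matrix.cons_val]
  change 1 * F ((mirrorRowFace c f₀).side .E) + ybRatio θ * F ((mirrorRowFace c f₀).side .N) +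
      -1 * F ((mirrorRowFace c f₀).side .W) + -ybRatio θ * F ((mirrorRowFace c f₀).side .S) =
    (starRingEnd ℂ) (1 * F' (f₀.side .E) + ybRatio (π - θ) * F' (f₀.side .N) + -1 * F' (f₀.side .W) +
      -ybRatio (π - θ) * F' (f₀.side .S))
  rw [key .E, key .N, key .W, key .S]
  simp only [mirrorSide, map_add, map_mul, map_neg, map_one, conj_ybRatio_pi_sub]
  ring

/-- ★ **Mirror-image zero sets**: `VF_θ` vanishes at `(ρDl, ρa, ρf₀)` iff `VF_{π−θ}` vanishes at `(Dl, a, f₀)`.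
[cite: GlazmanManolescu2019, Lemma 2.1, eq. (2.2) (CR)] -/
theorem vertexFunctional_printed_map_mirrorRow_eq_zero_iff (θ : ℝ) (c : ℤ) (Dl : List Face) (a : MidEdge) (f₀ : Face) :
    vertexFunctional (printedWeights θ) tFiveEighths (ybCoeff θ) (Dl.map (mirrorRowFace c)) (mirrorRow c a)
        (mirrorRowFace c f₀) = 0 ↔
      vertexFunctional (printedWeights (π - θ)) tFiveEighths (ybCoeff (π - θ)) Dl a f₀ = 0 := by
  rw [vertexFunctional_printed_map_mirrorRow_duality, map_eq_zero]

/-- ★ **Mirror-image moduli**: `‖VF_θ(ρDl; ρa; ρf₀)‖ = ‖VF_{π−θ}(Dl; a; f₀)‖`. [cite: GlazmanManolescu2019, Lemma 2.1, eq. (2.2) (CR)] -/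
theorem norm_vertexFunctional_printed_map_mirrorRow (θ : ℝ) (c : ℤ) (Dl : List Face) (a : MidEdge) (f₀ : Face) :
    ‖vertexFunctional (printedWeights θ) tFiveEighths (ybCoeff θ) (Dl.map (mirrorRowFace c)) (mirrorRow c a)
        (mirrorRowFace c f₀)‖ =
      ‖vertexFunctional (printedWeights (π - θ)) tFiveEighths (ybCoeff (π - θ)) Dl a f₀‖ := by
  rw [vertexFunctional_printed_map_mirrorRow_duality, Complex.norm_conj]

end Literature.Barriers.CriticalPhenomena.PlaquetteWalk

/-! ## §7. The twin reflection in the axis of a COLUMN: `VF_θ = −conj VF_{π−θ}`; purely imaginary at `θ = π/2` -/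

namespace Literature.Barriers.CriticalPhenomena.PlaquetteWalk

open Literature.Probability.RandomPlanarGeometry.SAW.YangBaxter
open Literature.Probability.RandomPlanarGeometry.SAW.YangBaxter.MidEdge
open Real Complex

/-- **Reflection in the vertical axis of column `c`** on mid-edges: columns `k ↦ 2c − k`; the slanted (horizontal)
mid-edges of column `c` are fixed, the left side of column `k` goes to the right side of column `2c − k`.
[cite: GlazmanManolescu2019, §1 (the lattice of rhombi and its mid-edges)] -/
def mirrorCol (c : ℤ) : MidEdge → MidEdge
  | .vert k j => .vert (2 * c + 1 - k) j
  | .slant k j => .slant (2 * c - k) j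

/-- The column reflection on faces. [cite: GlazmanManolescu2019, §1 (the lattice of rhombi and its mid-edges)] -/
def mirrorColFace (c : ℤ) (f : Face) : Face := (2 * c - f.1, f.2)

/-- The column reflection on the sides of a face: `W ↔ E`, `N`, `S` fixed. [cite: GlazmanManolescu2019, §1, Fig. 4 (z_W, z_E, z_S, z_N)] -/
def mirrorColSide : Side → Side
  | .N => .N
  | .S => .S
  | .W => .E
  | .E => .W

/-- The column reflection is an involution on mid-edges. [cite: GlazmanManolescu2019, §1 (the lattice of rhombi and its mid-edges)] -/
@[simp] theorem mirrorCol_mirrorCol (c : ℤ) (e : MidEdge) : mirrorCol c (mirrorCol c e) = e := by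
  cases e <;> simp [mirrorCol]

/-- The column reflection is an involution on faces. [cite: GlazmanManolescu2019, §1 (the lattice of rhombi and its mid-edges)] -/
@[simp] theorem mirrorColFace_mirrorColFace (c : ℤ) (f : Face) : mirrorColFace c (mirrorColFace c f) = f := by
  obtain ⟨k, j⟩ := f; simp [mirrorColFace]

/-- The column reflection is an involution on sides. [cite: GlazmanManolescu2019, §1, Fig. 4] -/
@[simp] theorem mirrorColSide_mirrorColSide (s : Side) : mirrorColSide (mirrorColSide s) = s := by
  cases s <;> rfl

/-- The column reflection is injective on mid-edges. [cite: GlazmanManolescu2019, §1 (the lattice of rhombi and its mid-edges)] -/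
theorem mirrorCol_injective (c : ℤ) : Function.Injective (mirrorCol c) :=
  Function.LeftInverse.injective (mirrorCol_mirrorCol c)

/-- The column reflection is injective on faces. [cite: GlazmanManolescu2019, §1 (the lattice of rhombi and its mid-edges)] -/
theorem mirrorColFace_injective (c : ℤ) : Function.Injective (mirrorColFace c) :=
  Function.LeftInverse.injective (mirrorColFace_mirrorColFace c)

/-- Sides are equivariant under the column reflection. [cite: GlazmanManolescu2019, §1, Fig. 4 (z_W, z_E, z_S, z_N)] -/
theorem mirrorCol_side (c : ℤ) (f : Face) (s : Side) :
    mirrorCol c (f.side s) = (mirrorColFace c f).side (mirrorColSide s) := by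
  obtain ⟨k, j⟩ := f
  cases s
  · simp [mirrorCol, mirrorColFace, mirrorColSide, Face.side]; ring
  · simp [mirrorCol, mirrorColFace, mirrorColSide, Face.side]
  · simp [mirrorCol, mirrorColFace, mirrorColSide, Face.side]
  · simp [mirrorCol, mirrorColFace, mirrorColSide, Face.side]

/-- A slanted mid-edge of the axis column is fixed. [cite: GlazmanManolescu2019, §1 (the lattice of rhombi and its mid-edges)] -/
@[simp] theorem mirrorCol_slant_axis (c j : ℤ) : mirrorCol c (.slant c j) = .slant c j := by
  simp [mirrorCol]; ring

/-- A face of the axis column is fixed. [cite: GlazmanManolescu2019, §1 (the lattice of rhombi and its mid-edges)] -/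
@[simp] theorem mirrorColFace_axis (c j : ℤ) : mirrorColFace c (c, j) = (c, j) := by
  simp [mirrorColFace]; ring

/-- `f.side s = e` is reflected (columns). [cite: GlazmanManolescu2019, §1 (the lattice of rhombi and its mid-edges)] -/
theorem side_eq_iff_mirrorCol (c : ℤ) (f : Face) (s : Side) (e : MidEdge) :
    (mirrorColFace c f).side (mirrorColSide s) = mirrorCol c e ↔ f.side s = e := by
  rw [← mirrorCol_side]
  exact (mirrorCol_injective c).eq_iff

/-- `∃ s, f.side s = e` is reflected (columns). [cite: GlazmanManolescu2019, §1 (the lattice of rhombi and its mid-edges)] -/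
theorem exists_side_eq_iff_mirrorCol (c : ℤ) (f : Face) (e : MidEdge) :
    (∃ s, (mirrorColFace c f).side s = mirrorCol c e) ↔ ∃ s, f.side s = e := by
  constructor
  · rintro ⟨s, hs⟩
    refine ⟨mirrorColSide s, ?_⟩
    rw [← side_eq_iff_mirrorCol c, mirrorColSide_mirrorColSide]
    exact hs
  · rintro ⟨s, hs⟩
    exact ⟨mirrorColSide s, (side_eq_iff_mirrorCol c f s e).2 hs⟩

/-- Common faces are equivariant (columns). [cite: GlazmanManolescu2019, §1 (the lattice of rhombi and its mid-edges)] -/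
theorem commonFace_mirrorCol (c : ℤ) (e e' : MidEdge) :
    commonFace (mirrorCol c e) (mirrorCol c e') = (commonFace e e').map (mirrorColFace c) := by
  cases h : commonFace e e' with
  | some f =>
    rw [Option.map_some]
    rw [MidEdge.commonFace_eq_some_iff] at h ⊢
    exact ⟨(mirrorCol_injective c).ne h.1, (exists_side_eq_iff_mirrorCol c f e).2 h.2.1,
      (exists_side_eq_iff_mirrorCol c f e').2 h.2.2⟩
  | none =>
    rw [Option.map_none]
    cases h' : commonFace (mirrorCol c e) (mirrorCol c e') with
    | none => rfl
    | some g =>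
      exfalso
      rw [MidEdge.commonFace_eq_some_iff] at h'
      have key : commonFace e e' = some (mirrorColFace c g) := by
        rw [MidEdge.commonFace_eq_some_iff]
        refine ⟨fun hh => h'.1 (by rw [hh]), ?_, ?_⟩
        · rw [← exists_side_eq_iff_mirrorCol c, mirrorColFace_mirrorColFace]; exact h'.2.1
        · rw [← exists_side_eq_iff_mirrorCol c, mirrorColFace_mirrorColFace]; exact h'.2.2
      rw [h] at key
      exact Option.some_ne_none _ key.symm

/-- `sideOf` is equivariant (columns). [cite: GlazmanManolescu2019, §1 (the lattice of rhombi and its mid-edges)] -/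
theorem sideOf_mirrorCol (c : ℤ) (f : Face) (e : MidEdge) :
    (mirrorColFace c f).sideOf (mirrorCol c e) = (f.sideOf e).map mirrorColSide := by
  cases h : f.sideOf e with
  | some s =>
    rw [Option.map_some, Face.sideOf_eq_some_iff, side_eq_iff_mirrorCol]
    exact (Face.sideOf_eq_some_iff f e s).1 h
  | none =>
    rw [Option.map_none]
    cases h' : (mirrorColFace c f).sideOf (mirrorCol c e) with
    | none => rfl
    | some s =>
      exfalso
      rw [Face.sideOf_eq_some_iff] at h'
      have key : f.sideOf e = some (mirrorColSide s) := by
        rw [Face.sideOf_eq_some_iff, ← side_eq_iff_mirrorCol c, mirrorColSide_mirrorColSide]; exact h'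
      rw [h] at key
      exact Option.some_ne_none _ key.symm

/-- The column-reflected arc. [folklore] -/
abbrev mirrorColArc (c : ℤ) (p : MidEdge × MidEdge) : MidEdge × MidEdge := Prod.map (mirrorCol c) (mirrorCol c) p

/-- Arc faces are equivariant (columns). [cite: GlazmanManolescu2019, §1] -/
theorem arcFace_mirrorColArc (c : ℤ) (p : MidEdge × MidEdge) :
    arcFace (mirrorColArc c p) = (arcFace p).map (mirrorColFace c) :=
  commonFace_mirrorCol c p.1 p.2

/-- The kind of the column-reflected arc: corner ↔ co-corner again. [cite: GlazmanManolescu2019, Fig. 1] -/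
theorem arcKind_mirrorColSide (s t : Side) : arcKind (mirrorColSide s) (mirrorColSide t) = mirrorKind (arcKind s t) := by
  cases s <;> cases t <;> rfl

/-- Arc kinds are equivariant (columns). [cite: GlazmanManolescu2019, Fig. 1] -/
theorem arcKindOf_mirrorColArc (c : ℤ) (p : MidEdge × MidEdge) :
    arcKindOf (mirrorColArc c p) = (arcKindOf p).map mirrorKind := by
  unfold arcKindOf
  rw [arcFace_mirrorColArc]
  cases arcFace p with
  | none => rfl
  | some f =>
    simp only [Option.map_some, Option.bind_some, mirrorColArc, Prod.map_fst, Prod.map_snd, sideOf_mirrorCol]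
    cases f.sideOf p.1 with
    | none => simp
    | some s =>
      cases f.sideOf p.2 with
      | none => simp
      | some t => simp [arcKind_mirrorColSide]

/-- The column reflection negates the signed quarter turn. [cite: GlazmanManolescu2019, §2.1 (definition of wind(γ))] -/
theorem qTurn_mirrorColSide (s t : Side) : qTurn (mirrorColSide s) (mirrorColSide t) = -qTurn s t := by
  cases s <;> cases t <;> rfl

/-- Quarter turns are odd under the column reflection. [cite: GlazmanManolescu2019, §2.1 (definition of wind(γ))] -/
theorem qTurnOf_mirrorColArc (c : ℤ) (p : MidEdge × MidEdge) : qTurnOf (mirrorColArc c p) = -qTurnOf p := by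
  unfold qTurnOf
  rw [arcFace_mirrorColArc]
  cases arcFace p with
  | none => simp
  | some f =>
    simp only [Option.map_some, mirrorColArc, Prod.map_fst, Prod.map_snd, sideOf_mirrorCol]
    cases f.sideOf p.1 with
    | none => simp
    | some s =>
      cases f.sideOf p.2 with
      | none => simp
      | some t => simp [qTurn_mirrorColSide]

/-- The arcs of the column-reflected list. [cite: GlazmanManolescu2019, §2.1 (finite domains of faces; walks as sequences of mid-edges)] -/
theorem arcsOf_map_mirrorCol (c : ℤ) (l : List MidEdge) :
    arcsOf (l.map (mirrorCol c)) = (arcsOf l).map (mirrorColArc c) := by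
  unfold arcsOf
  rw [← List.map_tail, List.zip_map]

/-- The quarter-turn count of the column-reflected list is the negative. [cite: GlazmanManolescu2019, §2.1 (definition of wind(γ))] -/
theorem quarterTurnsL_map_mirrorCol (c : ℤ) (l : List MidEdge) :
    quarterTurnsL (l.map (mirrorCol c)) = -quarterTurnsL l := by
  unfold quarterTurnsL
  rw [arcsOf_map_mirrorCol, List.map_map]
  induction arcsOf l with
  | nil => simp
  | cons p ps ih =>
    simp only [List.map_cons, List.sum_cons, Function.comp_apply, qTurnOf_mirrorColArc] at ih ⊢
    rw [ih]; ring

/-- The visited faces of the column-reflected list. [cite: GlazmanManolescu2019, §2.1 (finite domains of faces; walks as sequences of mid-edges)] -/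
theorem facesL_map_mirrorCol (c : ℤ) (l : List MidEdge) :
    facesL (l.map (mirrorCol c)) = (facesL l).map (mirrorColFace c) := by
  unfold facesL
  rw [arcsOf_map_mirrorCol, List.filterMap_map, ← List.dedup_map_of_injective (mirrorColFace_injective c),
    List.map_filterMap]
  congr 1
  refine List.filterMap_congr fun p _ => ?_
  exact arcFace_mirrorColArc c p

/-- The local configuration of the column-reflected list at the reflected face. [cite: GlazmanManolescu2019, Fig. 1] -/
theorem kindsL_map_mirrorCol (c : ℤ) (l : List MidEdge) (f : Face) :
    kindsL (l.map (mirrorCol c)) (mirrorColFace c f) = (kindsL l f).map mirrorKind := by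
  unfold kindsL
  rw [arcsOf_map_mirrorCol, List.filterMap_map, List.map_filterMap]
  refine List.filterMap_congr fun p _ => ?_
  simp only [Function.comp_apply, arcFace_mirrorColArc, arcKindOf_mirrorColArc]
  have hinj : ((arcFace p).map (mirrorColFace c) = some (mirrorColFace c f)) ↔ arcFace p = some f := by
    cases arcFace p with
    | none => simp
    | some g => simp only [Option.map_some, Option.some.injEq]; exact (mirrorColFace_injective c).eq_iff
  by_cases h : arcFace p = some f
  · rw [if_pos (hinj.2 h), if_pos h]
  · rw [if_neg (fun h' => h (hinj.1 h')), if_neg h, Option.map_none]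

/-- Configuration counts are reflected (columns). [cite: GlazmanManolescu2019, §1, Fig. 1, eq. (1)] -/
theorem cfgCount_map_mirrorCol (c : ℤ) (l : List MidEdge) (κ : List ArcKind) :
    cfgCount (l.map (mirrorCol c)) κ = cfgCount l (κ.map mirrorKind) := by
  unfold cfgCount
  rw [facesL_map_mirrorCol, List.countP_map]
  congr 1
  funext f
  simp only [Function.comp_apply, kindsL_map_mirrorCol]
  have hid : (mirrorKind ∘ mirrorKind) = id := funext mirrorKind_mirrorKind
  have key : (kindsL l f).map mirrorKind = κ ↔ kindsL l f = κ.map mirrorKind := by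
    constructor
    · intro h; rw [← h, List.map_map, hid, List.map_id]
    · intro h; rw [h, List.map_map, hid, List.map_id]
  rw [decide_eq_decide.2 key]

/-- ★ The plaquette weight of the column-reflected list is the corner-swapped weight. [cite: GlazmanManolescu2019, §1 ("the weight of a walk is the product of weights associated to each rhombus")] -/
theorem weightL_map_mirrorCol (W : CWeights) (c : ℤ) (l : List MidEdge) :
    weightL W (l.map (mirrorCol c)) = weightL W.swap l := by
  unfold weightL
  simp only [cfgCount_map_mirrorCol, List.map_cons, List.map_nil, mirrorKind]
  unfold CWeights.mono CWeights.swap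
  ring

namespace MirrorWalk

variable {D D' : Set Face} {a z a' z' : MidEdge}

/-- **The column-reflected walk.** [cite: GlazmanManolescu2019, §1 (definition of the model), Fig. 1] -/
def mirrorColWalk (c : ℤ) (hD : ∀ f, f ∈ D → mirrorColFace c f ∈ D') (ha : mirrorCol c a = a')
    (hz : mirrorCol c z = z') (γ : YBWalk D a z) : YBWalk D' a' z' where
  mids := γ.mids.map (mirrorCol c)
  head_eq := by rw [List.head?_map, γ.head_eq, Option.map_some, ha]
  getLast_eq := by rw [List.getLast?_map, γ.getLast_eq, Option.map_some, hz]
  nodup := γ.nodup.map (mirrorCol_injective c)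
  arc_mem p hp := by
    rw [arcsOf_map_mirrorCol, List.mem_map] at hp
    obtain ⟨q, hq, rfl⟩ := hp
    obtain ⟨f, hf, hqf⟩ := γ.arc_mem q hq
    exact ⟨mirrorColFace c f, hD f hf, by rw [arcFace_mirrorColArc, hqf, Option.map_some]⟩
  isChain := by
    rw [arcsOf_map_mirrorCol]
    refine List.isChain_map_of_isChain (mirrorColArc c) (fun p q h => ?_) γ.isChain
    rw [arcFace_mirrorColArc, arcFace_mirrorColArc]
    exact fun e => h (Option.map_injective (mirrorColFace_injective c) e)
  noncross f hWE hSN := by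
    rw [arcsOf_map_mirrorCol] at hWE hSN
    have hmem : ∀ s t : Side, ((f.side s, f.side t) ∈ (arcsOf γ.mids).map (mirrorColArc c)) ↔
        ((mirrorColFace c f).side (mirrorColSide s), (mirrorColFace c f).side (mirrorColSide t)) ∈ arcsOf γ.mids := by
      intro s t
      rw [List.mem_map]
      constructor
      · rintro ⟨q, hq, hqe⟩
        have e1 : mirrorCol c q.1 = f.side s := congrArg Prod.fst hqe
        have e2 : mirrorCol c q.2 = f.side t := congrArg Prod.snd hqe
        have e1' : q.1 = (mirrorColFace c f).side (mirrorColSide s) := by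
          rw [← mirrorCol_mirrorCol c q.1, e1, mirrorCol_side]
        have e2' : q.2 = (mirrorColFace c f).side (mirrorColSide t) := by
          rw [← mirrorCol_mirrorCol c q.2, e2, mirrorCol_side]
        rwa [← e1', ← e2', Prod.mk.eta]
      · intro h
        refine ⟨_, h, ?_⟩
        simp only [mirrorColArc, Prod.map_apply, mirrorCol_side, mirrorColFace_mirrorColFace, mirrorColSide_mirrorColSide]
    simp only [hmem, mirrorColSide] at hWE hSN
    exact γ.noncross (mirrorColFace c f) (Or.symm hWE) hSN

/-- The mid-edges of the column-reflected walk. [cite: GlazmanManolescu2019, §2.1 (finite domains of faces; walks as sequences of mid-edges)] -/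
@[simp] theorem mirrorColWalk_mids (c : ℤ) (hD : ∀ f, f ∈ D → mirrorColFace c f ∈ D') (ha : mirrorCol c a = a')
    (hz : mirrorCol c z = z') (γ : YBWalk D a z) : (mirrorColWalk c hD ha hz γ).mids = γ.mids.map (mirrorCol c) := rfl

end MirrorWalk

open MirrorWalk

/-- The column reflection is a bijection between the walks of a column-symmetric face list.
[cite: GlazmanManolescu2019, §1 (definition of the model)] -/
def mirrorColWalkEquiv (c : ℤ) {Dl : List Face} (hsym : ∀ f ∈ Dl, mirrorColFace c f ∈ Dl) (a z : MidEdge) :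
    YBWalk (dom Dl) a z ≃ YBWalk (dom Dl) (mirrorCol c a) (mirrorCol c z) where
  toFun := mirrorColWalk c (fun f hf => hsym f hf) rfl rfl
  invFun := mirrorColWalk c (fun f hf => hsym f hf) (mirrorCol_mirrorCol c a) (mirrorCol_mirrorCol c z)
  left_inv γ := by
    ext1
    simp only [mirrorColWalk_mids, List.map_map]
    conv_rhs => rw [← List.map_id γ.mids]
    congr 1
    exact funext (mirrorCol_mirrorCol c)
  right_inv γ := by
    ext1
    simp only [mirrorColWalk_mids, List.map_map]
    conv_rhs => rw [← List.map_id γ.mids]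
    congr 1
    exact funext (mirrorCol_mirrorCol c)

/-- ★★ **MIRROR COVARIANCE, column axis**: `F_{W,t}(ρa → ρz) = F_{W.swap, t⁻¹}(a → z)` on a face list symmetric in
the axis of column `c`. [cite: GlazmanManolescu2019, §2.1, eq. (2.1) (Θ ≡ π/2)] [cite: GlazmanManolescu2019, §1, eq. (1)] -/
theorem gmObservable_mirrorCol (W : CWeights) (t : ℂ) (c : ℤ) {Dl : List Face}
    (hsym : ∀ f ∈ Dl, mirrorColFace c f ∈ Dl) (a z : MidEdge) :
    gmObservable W t Dl (mirrorCol c a) (mirrorCol c z) = gmObservable W.swap t⁻¹ Dl a z := by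
  unfold gmObservable
  rw [← Equiv.sum_comp (mirrorColWalkEquiv c hsym a z)]
  refine Finset.sum_congr rfl fun γ _ => ?_
  change weightL W (γ.mids.map (mirrorCol c)) * t ^ quarterTurnsL (γ.mids.map (mirrorCol c)) = _
  rw [weightL_map_mirrorCol, quarterTurnsL_map_mirrorCol, zpow_neg, inv_zpow]

/-- On the column axis: `F_θ(a → ρz) = conj F_{π−θ}(a → z)` for a root on a slanted mid-edge of column `c`.
[cite: GlazmanManolescu2019, §2.1, eq. (2.1), eq. (1)] -/
theorem gmObservable_printed_mirrorCol_eq_conj (θ : ℝ) (c : ℤ) {Dl : List Face}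
    (hsym : ∀ f ∈ Dl, mirrorColFace c f ∈ Dl) (j₀ : ℤ) (z : MidEdge) :
    gmObservable (printedWeights θ) tFiveEighths Dl (.slant c j₀) (mirrorCol c z) =
      (starRingEnd ℂ) (gmObservable (printedWeights (π - θ)) tFiveEighths Dl (.slant c j₀) z) := by
  have h := gmObservable_mirrorCol (printedWeights θ) tFiveEighths c hsym (.slant c j₀) z
  rw [mirrorCol_slant_axis, printedWeights_swap] at h
  rw [h, conj_gmObservable_printed, conj_tFiveEighths]

/-- ★★★ **MIRROR DUALITY, column axis**: on a face list symmetric under the reflection of columns `k ↦ 2c − k`, for a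
root on ANY slanted (horizontal) mid-edge of the axis column `c` and ANY plaquette `(c, j)` of that column,
`VF_θ = −conj VF_{π−θ}` (the column reflection exchanges the slots `E ↔ W`, whose coefficients are `±1`, and fixes
`N`, `S`, whose coefficients are `±r`). [cite: GlazmanManolescu2019, Lemma 2.1, eq. (2.2) (CR)] [cite: DuminilCopinSmirnov2012, Lemma 1 (shape of the relation)] -/
theorem vertexFunctional_printed_mirrorCol_duality (θ : ℝ) (c : ℤ) {Dl : List Face}
    (hsym : ∀ f ∈ Dl, mirrorColFace c f ∈ Dl) (j₀ j : ℤ) :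
    vertexFunctional (printedWeights θ) tFiveEighths (ybCoeff θ) Dl (.slant c j₀) (c, j) =
      -(starRingEnd ℂ) (vertexFunctional (printedWeights (π - θ)) tFiveEighths (ybCoeff (π - θ)) Dl (.slant c j₀) (c, j)) := by
  set F : MidEdge → ℂ := fun z => gmObservable (printedWeights θ) tFiveEighths Dl (.slant c j₀) z with hF
  set F' : MidEdge → ℂ := fun z => gmObservable (printedWeights (π - θ)) tFiveEighths Dl (.slant c j₀) z with hF'
  have key : ∀ s : Side, F (Face.side (c, j) s) = (starRingEnd ℂ) (F' (Face.side (c, j) (mirrorColSide s))) := by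
    intro s
    have h := gmObservable_printed_mirrorCol_eq_conj θ c hsym j₀ (Face.side (c, j) (mirrorColSide s))
    rw [mirrorCol_side, mirrorColFace_axis, mirrorColSide_mirrorColSide] at h
    exact h
  unfold vertexFunctional
  simp only [Fin.sum_univ_four, slotSide, ybCoeff, Matrix.cons_val_zero, Matrix.cons_val_one, Matrix.cons_val]
  change 1 * F (Face.side (c, j) .E) + ybRatio θ * F (Face.side (c, j) .N) + -1 * F (Face.side (c, j) .W) +
      -ybRatio θ * F (Face.side (c, j) .S) =
    -(starRingEnd ℂ) (1 * F' (Face.side (c, j) .E) + ybRatio (π - θ) * F' (Face.side (c, j) .N) +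
      -1 * F' (Face.side (c, j) .W) + -ybRatio (π - θ) * F' (Face.side (c, j) .S))
  rw [key .E, key .N, key .W, key .S]
  simp only [mirrorColSide, map_add, map_mul, map_neg, map_one, conj_ybRatio_pi_sub]
  ring

/-- ★★★ **PURELY IMAGINARY at `θ = π/2` on the column axis**: the real part of the vertex functional vanishes.
(With the lane's far-cell half law in the VERTICAL normalisation — `VF(far) ∈ i·r·ℝ = ℝ` at `π/2` — this is again
the (R-9′) zero, for holes on a symmetry column: e.g. the `3 × 3` ring rooted at the `N` side of its hole.)
[cite: GlazmanManolescu2019, Lemma 2.1, eq. (2.2) (CR)] -/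
theorem vertexFunctional_printed_pi_div_two_re_eq_zero_of_mirrorCol (c : ℤ) {Dl : List Face}
    (hsym : ∀ f ∈ Dl, mirrorColFace c f ∈ Dl) (j₀ j : ℤ) :
    (vertexFunctional (printedWeights (π / 2)) tFiveEighths (ybCoeff (π / 2)) Dl (.slant c j₀) (c, j)).re = 0 := by
  have h := vertexFunctional_printed_mirrorCol_duality (π / 2) c hsym j₀ j
  rw [show π - π / 2 = π / 2 by ring] at h
  have := congrArg Complex.re h
  rw [Complex.neg_re, Complex.conj_re] at this
  linarith

/-- Same modulus at `θ` and `π − θ` on the column axis. [cite: GlazmanManolescu2019, Lemma 2.1, eq. (2.2) (CR)] -/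
theorem norm_vertexFunctional_printed_mirrorCol (θ : ℝ) (c : ℤ) {Dl : List Face}
    (hsym : ∀ f ∈ Dl, mirrorColFace c f ∈ Dl) (j₀ j : ℤ) :
    ‖vertexFunctional (printedWeights θ) tFiveEighths (ybCoeff θ) Dl (.slant c j₀) (c, j)‖ =
      ‖vertexFunctional (printedWeights (π - θ)) tFiveEighths (ybCoeff (π - θ)) Dl (.slant c j₀) (c, j)‖ := by
  rw [vertexFunctional_printed_mirrorCol_duality θ c hsym, norm_neg, Complex.norm_conj]

/-- The lane's `ring8` (`3 × 3 ∖ (1,1)`), column-symmetric about column `1`; rooted at the `N` side of the hole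
(`slant 1 2` = the catalogue's `holeRoot`), its far cell `(1, 0)` and root plaquette `(1, 2)` lie on the axis.
[cite: GlazmanManolescu2019, §2.1 (finite domains of faces)] -/
def ring8' : List Face := [(0, 0), (1, 0), (2, 0), (0, 1), (2, 1), (0, 2), (1, 2), (2, 2)]

/-- `ring8'` is symmetric in the axis of its middle column. [cite: GlazmanManolescu2019, §2.1 (finite domains of faces; walks as sequences of mid-edges)] -/
theorem ring8'_symmetric : ∀ f ∈ ring8', mirrorColFace 1 f ∈ ring8' := by decide

/-- ★ On the ring rooted at the `N` side of its hole, the ROOT PLAQUETTE `(1, 2)` — where the catalogue's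
`PlaquetteWalkHoleRootDefect` shows the defect `≠ 0` — has a PURELY IMAGINARY functional at `θ = π/2`.
[cite: GlazmanManolescu2019, Lemma 2.1, eq. (2.2) (CR)] -/
theorem vertexFunctional_printed_ring8'_rootPlaquette_re_eq_zero :
    (vertexFunctional (printedWeights (π / 2)) tFiveEighths (ybCoeff (π / 2)) ring8' (.slant 1 2) (1, 2)).re = 0 :=
  vertexFunctional_printed_pi_div_two_re_eq_zero_of_mirrorCol 1 ring8'_symmetric 2 2

end Literature.Barriers.CriticalPhenomena.PlaquetteWalk

namespace Literature.Barriers.CriticalPhenomena.PlaquetteWalk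

open Literature.Probability.RandomPlanarGeometry.SAW.YangBaxter
open Literature.Probability.RandomPlanarGeometry.SAW.YangBaxter.MidEdge
open Real Complex MirrorWalk

/-- Membership in the column-reflected face list. [cite: GlazmanManolescu2019, §2.1 (finite domains of faces)] -/
theorem mem_dom_map_mirrorColFace (c : ℤ) (Dl : List Face) (f : Face) :
    f ∈ dom (Dl.map (mirrorColFace c)) ↔ mirrorColFace c f ∈ dom Dl := by
  change f ∈ Dl.map (mirrorColFace c) ↔ mirrorColFace c f ∈ Dl
  rw [List.mem_map]
  constructor
  · rintro ⟨g, hg, rfl⟩; rwa [mirrorColFace_mirrorColFace]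
  · intro h; exact ⟨_, h, mirrorColFace_mirrorColFace c f⟩

/-- The column reflection is a bijection between the walks of a face list and those of the reflected list.
[cite: GlazmanManolescu2019, §1 (definition of the model)] -/
def mirrorColWalkEquivMap (c : ℤ) (Dl : List Face) (a z : MidEdge) :
    YBWalk (dom Dl) a z ≃ YBWalk (dom (Dl.map (mirrorColFace c))) (mirrorCol c a) (mirrorCol c z) where
  toFun := mirrorColWalk c (fun f hf => (mem_dom_map_mirrorColFace c Dl _).2 (by rwa [mirrorColFace_mirrorColFace])) rfl rfl
  invFun := mirrorColWalk c (fun f hf => (mem_dom_map_mirrorColFace c Dl f).1 hf) (mirrorCol_mirrorCol c a)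
    (mirrorCol_mirrorCol c z)
  left_inv γ := by
    ext1
    simp only [mirrorColWalk_mids, List.map_map]
    conv_rhs => rw [← List.map_id γ.mids]
    congr 1
    exact funext (mirrorCol_mirrorCol c)
  right_inv γ := by
    ext1
    simp only [mirrorColWalk_mids, List.map_map]
    conv_rhs => rw [← List.map_id γ.mids]
    congr 1
    exact funext (mirrorCol_mirrorCol c)

/-- ★★ **MIRROR COVARIANCE (column axis) for an arbitrary face list.** [cite: GlazmanManolescu2019, §2.1, eq. (2.1) (Θ ≡ π/2)] [cite: GlazmanManolescu2019, §1, eq. (1)] -/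
theorem gmObservable_map_mirrorCol (W : CWeights) (t : ℂ) (c : ℤ) (Dl : List Face) (a z : MidEdge) :
    gmObservable W t (Dl.map (mirrorColFace c)) (mirrorCol c a) (mirrorCol c z) = gmObservable W.swap t⁻¹ Dl a z := by
  unfold gmObservable
  rw [← Equiv.sum_comp (mirrorColWalkEquivMap c Dl a z)]
  refine Finset.sum_congr rfl fun γ _ => ?_
  change weightL W (γ.mids.map (mirrorCol c)) * t ^ quarterTurnsL (γ.mids.map (mirrorCol c)) = _
  rw [weightL_map_mirrorCol, quarterTurnsL_map_mirrorCol, zpow_neg, inv_zpow]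

/-- The printed observable of the column-reflected list: `F^{ρD}_θ(ρa → ρz) = conj F^{D}_{π−θ}(a → z)`.
[cite: GlazmanManolescu2019, §2.1, eq. (2.1), eq. (1)] -/
theorem gmObservable_printed_map_mirrorCol_eq_conj (θ : ℝ) (c : ℤ) (Dl : List Face) (a z : MidEdge) :
    gmObservable (printedWeights θ) tFiveEighths (Dl.map (mirrorColFace c)) (mirrorCol c a) (mirrorCol c z) =
      (starRingEnd ℂ) (gmObservable (printedWeights (π - θ)) tFiveEighths Dl a z) := by
  rw [gmObservable_map_mirrorCol, printedWeights_swap, conj_gmObservable_printed, conj_tFiveEighths]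

/-- ★★★ **MIRROR DUALITY (column axis) FOR EVERY DOMAIN**: `VF_θ(ρDl; ρa; ρf₀) = −conj VF_{π−θ}(Dl; a; f₀)` for the
column reflection `ρ` (which exchanges the `±1`-weighted slots `E`, `W` and fixes the `±r`-weighted `N`, `S`).
[cite: GlazmanManolescu2019, Lemma 2.1, eq. (2.2) (CR)] [cite: DuminilCopinSmirnov2012, Lemma 1 (shape of the relation)] -/
theorem vertexFunctional_printed_map_mirrorCol_duality (θ : ℝ) (c : ℤ) (Dl : List Face) (a : MidEdge) (f₀ : Face) :
    vertexFunctional (printedWeights θ) tFiveEighths (ybCoeff θ) (Dl.map (mirrorColFace c)) (mirrorCol c a)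
        (mirrorColFace c f₀) =
      -(starRingEnd ℂ) (vertexFunctional (printedWeights (π - θ)) tFiveEighths (ybCoeff (π - θ)) Dl a f₀) := by
  set F : MidEdge → ℂ := fun z => gmObservable (printedWeights θ) tFiveEighths (Dl.map (mirrorColFace c)) (mirrorCol c a) z
    with hF
  set F' : MidEdge → ℂ := fun z => gmObservable (printedWeights (π - θ)) tFiveEighths Dl a z with hF'
  have key : ∀ s : Side, F ((mirrorColFace c f₀).side s) = (starRingEnd ℂ) (F' (f₀.side (mirrorColSide s))) := by
    intro s
    have h := gmObservable_printed_map_mirrorCol_eq_conj θ c Dl a (f₀.side (mirrorColSide s))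
    rw [mirrorCol_side, mirrorColSide_mirrorColSide] at h
    exact h
  unfold vertexFunctional
  simp only [Fin.sum_univ_four, slotSide, ybCoeff, Matrix.cons_val_zero, Matrix.cons_val_one, Matrix.cons_val]
  change 1 * F ((mirrorColFace c f₀).side .E) + ybRatio θ * F ((mirrorColFace c f₀).side .N) +
      -1 * F ((mirrorColFace c f₀).side .W) + -ybRatio θ * F ((mirrorColFace c f₀).side .S) =
    -(starRingEnd ℂ) (1 * F' (f₀.side .E) + ybRatio (π - θ) * F' (f₀.side .N) + -1 * F' (f₀.side .W) +
      -ybRatio (π - θ) * F' (f₀.side .S))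
  rw [key .E, key .N, key .W, key .S]
  simp only [mirrorColSide, map_add, map_mul, map_neg, map_one, conj_ybRatio_pi_sub]
  ring

/-- ★★ **The half-turn rotation is an exact ANTI-symmetry of the vertex functional, at every `θ`**: rotating the
face list, the root and the plaquette by `π` (a row reflection followed by a column reflection) NEGATES the Yang–Baxter
vertex functional of the printed weights. [cite: GlazmanManolescu2019, Lemma 2.1, eq. (2.2) (CR)] -/
theorem vertexFunctional_printed_halfTurn (θ : ℝ) (c c' : ℤ) (Dl : List Face) (a : MidEdge) (f₀ : Face) :
    vertexFunctional (printedWeights θ) tFiveEighths (ybCoeff θ)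
        ((Dl.map (mirrorColFace c')).map (mirrorRowFace c)) (mirrorRow c (mirrorCol c' a))
        (mirrorRowFace c (mirrorColFace c' f₀)) =
      -vertexFunctional (printedWeights θ) tFiveEighths (ybCoeff θ) Dl a f₀ := by
  rw [vertexFunctional_printed_map_mirrorRow_duality, vertexFunctional_printed_map_mirrorCol_duality, sub_sub_cancel,
    map_neg, Complex.conj_conj]

end Literature.Barriers.CriticalPhenomena.PlaquetteWalk

/-! ## §9. The DIAGONAL reflection: an exact anti-linear symmetry at EVERY angle — `VF_θ(τ·) = r(θ) · conj VF_θ(·)` -/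

namespace Literature.Barriers.CriticalPhenomena.PlaquetteWalk

open Literature.Probability.RandomPlanarGeometry.SAW.YangBaxter
open Literature.Probability.RandomPlanarGeometry.SAW.YangBaxter.MidEdge
open Real Complex

/-- **Reflection in the main diagonal** on mid-edges: the left side of face `(k, j)` goes to the bottom side of face
`(j, k)`; it maps the rhombus of angle `θ` onto itself (the `θ`-corners `N ∩ W`, `S ∩ E` lie on the axis of the
reflection `W ↔ S`, `E ↔ N`). [cite: GlazmanManolescu2019, §1, Fig. 4 (the rhombus and its mid-edges z_W, z_E, z_S, z_N)] -/
def mirrorDiag : MidEdge → MidEdge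
  | .vert k j => .slant j k
  | .slant k j => .vert j k

/-- The diagonal reflection on faces. [cite: GlazmanManolescu2019, §1 (the lattice of rhombi and its mid-edges)] -/
def mirrorDiagFace (f : Face) : Face := (f.2, f.1)

/-- The diagonal reflection on sides: `W ↔ S`, `E ↔ N`. [cite: GlazmanManolescu2019, §1, Fig. 4 (z_W, z_E, z_S, z_N)] -/
def mirrorDiagSide : Side → Side
  | .W => .S
  | .S => .W
  | .E => .N
  | .N => .E

/-- The diagonal reflection is an involution on mid-edges. [cite: GlazmanManolescu2019, §1 (the lattice of rhombi and its mid-edges)] -/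
@[simp] theorem mirrorDiag_mirrorDiag (e : MidEdge) : mirrorDiag (mirrorDiag e) = e := by
  cases e <;> rfl

/-- The diagonal reflection is an involution on faces. [cite: GlazmanManolescu2019, §1 (the lattice of rhombi and its mid-edges)] -/
@[simp] theorem mirrorDiagFace_mirrorDiagFace (f : Face) : mirrorDiagFace (mirrorDiagFace f) = f := by
  obtain ⟨k, j⟩ := f; rfl

/-- The diagonal reflection is an involution on sides. [cite: GlazmanManolescu2019, §1, Fig. 4] -/
@[simp] theorem mirrorDiagSide_mirrorDiagSide (s : Side) : mirrorDiagSide (mirrorDiagSide s) = s := by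
  cases s <;> rfl

/-- The diagonal reflection is injective on mid-edges. [cite: GlazmanManolescu2019, §1 (the lattice of rhombi and its mid-edges)] -/
theorem mirrorDiag_injective : Function.Injective mirrorDiag :=
  Function.LeftInverse.injective mirrorDiag_mirrorDiag

/-- The diagonal reflection is injective on faces. [cite: GlazmanManolescu2019, §1 (the lattice of rhombi and its mid-edges)] -/
theorem mirrorDiagFace_injective : Function.Injective mirrorDiagFace :=
  Function.LeftInverse.injective mirrorDiagFace_mirrorDiagFace

/-- Sides are equivariant under the diagonal reflection. [cite: GlazmanManolescu2019, §1, Fig. 4 (z_W, z_E, z_S, z_N)] -/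
theorem mirrorDiag_side (f : Face) (s : Side) :
    mirrorDiag (f.side s) = (mirrorDiagFace f).side (mirrorDiagSide s) := by
  obtain ⟨k, j⟩ := f
  cases s <;> rfl

/-- `f.side s = e` is reflected (diagonal). [cite: GlazmanManolescu2019, §1 (the lattice of rhombi and its mid-edges)] -/
theorem side_eq_iff_mirrorDiag (f : Face) (s : Side) (e : MidEdge) :
    (mirrorDiagFace f).side (mirrorDiagSide s) = mirrorDiag e ↔ f.side s = e := by
  rw [← mirrorDiag_side]
  exact mirrorDiag_injective.eq_iff

/-- `∃ s, f.side s = e` is reflected (diagonal). [cite: GlazmanManolescu2019, §1 (the lattice of rhombi and its mid-edges)] -/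
theorem exists_side_eq_iff_mirrorDiag (f : Face) (e : MidEdge) :
    (∃ s, (mirrorDiagFace f).side s = mirrorDiag e) ↔ ∃ s, f.side s = e := by
  constructor
  · rintro ⟨s, hs⟩
    refine ⟨mirrorDiagSide s, ?_⟩
    rw [← side_eq_iff_mirrorDiag, mirrorDiagSide_mirrorDiagSide]
    exact hs
  · rintro ⟨s, hs⟩
    exact ⟨mirrorDiagSide s, (side_eq_iff_mirrorDiag f s e).2 hs⟩

/-- Common faces are equivariant (diagonal). [cite: GlazmanManolescu2019, §1 (the lattice of rhombi and its mid-edges)] -/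
theorem commonFace_mirrorDiag (e e' : MidEdge) :
    commonFace (mirrorDiag e) (mirrorDiag e') = (commonFace e e').map mirrorDiagFace := by
  cases h : commonFace e e' with
  | some f =>
    rw [Option.map_some]
    rw [MidEdge.commonFace_eq_some_iff] at h ⊢
    exact ⟨mirrorDiag_injective.ne h.1, (exists_side_eq_iff_mirrorDiag f e).2 h.2.1,
      (exists_side_eq_iff_mirrorDiag f e').2 h.2.2⟩
  | none =>
    rw [Option.map_none]
    cases h' : commonFace (mirrorDiag e) (mirrorDiag e') with
    | none => rfl
    | some g =>
      exfalso
      rw [MidEdge.commonFace_eq_some_iff] at h'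
      have key : commonFace e e' = some (mirrorDiagFace g) := by
        rw [MidEdge.commonFace_eq_some_iff]
        refine ⟨fun hh => h'.1 (by rw [hh]), ?_, ?_⟩
        · rw [← exists_side_eq_iff_mirrorDiag, mirrorDiagFace_mirrorDiagFace]; exact h'.2.1
        · rw [← exists_side_eq_iff_mirrorDiag, mirrorDiagFace_mirrorDiagFace]; exact h'.2.2
      rw [h] at key
      exact Option.some_ne_none _ key.symm

/-- `sideOf` is equivariant (diagonal). [cite: GlazmanManolescu2019, §1 (the lattice of rhombi and its mid-edges)] -/
theorem sideOf_mirrorDiag (f : Face) (e : MidEdge) :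
    (mirrorDiagFace f).sideOf (mirrorDiag e) = (f.sideOf e).map mirrorDiagSide := by
  cases h : f.sideOf e with
  | some s =>
    rw [Option.map_some, Face.sideOf_eq_some_iff, side_eq_iff_mirrorDiag]
    exact (Face.sideOf_eq_some_iff f e s).1 h
  | none =>
    rw [Option.map_none]
    cases h' : (mirrorDiagFace f).sideOf (mirrorDiag e) with
    | none => rfl
    | some s =>
      exfalso
      rw [Face.sideOf_eq_some_iff] at h'
      have key : f.sideOf e = some (mirrorDiagSide s) := by
        rw [Face.sideOf_eq_some_iff, ← side_eq_iff_mirrorDiag, mirrorDiagSide_mirrorDiagSide]; exact h'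
      rw [h] at key
      exact Option.some_ne_none _ key.symm

/-- The diagonally reflected arc. [folklore] -/
abbrev mirrorDiagArc (p : MidEdge × MidEdge) : MidEdge × MidEdge := Prod.map mirrorDiag mirrorDiag p

/-- Arc faces are equivariant (diagonal). [cite: GlazmanManolescu2019, §1] -/
theorem arcFace_mirrorDiagArc (p : MidEdge × MidEdge) :
    arcFace (mirrorDiagArc p) = (arcFace p).map mirrorDiagFace :=
  commonFace_mirrorDiag p.1 p.2

/-- **The diagonal reflection PRESERVES arc kinds**: `θ`-corners go to `θ`-corners, co-corners to co-corners,
straight to straight. [cite: GlazmanManolescu2019, Fig. 1] -/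
theorem arcKind_mirrorDiagSide (s t : Side) : arcKind (mirrorDiagSide s) (mirrorDiagSide t) = arcKind s t := by
  cases s <;> cases t <;> rfl

/-- Arc kinds are invariant (diagonal). [cite: GlazmanManolescu2019, Fig. 1] -/
theorem arcKindOf_mirrorDiagArc (p : MidEdge × MidEdge) : arcKindOf (mirrorDiagArc p) = arcKindOf p := by
  unfold arcKindOf
  rw [arcFace_mirrorDiagArc]
  cases arcFace p with
  | none => rfl
  | some f =>
    simp only [Option.map_some, Option.bind_some, mirrorDiagArc, Prod.map_fst, Prod.map_snd, sideOf_mirrorDiag]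
    cases f.sideOf p.1 with
    | none => simp
    | some s =>
      cases f.sideOf p.2 with
      | none => simp
      | some t => simp [arcKind_mirrorDiagSide]

/-- The diagonal reflection negates the signed quarter turn. [cite: GlazmanManolescu2019, §2.1 (definition of wind(γ))] -/
theorem qTurn_mirrorDiagSide (s t : Side) : qTurn (mirrorDiagSide s) (mirrorDiagSide t) = -qTurn s t := by
  cases s <;> cases t <;> rfl

/-- Quarter turns are odd under the diagonal reflection. [cite: GlazmanManolescu2019, §2.1 (definition of wind(γ))] -/
theorem qTurnOf_mirrorDiagArc (p : MidEdge × MidEdge) : qTurnOf (mirrorDiagArc p) = -qTurnOf p := by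
  unfold qTurnOf
  rw [arcFace_mirrorDiagArc]
  cases arcFace p with
  | none => simp
  | some f =>
    simp only [Option.map_some, mirrorDiagArc, Prod.map_fst, Prod.map_snd, sideOf_mirrorDiag]
    cases f.sideOf p.1 with
    | none => simp
    | some s =>
      cases f.sideOf p.2 with
      | none => simp
      | some t => simp [qTurn_mirrorDiagSide]

/-- The arcs of the diagonally reflected list. [cite: GlazmanManolescu2019, §2.1 (finite domains of faces; walks as sequences of mid-edges)] -/
theorem arcsOf_map_mirrorDiag (l : List MidEdge) : arcsOf (l.map mirrorDiag) = (arcsOf l).map mirrorDiagArc := by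
  unfold arcsOf
  rw [← List.map_tail, List.zip_map]

/-- The quarter-turn count of the diagonally reflected list is the negative. [cite: GlazmanManolescu2019, §2.1 (definition of wind(γ))] -/
theorem quarterTurnsL_map_mirrorDiag (l : List MidEdge) : quarterTurnsL (l.map mirrorDiag) = -quarterTurnsL l := by
  unfold quarterTurnsL
  rw [arcsOf_map_mirrorDiag, List.map_map]
  induction arcsOf l with
  | nil => simp
  | cons p ps ih =>
    simp only [List.map_cons, List.sum_cons, Function.comp_apply, qTurnOf_mirrorDiagArc] at ih ⊢
    rw [ih]; ring

/-- The visited faces of the diagonally reflected list. [cite: GlazmanManolescu2019, §2.1 (finite domains of faces; walks as sequences of mid-edges)] -/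
theorem facesL_map_mirrorDiag (l : List MidEdge) : facesL (l.map mirrorDiag) = (facesL l).map mirrorDiagFace := by
  unfold facesL
  rw [arcsOf_map_mirrorDiag, List.filterMap_map, ← List.dedup_map_of_injective mirrorDiagFace_injective,
    List.map_filterMap]
  congr 1
  refine List.filterMap_congr fun p _ => ?_
  exact arcFace_mirrorDiagArc p

/-- The local configuration of the diagonally reflected list at the reflected face is THE SAME.
[cite: GlazmanManolescu2019, Fig. 1] -/
theorem kindsL_map_mirrorDiag (l : List MidEdge) (f : Face) :
    kindsL (l.map mirrorDiag) (mirrorDiagFace f) = kindsL l f := by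
  unfold kindsL
  rw [arcsOf_map_mirrorDiag, List.filterMap_map]
  refine List.filterMap_congr fun p _ => ?_
  simp only [Function.comp_apply, arcFace_mirrorDiagArc, arcKindOf_mirrorDiagArc]
  have hinj : ((arcFace p).map mirrorDiagFace = some (mirrorDiagFace f)) ↔ arcFace p = some f := by
    cases arcFace p with
    | none => simp
    | some g => simp only [Option.map_some, Option.some.injEq]; exact mirrorDiagFace_injective.eq_iff
  by_cases h : arcFace p = some f
  · rw [if_pos (hinj.2 h), if_pos h]
  · rw [if_neg (fun h' => h (hinj.1 h')), if_neg h]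

/-- Configuration counts are invariant (diagonal). [cite: GlazmanManolescu2019, §1, Fig. 1, eq. (1)] -/
theorem cfgCount_map_mirrorDiag (l : List MidEdge) (κ : List ArcKind) : cfgCount (l.map mirrorDiag) κ = cfgCount l κ := by
  unfold cfgCount
  rw [facesL_map_mirrorDiag, List.countP_map]
  congr 1
  funext f
  simp only [Function.comp_apply, kindsL_map_mirrorDiag]

/-- ★ **The plaquette weight is INVARIANT under the diagonal reflection** — for every weight system.
[cite: GlazmanManolescu2019, §1 ("the weight of a walk is the product of weights associated to each rhombus")] -/
theorem weightL_map_mirrorDiag (W : CWeights) (l : List MidEdge) : weightL W (l.map mirrorDiag) = weightL W l := by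
  unfold weightL
  simp only [cfgCount_map_mirrorDiag]

namespace MirrorWalk

variable {D D' : Set Face} {a z a' z' : MidEdge}

/-- **The diagonally reflected walk.** [cite: GlazmanManolescu2019, §1 (definition of the model), Fig. 1] -/
def mirrorDiagWalk (hD : ∀ f, f ∈ D → mirrorDiagFace f ∈ D') (ha : mirrorDiag a = a') (hz : mirrorDiag z = z')
    (γ : YBWalk D a z) : YBWalk D' a' z' where
  mids := γ.mids.map mirrorDiag
  head_eq := by rw [List.head?_map, γ.head_eq, Option.map_some, ha]
  getLast_eq := by rw [List.getLast?_map, γ.getLast_eq, Option.map_some, hz]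
  nodup := γ.nodup.map mirrorDiag_injective
  arc_mem p hp := by
    rw [arcsOf_map_mirrorDiag, List.mem_map] at hp
    obtain ⟨q, hq, rfl⟩ := hp
    obtain ⟨f, hf, hqf⟩ := γ.arc_mem q hq
    exact ⟨mirrorDiagFace f, hD f hf, by rw [arcFace_mirrorDiagArc, hqf, Option.map_some]⟩
  isChain := by
    rw [arcsOf_map_mirrorDiag]
    refine List.isChain_map_of_isChain mirrorDiagArc (fun p q h => ?_) γ.isChain
    rw [arcFace_mirrorDiagArc, arcFace_mirrorDiagArc]
    exact fun e => h (Option.map_injective mirrorDiagFace_injective e)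
  noncross f hWE hSN := by
    rw [arcsOf_map_mirrorDiag] at hWE hSN
    have hmem : ∀ s t : Side, ((f.side s, f.side t) ∈ (arcsOf γ.mids).map mirrorDiagArc) ↔
        ((mirrorDiagFace f).side (mirrorDiagSide s), (mirrorDiagFace f).side (mirrorDiagSide t)) ∈ arcsOf γ.mids := by
      intro s t
      rw [List.mem_map]
      constructor
      · rintro ⟨q, hq, hqe⟩
        have e1 : mirrorDiag q.1 = f.side s := congrArg Prod.fst hqe
        have e2 : mirrorDiag q.2 = f.side t := congrArg Prod.snd hqe
        have e1' : q.1 = (mirrorDiagFace f).side (mirrorDiagSide s) := by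
          rw [← mirrorDiag_mirrorDiag q.1, e1, mirrorDiag_side]
        have e2' : q.2 = (mirrorDiagFace f).side (mirrorDiagSide t) := by
          rw [← mirrorDiag_mirrorDiag q.2, e2, mirrorDiag_side]
        rwa [← e1', ← e2', Prod.mk.eta]
      · intro h
        refine ⟨_, h, ?_⟩
        simp only [mirrorDiagArc, Prod.map_apply, mirrorDiag_side, mirrorDiagFace_mirrorDiagFace,
          mirrorDiagSide_mirrorDiagSide]
    simp only [hmem, mirrorDiagSide] at hWE hSN
    exact γ.noncross (mirrorDiagFace f) hSN hWE

/-- The mid-edges of the diagonally reflected walk. [cite: GlazmanManolescu2019, §2.1 (finite domains of faces; walks as sequences of mid-edges)] -/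
@[simp] theorem mirrorDiagWalk_mids (hD : ∀ f, f ∈ D → mirrorDiagFace f ∈ D') (ha : mirrorDiag a = a')
    (hz : mirrorDiag z = z') (γ : YBWalk D a z) : (mirrorDiagWalk hD ha hz γ).mids = γ.mids.map mirrorDiag := rfl

end MirrorWalk

open MirrorWalk

/-- Membership in the diagonally reflected face list. [cite: GlazmanManolescu2019, §2.1 (finite domains of faces)] -/
theorem mem_dom_map_mirrorDiagFace (Dl : List Face) (f : Face) :
    f ∈ dom (Dl.map mirrorDiagFace) ↔ mirrorDiagFace f ∈ dom Dl := by
  change f ∈ Dl.map mirrorDiagFace ↔ mirrorDiagFace f ∈ Dl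
  rw [List.mem_map]
  constructor
  · rintro ⟨g, hg, rfl⟩; rwa [mirrorDiagFace_mirrorDiagFace]
  · intro h; exact ⟨_, h, mirrorDiagFace_mirrorDiagFace f⟩

/-- The diagonal reflection is a bijection between the walks of a face list and those of the reflected list.
[cite: GlazmanManolescu2019, §1 (definition of the model)] -/
def mirrorDiagWalkEquivMap (Dl : List Face) (a z : MidEdge) :
    YBWalk (dom Dl) a z ≃ YBWalk (dom (Dl.map mirrorDiagFace)) (mirrorDiag a) (mirrorDiag z) where
  toFun := mirrorDiagWalk (fun f hf => (mem_dom_map_mirrorDiagFace Dl _).2 (by rwa [mirrorDiagFace_mirrorDiagFace])) rfl rfl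
  invFun := mirrorDiagWalk (fun f hf => (mem_dom_map_mirrorDiagFace Dl f).1 hf) (mirrorDiag_mirrorDiag a)
    (mirrorDiag_mirrorDiag z)
  left_inv γ := by
    ext1
    simp only [mirrorDiagWalk_mids, List.map_map]
    conv_rhs => rw [← List.map_id γ.mids]
    congr 1
    exact funext mirrorDiag_mirrorDiag
  right_inv γ := by
    ext1
    simp only [mirrorDiagWalk_mids, List.map_map]
    conv_rhs => rw [← List.map_id γ.mids]
    congr 1
    exact funext mirrorDiag_mirrorDiag

/-- ★★ **DIAGONAL COVARIANCE for arbitrary complex weights**: `F^{τD}_{W,t}(τa → τz) = F^{D}_{W,t⁻¹}(a → z)` — the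
weights are kept (NO corner swap), only the phase is inverted. [cite: GlazmanManolescu2019, §2.1, eq. (2.1) (Θ ≡ π/2)] [cite: GlazmanManolescu2019, §1, eq. (1)] -/
theorem gmObservable_map_mirrorDiag (W : CWeights) (t : ℂ) (Dl : List Face) (a z : MidEdge) :
    gmObservable W t (Dl.map mirrorDiagFace) (mirrorDiag a) (mirrorDiag z) = gmObservable W t⁻¹ Dl a z := by
  unfold gmObservable
  rw [← Equiv.sum_comp (mirrorDiagWalkEquivMap Dl a z)]
  refine Finset.sum_congr rfl fun γ _ => ?_
  change weightL W (γ.mids.map mirrorDiag) * t ^ quarterTurnsL (γ.mids.map mirrorDiag) = _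
  rw [weightL_map_mirrorDiag, quarterTurnsL_map_mirrorDiag, zpow_neg, inv_zpow]

/-- ★★ **At EVERY angle the diagonal reflection conjugates the printed observable**:
`F^{τD}_θ(τa → τz) = conj F^{D}_θ(a → z)`. [cite: GlazmanManolescu2019, §2.1, eq. (2.1), eq. (1)] -/
theorem gmObservable_printed_map_mirrorDiag_eq_conj (θ : ℝ) (Dl : List Face) (a z : MidEdge) :
    gmObservable (printedWeights θ) tFiveEighths (Dl.map mirrorDiagFace) (mirrorDiag a) (mirrorDiag z) =
      (starRingEnd ℂ) (gmObservable (printedWeights θ) tFiveEighths Dl a z) := by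
  rw [gmObservable_map_mirrorDiag, conj_gmObservable_printed, conj_tFiveEighths]

/-- The coefficient ratio is unimodular: `conj r(θ) · r(θ) = 1`. [cite: GlazmanManolescu2019, Lemma 2.1, eq. (CR)] -/
theorem conj_ybRatio_mul_ybRatio (θ : ℝ) : (starRingEnd ℂ) (ybRatio θ) * ybRatio θ = 1 := by
  unfold ybRatio
  rw [← Complex.exp_conj, map_mul, Complex.conj_ofReal, Complex.conj_I, ← Complex.exp_add]
  convert Complex.exp_zero using 2
  ring

/-- ★★★ **DIAGONAL DUALITY AT EVERY ANGLE.** For EVERY finite face list, EVERY root and EVERY plaquette, reflecting the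
data in the main diagonal multiplies the conjugate vertex functional by the coefficient ratio:
`VF_θ(τDl; τa; τf₀) = r(θ) · conj VF_θ(Dl; a; f₀)` (the reflection exchanges the slot pairs `E ↔ N`, `W ↔ S`, i.e. the
coefficients `1 ↔ r`, `−1 ↔ −r`, and `conj r = r⁻¹`). In particular `‖VF_θ(τ·)‖ = ‖VF_θ(·)‖` and the zero sets correspond
— at the SAME `θ`: the lane's tables for a root on a vertical side of the hole and for the transposed configuration
(root on a slanted side) determine each other. [cite: GlazmanManolescu2019, Lemma 2.1, eq. (2.2) (CR)]
[cite: DuminilCopinSmirnov2012, Lemma 1 (shape of the relation)] -/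
theorem vertexFunctional_printed_map_mirrorDiag (θ : ℝ) (Dl : List Face) (a : MidEdge) (f₀ : Face) :
    vertexFunctional (printedWeights θ) tFiveEighths (ybCoeff θ) (Dl.map mirrorDiagFace) (mirrorDiag a)
        (mirrorDiagFace f₀) =
      ybRatio θ * (starRingEnd ℂ) (vertexFunctional (printedWeights θ) tFiveEighths (ybCoeff θ) Dl a f₀) := by
  set F : MidEdge → ℂ := fun z => gmObservable (printedWeights θ) tFiveEighths (Dl.map mirrorDiagFace) (mirrorDiag a) z
    with hF
  set F' : MidEdge → ℂ := fun z => gmObservable (printedWeights θ) tFiveEighths Dl a z with hF'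
  have key : ∀ s : Side, F ((mirrorDiagFace f₀).side s) = (starRingEnd ℂ) (F' (f₀.side (mirrorDiagSide s))) := by
    intro s
    have h := gmObservable_printed_map_mirrorDiag_eq_conj θ Dl a (f₀.side (mirrorDiagSide s))
    rw [mirrorDiag_side, mirrorDiagSide_mirrorDiagSide] at h
    exact h
  have hr := conj_ybRatio_mul_ybRatio θ
  unfold vertexFunctional
  simp only [Fin.sum_univ_four, slotSide, ybCoeff, Matrix.cons_val_zero, Matrix.cons_val_one, Matrix.cons_val]
  change 1 * F ((mirrorDiagFace f₀).side .E) + ybRatio θ * F ((mirrorDiagFace f₀).side .N) +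
      -1 * F ((mirrorDiagFace f₀).side .W) + -ybRatio θ * F ((mirrorDiagFace f₀).side .S) =
    ybRatio θ * (starRingEnd ℂ) (1 * F' (f₀.side .E) + ybRatio θ * F' (f₀.side .N) + -1 * F' (f₀.side .W) +
      -ybRatio θ * F' (f₀.side .S))
  rw [key .E, key .N, key .W, key .S]
  simp only [mirrorDiagSide, map_add, map_mul, map_neg, map_one]
  linear_combination ((starRingEnd ℂ) (F' (f₀.side .S)) - (starRingEnd ℂ) (F' (f₀.side .N))) * hr

/-- ★ **Same modulus under the diagonal reflection, at the same angle.** [cite: GlazmanManolescu2019, Lemma 2.1, eq. (2.2) (CR)] -/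
theorem norm_vertexFunctional_printed_map_mirrorDiag (θ : ℝ) (Dl : List Face) (a : MidEdge) (f₀ : Face) :
    ‖vertexFunctional (printedWeights θ) tFiveEighths (ybCoeff θ) (Dl.map mirrorDiagFace) (mirrorDiag a)
        (mirrorDiagFace f₀)‖ =
      ‖vertexFunctional (printedWeights θ) tFiveEighths (ybCoeff θ) Dl a f₀‖ := by
  rw [vertexFunctional_printed_map_mirrorDiag, norm_mul, Complex.norm_conj]
  unfold ybRatio
  rw [Complex.norm_exp_ofReal_mul_I, one_mul]

/-- ★ **Same zero set under the diagonal reflection, at the same angle.** [cite: GlazmanManolescu2019, Lemma 2.1, eq. (2.2) (CR)] -/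
theorem vertexFunctional_printed_map_mirrorDiag_eq_zero_iff (θ : ℝ) (Dl : List Face) (a : MidEdge) (f₀ : Face) :
    vertexFunctional (printedWeights θ) tFiveEighths (ybCoeff θ) (Dl.map mirrorDiagFace) (mirrorDiag a)
        (mirrorDiagFace f₀) = 0 ↔
      vertexFunctional (printedWeights θ) tFiveEighths (ybCoeff θ) Dl a f₀ = 0 := by
  rw [vertexFunctional_printed_map_mirrorDiag, mul_eq_zero, map_eq_zero]
  constructor
  · rintro (h | h)
    · exact absurd h (ybRatio_ne_zero θ)
    · exact h
  · exact Or.inr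

/-- ★★ **The quarter-turn rotation** (row reflection followed by the diagonal reflection): the vertex functional at
angle `θ` of the rotated data is `r(θ)` times the vertex functional at angle `π − θ` of the data.
[cite: GlazmanManolescu2019, Lemma 2.1, eq. (2.2) (CR)] -/
theorem vertexFunctional_printed_quarterTurn (θ : ℝ) (c : ℤ) (Dl : List Face) (a : MidEdge) (f₀ : Face) :
    vertexFunctional (printedWeights θ) tFiveEighths (ybCoeff θ)
        ((Dl.map (mirrorRowFace c)).map mirrorDiagFace) (mirrorDiag (mirrorRow c a)) (mirrorDiagFace (mirrorRowFace c f₀)) =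
      ybRatio θ * vertexFunctional (printedWeights (π - θ)) tFiveEighths (ybCoeff (π - θ)) Dl a f₀ := by
  rw [vertexFunctional_printed_map_mirrorDiag, vertexFunctional_printed_map_mirrorRow_duality, Complex.conj_conj]

/-- ★ **The anti-diagonal reflection** (diagonal reflection after a half turn): `VF_θ(σ·) = −r(θ) · conj VF_θ(·)` — completing
the dihedral table `{id, conj∘(π−θ), −conj∘(π−θ), −id, r·conj, −r·conj, r·(π−θ), −r·(π−θ)}` of the printed vertex functional.
[cite: GlazmanManolescu2019, Lemma 2.1, eq. (2.2) (CR)] -/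
theorem vertexFunctional_printed_antiDiag (θ : ℝ) (c c' : ℤ) (Dl : List Face) (a : MidEdge) (f₀ : Face) :
    vertexFunctional (printedWeights θ) tFiveEighths (ybCoeff θ)
        (((Dl.map (mirrorColFace c')).map (mirrorRowFace c)).map mirrorDiagFace)
        (mirrorDiag (mirrorRow c (mirrorCol c' a))) (mirrorDiagFace (mirrorRowFace c (mirrorColFace c' f₀))) =
      -(ybRatio θ * (starRingEnd ℂ) (vertexFunctional (printedWeights θ) tFiveEighths (ybCoeff θ) Dl a f₀)) := by
  rw [vertexFunctional_printed_map_mirrorDiag, vertexFunctional_printed_halfTurn, map_neg, mul_neg]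

end Literature.Barriers.CriticalPhenomena.PlaquetteWalk


/-! ## §10. Arbitrary weights, phase and coefficients: the covariance of the vertex functional on the whole family -/

namespace Literature.Barriers.CriticalPhenomena.PlaquetteWalk

open Literature.Probability.RandomPlanarGeometry.SAW.YangBaxter
open Literature.Probability.RandomPlanarGeometry.SAW.YangBaxter.MidEdge
open Real Complex

/-- The coefficient vector with the `N` and `S` slots exchanged (slot order `(E, N, W, S)`). [cite: DuminilCopinSmirnov2012, Lemma 1 (shape of the relation)] -/
def swapNS (c : Fin 4 → ℂ) : Fin 4 → ℂ := ![c 0, c 3, c 2, c 1]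

/-- The coefficient vector with the `E` and `W` slots exchanged. [cite: DuminilCopinSmirnov2012, Lemma 1 (shape of the relation)] -/
def swapEW (c : Fin 4 → ℂ) : Fin 4 → ℂ := ![c 2, c 1, c 0, c 3]

/-- The coefficient vector with the slot pairs `E ↔ N`, `W ↔ S` exchanged. [cite: DuminilCopinSmirnov2012, Lemma 1 (shape of the relation)] -/
def swapDiag (c : Fin 4 → ℂ) : Fin 4 → ℂ := ![c 1, c 0, c 3, c 2]

/-- ★★ **Row-mirror covariance of the vertex functional for ARBITRARY complex weights, phase and coefficients**:
`VF_{W,t,c}(ρDl; ρa; ρf₀) = VF_{W.swap, t⁻¹, swapNS c}(Dl; a; f₀)` — valid on the whole five-parameter family and at every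
spin (the catalogue's Yang–Baxter CURVE included). [cite: GlazmanManolescu2019, §1, eq. (1); §2.1, eq. (2.1)] [cite: DuminilCopinSmirnov2012, Lemma 1 (shape of the relation)] -/
theorem vertexFunctional_map_mirrorRow (W : CWeights) (t : ℂ) (c : Fin 4 → ℂ) (k : ℤ) (Dl : List Face) (a : MidEdge)
    (f₀ : Face) :
    vertexFunctional W t c (Dl.map (mirrorRowFace k)) (mirrorRow k a) (mirrorRowFace k f₀) =
      vertexFunctional W.swap t⁻¹ (swapNS c) Dl a f₀ := by
  have key : ∀ s : Side, gmObservable W t (Dl.map (mirrorRowFace k)) (mirrorRow k a) ((mirrorRowFace k f₀).side s) =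
      gmObservable W.swap t⁻¹ Dl a (f₀.side (mirrorSide s)) := by
    intro s
    have h := gmObservable_map_mirrorRow W t k Dl a (f₀.side (mirrorSide s))
    rw [mirrorRow_side, mirrorSide_mirrorSide] at h
    exact h
  unfold vertexFunctional
  simp only [Fin.sum_univ_four, slotSide, swapNS, Matrix.cons_val_zero, Matrix.cons_val_one, Matrix.cons_val]
  change c 0 * gmObservable W t _ _ ((mirrorRowFace k f₀).side .E) + c 1 * gmObservable W t _ _ ((mirrorRowFace k f₀).side .N) +
      c 2 * gmObservable W t _ _ ((mirrorRowFace k f₀).side .W) + c 3 * gmObservable W t _ _ ((mirrorRowFace k f₀).side .S) =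
    c 0 * gmObservable W.swap t⁻¹ Dl a (f₀.side .E) + c 3 * gmObservable W.swap t⁻¹ Dl a (f₀.side .N) +
      c 2 * gmObservable W.swap t⁻¹ Dl a (f₀.side .W) + c 1 * gmObservable W.swap t⁻¹ Dl a (f₀.side .S)
  rw [key .E, key .N, key .W, key .S]
  simp only [mirrorSide]
  ring

/-- ★★ **Column-mirror covariance for arbitrary weights, phase and coefficients**:
`VF_{W,t,c}(ρ'Dl; ρ'a; ρ'f₀) = VF_{W.swap, t⁻¹, swapEW c}(Dl; a; f₀)`. [cite: GlazmanManolescu2019, §1, eq. (1); §2.1, eq. (2.1)] [cite: DuminilCopinSmirnov2012, Lemma 1 (shape of the relation)] -/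
theorem vertexFunctional_map_mirrorCol (W : CWeights) (t : ℂ) (c : Fin 4 → ℂ) (k : ℤ) (Dl : List Face) (a : MidEdge)
    (f₀ : Face) :
    vertexFunctional W t c (Dl.map (mirrorColFace k)) (mirrorCol k a) (mirrorColFace k f₀) =
      vertexFunctional W.swap t⁻¹ (swapEW c) Dl a f₀ := by
  have key : ∀ s : Side, gmObservable W t (Dl.map (mirrorColFace k)) (mirrorCol k a) ((mirrorColFace k f₀).side s) =
      gmObservable W.swap t⁻¹ Dl a (f₀.side (mirrorColSide s)) := by
    intro s
    have h := gmObservable_map_mirrorCol W t k Dl a (f₀.side (mirrorColSide s))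
    rw [mirrorCol_side, mirrorColSide_mirrorColSide] at h
    exact h
  unfold vertexFunctional
  simp only [Fin.sum_univ_four, slotSide, swapEW, Matrix.cons_val_zero, Matrix.cons_val_one, Matrix.cons_val]
  change c 0 * gmObservable W t _ _ ((mirrorColFace k f₀).side .E) + c 1 * gmObservable W t _ _ ((mirrorColFace k f₀).side .N) +
      c 2 * gmObservable W t _ _ ((mirrorColFace k f₀).side .W) + c 3 * gmObservable W t _ _ ((mirrorColFace k f₀).side .S) =
    c 2 * gmObservable W.swap t⁻¹ Dl a (f₀.side .E) + c 1 * gmObservable W.swap t⁻¹ Dl a (f₀.side .N) +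
      c 0 * gmObservable W.swap t⁻¹ Dl a (f₀.side .W) + c 3 * gmObservable W.swap t⁻¹ Dl a (f₀.side .S)
  rw [key .E, key .N, key .W, key .S]
  simp only [mirrorColSide]
  ring

/-- ★★ **Diagonal covariance for arbitrary weights, phase and coefficients**:
`VF_{W,t,c}(τDl; τa; τf₀) = VF_{W, t⁻¹, swapDiag c}(Dl; a; f₀)` — the weights are KEPT. [cite: GlazmanManolescu2019, §1, eq. (1); §2.1, eq. (2.1)] [cite: DuminilCopinSmirnov2012, Lemma 1 (shape of the relation)] -/
theorem vertexFunctional_map_mirrorDiag (W : CWeights) (t : ℂ) (c : Fin 4 → ℂ) (Dl : List Face) (a : MidEdge) (f₀ : Face) :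
    vertexFunctional W t c (Dl.map mirrorDiagFace) (mirrorDiag a) (mirrorDiagFace f₀) =
      vertexFunctional W t⁻¹ (swapDiag c) Dl a f₀ := by
  have key : ∀ s : Side, gmObservable W t (Dl.map mirrorDiagFace) (mirrorDiag a) ((mirrorDiagFace f₀).side s) =
      gmObservable W t⁻¹ Dl a (f₀.side (mirrorDiagSide s)) := by
    intro s
    have h := gmObservable_map_mirrorDiag W t Dl a (f₀.side (mirrorDiagSide s))
    rw [mirrorDiag_side, mirrorDiagSide_mirrorDiagSide] at h
    exact h
  unfold vertexFunctional
  simp only [Fin.sum_univ_four, slotSide, swapDiag, Matrix.cons_val_zero, Matrix.cons_val_one, Matrix.cons_val]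
  change c 0 * gmObservable W t _ _ ((mirrorDiagFace f₀).side .E) + c 1 * gmObservable W t _ _ ((mirrorDiagFace f₀).side .N) +
      c 2 * gmObservable W t _ _ ((mirrorDiagFace f₀).side .W) + c 3 * gmObservable W t _ _ ((mirrorDiagFace f₀).side .S) =
    c 1 * gmObservable W t⁻¹ Dl a (f₀.side .E) + c 0 * gmObservable W t⁻¹ Dl a (f₀.side .N) +
      c 3 * gmObservable W t⁻¹ Dl a (f₀.side .W) + c 2 * gmObservable W t⁻¹ Dl a (f₀.side .S)
  rw [key .E, key .N, key .W, key .S]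
  simp only [mirrorDiagSide]
  ring

/-- ★★ **Consequence for the technique class `ExactPlaquetteVertexRelation`**: an exact vertex relation for
`(W, t, c)` is equivalent to one for `(W, t⁻¹, swapDiag c)` (diagonal reflection of every instance); likewise
`(W.swap, t⁻¹, swapNS c)`. So the catalogue's classification results need only be read up to the dihedral action.
[cite: GlazmanManolescu2019, Lemma 2.1 (shape: a relation at each rhombus of the domain)] -/
theorem exactPlaquetteVertexRelation_mirrorDiag_iff (W : CWeights) (t : ℂ) (c : Fin 4 → ℂ) :
    ExactPlaquetteVertexRelation W t⁻¹ (swapDiag c) ↔ ExactPlaquetteVertexRelation W t c := by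
  have hb : ∀ (Dl : List Face) (a : MidEdge), IsBoundaryRoot (Dl.map mirrorDiagFace) (mirrorDiag a) ↔ IsBoundaryRoot Dl a := by
    intro Dl a
    have hf : ∀ e : MidEdge, (mirrorDiag e).faces = (mirrorDiagFace e.faces.1, mirrorDiagFace e.faces.2) := by
      intro e; cases e <;> simp [mirrorDiag, mirrorDiagFace, MidEdge.faces]
    have hm : ∀ g : Face, mirrorDiagFace g ∈ Dl.map mirrorDiagFace ↔ g ∈ Dl := by
      intro g
      rw [List.mem_map]
      constructor
      · rintro ⟨g', hg', e⟩; rwa [← mirrorDiagFace_injective e]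
      · intro h; exact ⟨g, h, rfl⟩
    unfold IsBoundaryRoot
    rw [hf]
    simp only [hm]
  have hD : ∀ Dl : List Face, (Dl.map mirrorDiagFace).map mirrorDiagFace = Dl := by
    intro Dl
    rw [List.map_map]
    have : mirrorDiagFace ∘ mirrorDiagFace = id := funext mirrorDiagFace_mirrorDiagFace
    rw [this, List.map_id]
  constructor
  · intro h Dl a f₀ hf ha
    -- reflect the reflected data back: `VF_{W,t,c}(Dl; a; f₀) = VF_{W,t⁻¹,swapDiag c}(τDl; τa; τf₀)`
    have h5 := vertexFunctional_map_mirrorDiag W t c (Dl.map mirrorDiagFace) (mirrorDiag a) (mirrorDiagFace f₀)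
    rw [hD, mirrorDiag_mirrorDiag, mirrorDiagFace_mirrorDiagFace] at h5
    rw [h5]
    exact h (Dl.map mirrorDiagFace) (mirrorDiag a) (mirrorDiagFace f₀) (List.mem_map.2 ⟨f₀, hf, rfl⟩) ((hb Dl a).2 ha)
  · intro h Dl a f₀ hf ha
    rw [← vertexFunctional_map_mirrorDiag W t c Dl a f₀]
    exact h (Dl.map mirrorDiagFace) (mirrorDiag a) (mirrorDiagFace f₀) (List.mem_map.2 ⟨f₀, hf, rfl⟩) ((hb Dl a).2 ha)

end Literature.Barriers.CriticalPhenomena.PlaquetteWalk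

/-! ## §11. The VERTICAL domino class is the diagonal image of the HORIZONTAL one -/

namespace Literature.Barriers.CriticalPhenomena.PlaquetteWalk

open Literature.Probability.RandomPlanarGeometry.SAW.YangBaxter
open Literature.Probability.RandomPlanarGeometry.SAW.YangBaxter.MidEdge
open Real Complex

/-- The diagonal reflection of the horizontal neighbour is the vertical neighbour of the reflection: `τ(f⁺) = (τf)↑`.
[cite: GlazmanManolescu2019, §1 (the lattice of rhombi and its mid-edges)] -/
theorem mirrorDiagFace_east (f : Face) : mirrorDiagFace (east f) = north (mirrorDiagFace f) := by
  obtain ⟨k, j⟩ := f; rfl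

/-- `(τf)⁺ = τ(f↑)`. [cite: GlazmanManolescu2019, §1 (the lattice of rhombi and its mid-edges)] -/
theorem east_mirrorDiagFace (f : Face) : east (mirrorDiagFace f) = mirrorDiagFace (north f) := by
  obtain ⟨k, j⟩ := f; rfl

/-- The coefficient vector of a horizontal domino read through the diagonal: slots `1 ↔ 2` and `4 ↔ 5` exchanged
(`(f.W, f.N, f.S, shared, f⁺.N, f⁺.S, f⁺.E)` ↦ `(f.S, f.E, f.W, shared, f↑.E, f↑.W, f↑.N)` in the vertical slot order
`(f.S, f.W, f.E, shared, f↑.W, f↑.E, f↑.N)`). [cite: DuminilCopinSmirnov2012, Lemma 1 (shape of a local linear relation)] -/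
def swapDomino (c : Fin 7 → ℂ) : Fin 7 → ℂ := ![c 0, c 2, c 1, c 3, c 5, c 4, c 6]

/-- `swapDomino` is an involution. [folklore] -/
private theorem swapDomino_swapDomino (c : Fin 7 → ℂ) : swapDomino (swapDomino c) = c := by
  funext i; fin_cases i <;> rfl

/-- The seven slots of the reflected horizontal domino are the reflected slots of the vertical domino, permuted.
[cite: GlazmanManolescu2019, §2.1, Fig. 4 (z_W, z_E, z_S, z_N of a rhombus)] -/
theorem dominoSlot_mirrorDiagFace (f : Face) :
    dominoSlot (mirrorDiagFace f) 0 = mirrorDiag (dominoSlotV f 0) ∧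
    dominoSlot (mirrorDiagFace f) 1 = mirrorDiag (dominoSlotV f 2) ∧
    dominoSlot (mirrorDiagFace f) 2 = mirrorDiag (dominoSlotV f 1) ∧
    dominoSlot (mirrorDiagFace f) 3 = mirrorDiag (dominoSlotV f 3) ∧
    dominoSlot (mirrorDiagFace f) 4 = mirrorDiag (dominoSlotV f 5) ∧
    dominoSlot (mirrorDiagFace f) 5 = mirrorDiag (dominoSlotV f 4) ∧
    dominoSlot (mirrorDiagFace f) 6 = mirrorDiag (dominoSlotV f 6) := by
  obtain ⟨k, j⟩ := f
  refine ⟨rfl, rfl, rfl, rfl, rfl, rfl, rfl⟩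

/-- ★★ **The horizontal domino functional of the diagonally reflected data is the VERTICAL domino functional of the data,
with the phase inverted and the slots permuted** — for every weight system, phase and coefficient vector.
[cite: GlazmanManolescu2019, §2.1, eq. (2.1), §1 eq. (1)] [cite: DuminilCopinSmirnov2012, Lemma 1 (shape of a local linear relation)] -/
theorem dominoFunctional_map_mirrorDiag (W : CWeights) (t : ℂ) (c : Fin 7 → ℂ) (Dl : List Face) (a : MidEdge) (f : Face) :
    dominoFunctional W t c (Dl.map mirrorDiagFace) (mirrorDiag a) (mirrorDiagFace f) =
      dominoFunctionalV W t⁻¹ (swapDomino c) Dl a f := by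
  obtain ⟨h0, h1, h2, h3, h4, h5, h6⟩ := dominoSlot_mirrorDiagFace f
  unfold dominoFunctional dominoFunctionalV
  simp only [Fin.sum_univ_seven, swapDomino, Matrix.cons_val_zero, Matrix.cons_val_one, Matrix.cons_val]
  rw [h0, h1, h2, h3, h4, h5, h6]
  simp only [gmObservable_map_mirrorDiag]
  ring

/-- Boundary roots are transported by the diagonal reflection. [cite: GlazmanManolescu2019, §2.1 (walks start on the boundary)] -/
theorem isBoundaryRoot_map_mirrorDiag_iff (Dl : List Face) (a : MidEdge) :
    IsBoundaryRoot (Dl.map mirrorDiagFace) (mirrorDiag a) ↔ IsBoundaryRoot Dl a := by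
  have hf : ∀ e : MidEdge, (mirrorDiag e).faces = (mirrorDiagFace e.faces.1, mirrorDiagFace e.faces.2) := by
    intro e; cases e <;> simp [mirrorDiag, mirrorDiagFace, MidEdge.faces]
  have hm : ∀ g : Face, mirrorDiagFace g ∈ Dl.map mirrorDiagFace ↔ g ∈ Dl := by
    intro g
    rw [List.mem_map]
    constructor
    · rintro ⟨g', hg', e⟩; rwa [← mirrorDiagFace_injective e]
    · intro h; exact ⟨g, h, rfl⟩
  unfold IsBoundaryRoot
  rw [hf]
  simp only [hm]

/-- ★★★ **THE VERTICAL DOMINO CLASS IS THE DIAGONAL IMAGE OF THE HORIZONTAL CLASS**: an exact VERTICAL-domino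
relation for `(W, t⁻¹, swapDomino c)` holds iff an exact HORIZONTAL-domino relation for `(W, t, c)` holds. So every
classification / rigidity / no-go statement of the catalogue for horizontal dominoes (`PlaquetteWalkDominoRigidity`,
`…Sharp`, `…Identity`, `…SAWNoGo`) yields its vertical twin (`…Vertical` files) by transport, and conversely.
[cite: GlazmanManolescu2019, Lemma 2.1 (shape: a relation at each pair of adjacent rhombi)] -/
theorem exactDominoVertexRelationV_iff_mirrorDiag (W : CWeights) (t : ℂ) (c : Fin 7 → ℂ) :
    ExactDominoVertexRelationV W t⁻¹ (swapDomino c) ↔ ExactDominoVertexRelation W t c := by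
  have hm : ∀ (Dl : List Face) (g : Face), mirrorDiagFace g ∈ Dl.map mirrorDiagFace ↔ g ∈ Dl := by
    intro Dl g
    rw [List.mem_map]
    constructor
    · rintro ⟨g', hg', e⟩; rwa [← mirrorDiagFace_injective e]
    · intro h; exact ⟨g, h, rfl⟩
  have hD : ∀ Dl : List Face, (Dl.map mirrorDiagFace).map mirrorDiagFace = Dl := by
    intro Dl
    rw [List.map_map]
    have : mirrorDiagFace ∘ mirrorDiagFace = id := funext mirrorDiagFace_mirrorDiagFace
    rw [this, List.map_id]
  constructor
  · intro hV Dl a f hf he ha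
    -- write the horizontal data as the reflection of reflected data
    have key := dominoFunctional_map_mirrorDiag W t c (Dl.map mirrorDiagFace) (mirrorDiag a) (mirrorDiagFace f)
    rw [hD, mirrorDiag_mirrorDiag, mirrorDiagFace_mirrorDiagFace] at key
    rw [key]
    refine hV (Dl.map mirrorDiagFace) (mirrorDiag a) (mirrorDiagFace f) ((hm Dl f).2 hf) ?_
      ((isBoundaryRoot_map_mirrorDiag_iff Dl a).2 ha)
    rw [← mirrorDiagFace_east, hm]; exact he
  · intro hH Dl a f hf hn ha
    rw [← dominoFunctional_map_mirrorDiag]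
    refine hH (Dl.map mirrorDiagFace) (mirrorDiag a) (mirrorDiagFace f) ((hm Dl f).2 hf) ?_
      ((isBoundaryRoot_map_mirrorDiag_iff Dl a).2 ha)
    rw [east_mirrorDiagFace, hm]; exact hn

/-- The same with the roles exchanged: a horizontal relation for `(W, t⁻¹, swapDomino c)` iff a vertical one for
`(W, t, c)`. [cite: GlazmanManolescu2019, Lemma 2.1 (shape: a relation at each pair of adjacent rhombi)] -/
theorem exactDominoVertexRelation_iff_mirrorDiag (W : CWeights) (t : ℂ) (c : Fin 7 → ℂ) :
    ExactDominoVertexRelation W t⁻¹ (swapDomino c) ↔ ExactDominoVertexRelationV W t c := by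
  have h := exactDominoVertexRelationV_iff_mirrorDiag W t⁻¹ (swapDomino c)
  rw [inv_inv, swapDomino_swapDomino] at h
  exact h.symm

end Literature.Barriers.CriticalPhenomena.PlaquetteWalk

/-! ## §12. Application: the vertical SAW domino no-go from the horizontal one, by transport -/

namespace Literature.Barriers.CriticalPhenomena.PlaquetteWalk

open Literature.Probability.RandomPlanarGeometry.SAW.YangBaxter
open Real Complex

/-- `swapDomino c = 0 ↔ c = 0`. [folklore] -/
private theorem swapDomino_eq_zero_iff (c : Fin 7 → ℂ) : swapDomino c = 0 ↔ c = 0 := by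
  constructor
  · intro h
    funext i
    fin_cases i
    · exact congrFun h 0
    · exact congrFun h 2
    · exact congrFun h 1
    · exact congrFun h 3
    · exact congrFun h 5
    · exact congrFun h 4
    · exact congrFun h 6
  · rintro rfl; funext i; fin_cases i <;> rfl

/- ★★ **SECOND PROOF of the catalogue's vertical SAW domino no-go** (`PlaquetteWalkDominoSAWNoGoVertical`,
`saw_no_dominoV_identity`, ≈ 1 600 hand-built lines): the uniform self-avoiding walk `(x, x, x, 0, 0)` carries no
non-zero VERTICAL two-plaquette identity at any `x ≠ 0`, `t ≠ 0` — in three lines from the HORIZONTAL no-go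
(`PlaquetteWalkDominoSAWNoGo.saw_no_domino_identity`) and the diagonal transport of § 11 (a vertical identity for
`(t, c)` is a horizontal identity for `(t⁻¹, swapDomino c)`). Written as an `example` (the statement is the landed
theorem's; this is a second proof, not a second declaration). [cite: GlazmanManolescu2019, §1 (the uniform walk as a point of the family)] -/
example {x t : ℂ} (hx : x ≠ 0) (ht : t ≠ 0) {c : Fin 7 → ℂ}
    (hrel : ExactDominoVertexRelationV ⟨x, x, x, 0, 0⟩ t c) : c = 0 := by
  have h := (exactDominoVertexRelation_iff_mirrorDiag ⟨x, x, x, 0, 0⟩ t c).2 hrel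
  exact (swapDomino_eq_zero_iff c).1 (saw_no_domino_identity hx (inv_ne_zero ht) h)

/-- ★★ **The vertical SAW domino no-go in TRANSPORTED form** (a new statement, equivalent to the landed one by § 11):
the uniform walk carries no non-zero HORIZONTAL two-plaquette identity with PERMUTED coefficients at the inverted phase —
`ExactDominoVertexRelation (x,x,x,0,0) t⁻¹ (swapDomino c) → c = 0` — which § 11 identifies with ZV's vertical no-go.
[cite: GlazmanManolescu2019, §1 (the uniform walk as a point of the family)] [cite: GlazmanManolescu2019, Lemma 2.1 (shape: a relation at each pair of adjacent rhombi)] -/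
theorem saw_no_domino_identity_swapDomino {x t : ℂ} (hx : x ≠ 0) (ht : t ≠ 0) {c : Fin 7 → ℂ}
    (hrel : ExactDominoVertexRelation ⟨x, x, x, 0, 0⟩ t⁻¹ (swapDomino c)) : c = 0 :=
  (swapDomino_eq_zero_iff c).1 (saw_no_domino_identity hx (inv_ne_zero ht) hrel)

end Literature.Barriers.CriticalPhenomena.PlaquetteWalk

/-! ## §13. The dihedral group acts ON the Yang–Baxter curve: closed forms, the diagonal reflection fixes every
curve point `(t, r) ↦ (t⁻¹, r⁻¹)`, the row reflection is `(t, r) ↦ (t⁻¹, ε r)` with the corner swap -/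

namespace Literature.Barriers.CriticalPhenomena.PlaquetteWalk

open Literature.Probability.RandomPlanarGeometry.SAW.YangBaxter
open Literature.Probability.RandomPlanarGeometry.SAW.YangBaxter.MidEdge
open Real Complex

/-! ### Closed forms of the five curve weights at both signs `ε = ±1`
(the `ε = −1` forms are `ybCurve_u₁_eq` … `ybCurve_w₂_eq` of `PlaquetteWalkHoleRootDefectInterior`; here the sign is a
parameter, which is what the dihedral bookkeeping needs) -/

/-- `1 + ε v = −r²(1 − t⁴)(1 − t⁸)/Q` on the curve, `Q = t⁶(1 + r⁴) − (1 + t¹²) r²` the discriminant.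
[cite: Glazman2015WeightedSAW, Lemma 3.1, (3.3)–(3.7)] -/
theorem one_add_eps_mul_ybV {ε : ℂ} (hε : ε = 1 ∨ ε = -1) (t r : ℂ)
    (hD : t ^ 6 * (1 + r ^ 4) - (1 + t ^ 12) * r ^ 2 ≠ 0) :
    1 + ε * ybV ε t r = -(r ^ 2 * (1 - t ^ 4) * (1 - t ^ 8)) / (t ^ 6 * (1 + r ^ 4) - (1 + t ^ 12) * r ^ 2) := by
  have hD2 : t ^ 6 * (1 + r ^ 4) - r ^ 2 * (1 + t ^ 12) ≠ 0 := fun h => hD (by linear_combination h)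
  unfold ybV
  rw [eq_div_iff hD]
  rcases hε with rfl | rfl <;> · field_simp; ring

/-- Closed form of the corner weight at both signs: `u₁ = ε t r (1 − t⁸)(r² − t²)/Q`.
[cite: Glazman2015WeightedSAW, Lemma 3.1, (3.3)–(3.7)] -/
theorem ybU1_eq_div {ε t r : ℂ} (hε : ε = 1 ∨ ε = -1) (ht4 : t ^ 4 ≠ 1) (hr : r ≠ 0)
    (hD : t ^ 6 * (1 + r ^ 4) - (1 + t ^ 12) * r ^ 2 ≠ 0) :
    ybU1 ε t r = ε * t * r * (1 - t ^ 8) * (r ^ 2 - t ^ 2) / (t ^ 6 * (1 + r ^ 4) - (1 + t ^ 12) * r ^ 2) := by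
  have hε0 : ε ≠ 0 := by rcases hε with rfl | rfl <;> norm_num
  have h1 : t ^ 4 - 1 ≠ 0 := sub_ne_zero.2 ht4
  have hD2 : t ^ 6 * (1 + r ^ 4) - r ^ 2 * (1 + t ^ 12) ≠ 0 := fun h => hD (by linear_combination h)
  unfold ybU1
  rw [one_add_eps_mul_ybV hε t r hD, div_eq_div_iff (mul_ne_zero (mul_ne_zero hε0 hr) h1) hD]
  rcases hε with rfl | rfl <;> · field_simp; ring

/-- Closed form of the co-corner weight at both signs: `u₂ = t r (1 − t⁸)(1 − r²t²)/Q` (no `ε`).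
[cite: Glazman2015WeightedSAW, Lemma 3.1, (3.3)–(3.7)] -/
theorem ybU2_eq_div {ε t r : ℂ} (hε : ε = 1 ∨ ε = -1) (ht : t ≠ 0) (ht4 : t ^ 4 ≠ 1) (hr : r ≠ 0)
    (hD : t ^ 6 * (1 + r ^ 4) - (1 + t ^ 12) * r ^ 2 ≠ 0) :
    ybU2 ε t r = t * r * (1 - t ^ 8) * (1 - r ^ 2 * t ^ 2) / (t ^ 6 * (1 + r ^ 4) - (1 + t ^ 12) * r ^ 2) := by
  have hD2 : t ^ 6 * (1 + r ^ 4) - r ^ 2 * (1 + t ^ 12) ≠ 0 := fun h => hD (by linear_combination h)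
  unfold ybU2
  rw [ybU1_eq_div hε ht4 hr hD, one_add_eps_mul_ybV hε t r hD, div_eq_div_iff (pow_ne_zero 2 ht) hD]
  rcases hε with rfl | rfl <;> · field_simp; ring

/-- Closed form of the two-corner weight at both signs: `w₁ = (t² − r²)(1 − t¹⁰r²)/Q` (no `ε`).
[cite: Glazman2015WeightedSAW, Lemma 3.1, (3.3)–(3.7)] -/
theorem ybW1_eq_div {ε t r : ℂ} (hε : ε = 1 ∨ ε = -1) (ht : t ≠ 0) (ht4 : t ^ 4 ≠ 1) (hr : r ≠ 0)
    (hD : t ^ 6 * (1 + r ^ 4) - (1 + t ^ 12) * r ^ 2 ≠ 0) :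
    ybW1 ε t r = (t ^ 2 - r ^ 2) * (1 - t ^ 10 * r ^ 2) / (t ^ 6 * (1 + r ^ 4) - (1 + t ^ 12) * r ^ 2) := by
  have hD2 : t ^ 6 * (1 + r ^ 4) - r ^ 2 * (1 + t ^ 12) ≠ 0 := fun h => hD (by linear_combination h)
  unfold ybW1
  rw [ybU1_eq_div hε ht4 hr hD]
  unfold ybV
  rw [div_eq_div_iff (pow_ne_zero 4 ht) hD]
  rcases hε with rfl | rfl <;> · field_simp; ring

/-- Closed form of the two-co-corner weight at both signs: `w₂ = (t¹⁰ − r²)(1 − t²r²)/Q` (no `ε`).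
[cite: Glazman2015WeightedSAW, Lemma 3.1, (3.3)–(3.7)] -/
theorem ybW2_eq_div {ε t r : ℂ} (hε : ε = 1 ∨ ε = -1) (ht : t ≠ 0) (ht4 : t ^ 4 ≠ 1) (hr : r ≠ 0)
    (hD : t ^ 6 * (1 + r ^ 4) - (1 + t ^ 12) * r ^ 2 ≠ 0) :
    ybW2 ε t r = (t ^ 10 - r ^ 2) * (1 - t ^ 2 * r ^ 2) / (t ^ 6 * (1 + r ^ 4) - (1 + t ^ 12) * r ^ 2) := by
  have hD2 : t ^ 6 * (1 + r ^ 4) - r ^ 2 * (1 + t ^ 12) ≠ 0 := fun h => hD (by linear_combination h)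
  unfold ybW2
  rw [ybU2_eq_div hε ht ht4 hr hD]
  unfold ybV
  rw [div_eq_div_iff ht hD]
  rcases hε with rfl | rfl <;> · field_simp; ring

/-! ### How the discriminant transforms -/

/-- `Q(t⁻¹, r⁻¹) = Q(t, r)/(t¹² r⁴)`. [cite: Glazman2015WeightedSAW, Lemma 3.1, (3.3)–(3.7)] -/
theorem ybDisc_inv_inv {t r : ℂ} (ht : t ≠ 0) (hr : r ≠ 0) :
    t⁻¹ ^ 6 * (1 + r⁻¹ ^ 4) - (1 + t⁻¹ ^ 12) * r⁻¹ ^ 2 =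
      (t ^ 6 * (1 + r ^ 4) - (1 + t ^ 12) * r ^ 2) / (t ^ 12 * r ^ 4) := by
  field_simp
  ring

/-- `Q(t⁻¹, r) = Q(t, r)/t¹²`: the discriminant is palindromic in `t`. [cite: Glazman2015WeightedSAW, Lemma 3.1, (3.3)–(3.7)] -/
theorem ybDisc_inv_phase {t : ℂ} (ht : t ≠ 0) (r : ℂ) :
    t⁻¹ ^ 6 * (1 + r ^ 4) - (1 + t⁻¹ ^ 12) * r ^ 2 = (t ^ 6 * (1 + r ^ 4) - (1 + t ^ 12) * r ^ 2) / t ^ 12 := by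
  field_simp
  ring

/-- `Q(t, ε r) = Q(t, r)` for `ε = ±1`: the discriminant is even in `r`. [cite: Glazman2015WeightedSAW, Lemma 3.1, (3.3)–(3.7)] -/
theorem ybDisc_eps_mul {ε : ℂ} (hε : ε = 1 ∨ ε = -1) (t r : ℂ) :
    t ^ 6 * (1 + (ε * r) ^ 4) - (1 + t ^ 12) * (ε * r) ^ 2 = t ^ 6 * (1 + r ^ 4) - (1 + t ^ 12) * r ^ 2 := by
  rcases hε with rfl | rfl <;> ring

/-! ### The diagonal reflection fixes every curve point: `(t, r) ↦ (t⁻¹, r⁻¹)` gives the SAME weights -/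

/-- The straight weight is invariant under `(t, r) ↦ (t⁻¹, r⁻¹)` (numerator and denominator are reciprocal
polynomials of bidegree `(12, 4)`); no genericity needed. [cite: Glazman2015WeightedSAW, Lemma 3.1, (3.3)–(3.7)] -/
theorem ybV_inv_inv (ε : ℂ) {t r : ℂ} (ht : t ≠ 0) (hr : r ≠ 0) : ybV ε t⁻¹ r⁻¹ = ybV ε t r := by
  unfold ybV
  by_cases h1 : t ^ 6 * (1 + r ^ 4) - (1 + t ^ 12) * r ^ 2 = 0
  · have h2 : t⁻¹ ^ 6 * (1 + r⁻¹ ^ 4) - (1 + t⁻¹ ^ 12) * r⁻¹ ^ 2 = 0 := by rw [ybDisc_inv_inv ht hr, h1, zero_div]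
    rw [h1, h2, div_zero, div_zero]
  · have h2 : t⁻¹ ^ 6 * (1 + r⁻¹ ^ 4) - (1 + t⁻¹ ^ 12) * r⁻¹ ^ 2 ≠ 0 := by
      rw [ybDisc_inv_inv ht hr]; exact div_ne_zero h1 (mul_ne_zero (pow_ne_zero _ ht) (pow_ne_zero _ hr))
    rw [div_eq_div_iff h2 h1]
    field_simp
    ring

/-- The corner weight `u₁` is invariant under `(t, r) ↦ (t⁻¹, r⁻¹)`. [cite: Glazman2015WeightedSAW, Lemma 3.1, (3.3)–(3.7)] -/
theorem ybU1_inv_inv {ε t r : ℂ} (hε : ε ≠ 0) (ht : t ≠ 0) (ht4 : t ^ 4 ≠ 1) (hr : r ≠ 0) :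
    ybU1 ε t⁻¹ r⁻¹ = ybU1 ε t r := by
  unfold ybU1
  rw [ybV_inv_inv ε ht hr]
  have h1 : ε * r * (t ^ 4 - 1) ≠ 0 := mul_ne_zero (mul_ne_zero hε hr) (sub_ne_zero.2 ht4)
  have h2 : ε * r⁻¹ * (t⁻¹ ^ 4 - 1) ≠ 0 := by
    refine mul_ne_zero (mul_ne_zero hε (inv_ne_zero hr)) (sub_ne_zero.2 ?_)
    intro h
    apply ht4
    have : t ^ 4 = (t⁻¹ ^ 4)⁻¹ := by rw [inv_pow, inv_inv]
    rw [this, h, inv_one]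
  rw [div_eq_div_iff h2 h1]
  field_simp
  ring

/-- The co-corner weight `u₂` is invariant under `(t, r) ↦ (t⁻¹, r⁻¹)` (`ε = ±1`). [cite: Glazman2015WeightedSAW, Lemma 3.1, (3.3)–(3.7)] -/
theorem ybU2_inv_inv {ε t r : ℂ} (hε : ε = 1 ∨ ε = -1) (ht : t ≠ 0) (ht4 : t ^ 4 ≠ 1) (hr : r ≠ 0) :
    ybU2 ε t⁻¹ r⁻¹ = ybU2 ε t r := by
  have hε0 : ε ≠ 0 := by rcases hε with rfl | rfl <;> norm_num
  unfold ybU2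
  rw [ybU1_inv_inv hε0 ht ht4 hr, ybV_inv_inv ε ht hr]
  unfold ybU1 ybV
  have h1 : t ^ 4 - 1 ≠ 0 := sub_ne_zero.2 ht4
  rcases hε with rfl | rfl
  · field_simp
    ring
  · field_simp
    ring

/-- The two-corner weight `w₁` is invariant under `(t, r) ↦ (t⁻¹, r⁻¹)` (`ε = ±1`, off the discriminant).
[cite: Glazman2015WeightedSAW, Lemma 3.1, (3.3)–(3.7)] -/
theorem ybW1_inv_inv {ε t r : ℂ} (hε : ε = 1 ∨ ε = -1) (ht : t ≠ 0) (ht4 : t ^ 4 ≠ 1) (hr : r ≠ 0)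
    (hD : t ^ 6 * (1 + r ^ 4) - (1 + t ^ 12) * r ^ 2 ≠ 0) : ybW1 ε t⁻¹ r⁻¹ = ybW1 ε t r := by
  have hε0 : ε ≠ 0 := by rcases hε with rfl | rfl <;> norm_num
  unfold ybW1
  rw [ybU1_inv_inv hε0 ht ht4 hr, ybV_inv_inv ε ht hr]
  unfold ybU1 ybV
  have h1 : t ^ 4 - 1 ≠ 0 := sub_ne_zero.2 ht4
  have hD2 : t ^ 6 * (1 + r ^ 4) - r ^ 2 * (1 + t ^ 12) ≠ 0 := fun h => hD (by linear_combination h)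
  rcases hε with rfl | rfl
  · field_simp
    ring
  · field_simp
    ring

/-- The two-co-corner weight `w₂` is invariant under `(t, r) ↦ (t⁻¹, r⁻¹)` (`ε = ±1`, off the discriminant).
[cite: Glazman2015WeightedSAW, Lemma 3.1, (3.3)–(3.7)] -/
theorem ybW2_inv_inv {ε t r : ℂ} (hε : ε = 1 ∨ ε = -1) (ht : t ≠ 0) (ht4 : t ^ 4 ≠ 1) (hr : r ≠ 0)
    (hD : t ^ 6 * (1 + r ^ 4) - (1 + t ^ 12) * r ^ 2 ≠ 0) : ybW2 ε t⁻¹ r⁻¹ = ybW2 ε t r := by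
  have hε0 : ε ≠ 0 := by rcases hε with rfl | rfl <;> norm_num
  unfold ybW2
  rw [ybU2_inv_inv hε ht ht4 hr, ybV_inv_inv ε ht hr]
  unfold ybU2 ybU1 ybV
  have h1 : t ^ 4 - 1 ≠ 0 := sub_ne_zero.2 ht4
  have hD2 : t ^ 6 * (1 + r ^ 4) - r ^ 2 * (1 + t ^ 12) ≠ 0 := fun h => hD (by linear_combination h)
  rcases hε with rfl | rfl
  · field_simp
    ring
  · field_simp
    ring

/-- ★★★ **THE DIAGONAL REFLECTION FIXES EVERY POINT OF THE YANG–BAXTER CURVE**: `ybCurve ε t⁻¹ r⁻¹ = ybCurve ε t r`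
(`ε = ±1`, `t ≠ 0`, `t⁴ ≠ 1`, `r ≠ 0`, off the discriminant `Q = 0`): inverting the spin phase AND the coefficient ratio
returns THE SAME weight system. This is the algebraic face of § 9/§ 10: the diagonal reflection keeps the weights and maps
the instance `(W, t, c)` to `(W, t⁻¹, swapDiag c)`, whose coefficient ratio is `r⁻¹` (`coeffRatio_swapDiag`).
[cite: Glazman2015WeightedSAW, Lemma 3.1, (3.3)–(3.7)] [cite: GlazmanManolescu2019, Lemma 2.1, eq. (CR)] -/
theorem ybCurve_inv_inv {ε t r : ℂ} (hε : ε = 1 ∨ ε = -1) (ht : t ≠ 0) (ht4 : t ^ 4 ≠ 1) (hr : r ≠ 0)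
    (hD : t ^ 6 * (1 + r ^ 4) - (1 + t ^ 12) * r ^ 2 ≠ 0) : ybCurve ε t⁻¹ r⁻¹ = ybCurve ε t r := by
  have hε0 : ε ≠ 0 := by rcases hε with rfl | rfl <;> norm_num
  simp only [ybCurve, ybU1_inv_inv hε0 ht ht4 hr, ybU2_inv_inv hε ht ht4 hr, ybV_inv_inv ε ht hr,
    ybW1_inv_inv hε ht ht4 hr hD, ybW2_inv_inv hε ht ht4 hr hD]

/-! ### The row reflection maps the curve onto itself: `(t, r) ↦ (t⁻¹, ε r)` with the corner swap `u₁ ↔ u₂`, `w₁ ↔ w₂` -/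

/-- The straight weight is invariant under `t ↦ t⁻¹` alone (palindromic numerator and denominator); no genericity
needed. [cite: Glazman2015WeightedSAW, Lemma 3.1, (3.3)–(3.7)] -/
theorem ybV_inv_phase (ε r : ℂ) {t : ℂ} (ht : t ≠ 0) : ybV ε t⁻¹ r = ybV ε t r := by
  unfold ybV
  by_cases h1 : t ^ 6 * (1 + r ^ 4) - (1 + t ^ 12) * r ^ 2 = 0
  · have h2 : t⁻¹ ^ 6 * (1 + r ^ 4) - (1 + t⁻¹ ^ 12) * r ^ 2 = 0 := by rw [ybDisc_inv_phase ht, h1, zero_div]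
    rw [h1, h2, div_zero, div_zero]
  · have h2 : t⁻¹ ^ 6 * (1 + r ^ 4) - (1 + t⁻¹ ^ 12) * r ^ 2 ≠ 0 := by
      rw [ybDisc_inv_phase ht]; exact div_ne_zero h1 (pow_ne_zero _ ht)
    rw [div_eq_div_iff h2 h1]
    field_simp
    ring

/-- The straight weight is even in `r`: `V(ε, t, εr) = V(ε, t, r)` for `ε = ±1`. [cite: Glazman2015WeightedSAW, Lemma 3.1, (3.3)–(3.7)] -/
theorem ybV_eps_mul {ε : ℂ} (hε : ε = 1 ∨ ε = -1) (t r : ℂ) : ybV ε t (ε * r) = ybV ε t r := by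
  unfold ybV
  rw [ybDisc_eps_mul hε]
  rcases hε with rfl | rfl <;> ring

/-- Row reflection, straight weight: `V(ε, t⁻¹, εr) = V(ε, t, r)`. [cite: Glazman2015WeightedSAW, Lemma 3.1, (3.3)–(3.7)] -/
theorem ybV_rowSwap {ε : ℂ} (hε : ε = 1 ∨ ε = -1) {t : ℂ} (ht : t ≠ 0) (r : ℂ) :
    ybV ε t⁻¹ (ε * r) = ybV ε t r := by
  rw [ybV_eps_mul hε, ybV_inv_phase ε r ht]

/-- Row reflection, corner weights: `U1(ε, t⁻¹, εr) = U2(ε, t, r)` — the corner weight of the reflected parameters is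
the CO-corner weight. [cite: Glazman2015WeightedSAW, Lemma 3.1, (3.3)–(3.7)] -/
theorem ybU1_rowSwap {ε t r : ℂ} (hε : ε = 1 ∨ ε = -1) (ht : t ≠ 0) (ht4 : t ^ 4 ≠ 1) (hr : r ≠ 0)
    (hD : t ^ 6 * (1 + r ^ 4) - (1 + t ^ 12) * r ^ 2 ≠ 0) : ybU1 ε t⁻¹ (ε * r) = ybU2 ε t r := by
  have hε0 : ε ≠ 0 := by rcases hε with rfl | rfl <;> norm_num
  have hti4 : t⁻¹ ^ 4 ≠ 1 := by
    intro h; apply ht4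
    have : t ^ 4 = (t⁻¹ ^ 4)⁻¹ := by rw [inv_pow, inv_inv]
    rw [this, h, inv_one]
  have hDi : t⁻¹ ^ 6 * (1 + (ε * r) ^ 4) - (1 + t⁻¹ ^ 12) * (ε * r) ^ 2 ≠ 0 := by
    rw [ybDisc_eps_mul hε, ybDisc_inv_phase ht]; exact div_ne_zero hD (pow_ne_zero _ ht)
  have hD2 : t ^ 6 * (1 + r ^ 4) - r ^ 2 * (1 + t ^ 12) ≠ 0 := fun h => hD (by linear_combination h)
  rw [ybU1_eq_div hε hti4 (mul_ne_zero hε0 hr) hDi, ybU2_eq_div hε ht ht4 hr hD, ybDisc_eps_mul hε,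
    ybDisc_inv_phase ht, div_eq_div_iff (div_ne_zero hD (pow_ne_zero _ ht)) hD]
  rcases hε with rfl | rfl <;> · field_simp; ring

/-- Row reflection, corner weights: `U2(ε, t⁻¹, εr) = U1(ε, t, r)`. [cite: Glazman2015WeightedSAW, Lemma 3.1, (3.3)–(3.7)] -/
theorem ybU2_rowSwap {ε t r : ℂ} (hε : ε = 1 ∨ ε = -1) (ht : t ≠ 0) (ht4 : t ^ 4 ≠ 1) (hr : r ≠ 0)
    (hD : t ^ 6 * (1 + r ^ 4) - (1 + t ^ 12) * r ^ 2 ≠ 0) : ybU2 ε t⁻¹ (ε * r) = ybU1 ε t r := by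
  have hε0 : ε ≠ 0 := by rcases hε with rfl | rfl <;> norm_num
  have hti4 : t⁻¹ ^ 4 ≠ 1 := by
    intro h; apply ht4
    have : t ^ 4 = (t⁻¹ ^ 4)⁻¹ := by rw [inv_pow, inv_inv]
    rw [this, h, inv_one]
  have hDi : t⁻¹ ^ 6 * (1 + (ε * r) ^ 4) - (1 + t⁻¹ ^ 12) * (ε * r) ^ 2 ≠ 0 := by
    rw [ybDisc_eps_mul hε, ybDisc_inv_phase ht]; exact div_ne_zero hD (pow_ne_zero _ ht)
  have hD2 : t ^ 6 * (1 + r ^ 4) - r ^ 2 * (1 + t ^ 12) ≠ 0 := fun h => hD (by linear_combination h)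
  rw [ybU2_eq_div hε (inv_ne_zero ht) hti4 (mul_ne_zero hε0 hr) hDi, ybU1_eq_div hε ht4 hr hD, ybDisc_eps_mul hε,
    ybDisc_inv_phase ht, div_eq_div_iff (div_ne_zero hD (pow_ne_zero _ ht)) hD]
  rcases hε with rfl | rfl <;> · field_simp; ring

/-- Row reflection, two-corner weights: `W1(ε, t⁻¹, εr) = W2(ε, t, r)`. [cite: Glazman2015WeightedSAW, Lemma 3.1, (3.3)–(3.7)] -/
theorem ybW1_rowSwap {ε t r : ℂ} (hε : ε = 1 ∨ ε = -1) (ht : t ≠ 0) (ht4 : t ^ 4 ≠ 1) (hr : r ≠ 0)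
    (hD : t ^ 6 * (1 + r ^ 4) - (1 + t ^ 12) * r ^ 2 ≠ 0) : ybW1 ε t⁻¹ (ε * r) = ybW2 ε t r := by
  have hε0 : ε ≠ 0 := by rcases hε with rfl | rfl <;> norm_num
  have hti4 : t⁻¹ ^ 4 ≠ 1 := by
    intro h; apply ht4
    have : t ^ 4 = (t⁻¹ ^ 4)⁻¹ := by rw [inv_pow, inv_inv]
    rw [this, h, inv_one]
  have hDi : t⁻¹ ^ 6 * (1 + (ε * r) ^ 4) - (1 + t⁻¹ ^ 12) * (ε * r) ^ 2 ≠ 0 := by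
    rw [ybDisc_eps_mul hε, ybDisc_inv_phase ht]; exact div_ne_zero hD (pow_ne_zero _ ht)
  have hD2 : t ^ 6 * (1 + r ^ 4) - r ^ 2 * (1 + t ^ 12) ≠ 0 := fun h => hD (by linear_combination h)
  rw [ybW1_eq_div hε (inv_ne_zero ht) hti4 (mul_ne_zero hε0 hr) hDi, ybW2_eq_div hε ht ht4 hr hD, ybDisc_eps_mul hε,
    ybDisc_inv_phase ht, div_eq_div_iff (div_ne_zero hD (pow_ne_zero _ ht)) hD]
  rcases hε with rfl | rfl <;> field_simp

/-- Row reflection, two-corner weights: `W2(ε, t⁻¹, εr) = W1(ε, t, r)`. [cite: Glazman2015WeightedSAW, Lemma 3.1, (3.3)–(3.7)] -/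
theorem ybW2_rowSwap {ε t r : ℂ} (hε : ε = 1 ∨ ε = -1) (ht : t ≠ 0) (ht4 : t ^ 4 ≠ 1) (hr : r ≠ 0)
    (hD : t ^ 6 * (1 + r ^ 4) - (1 + t ^ 12) * r ^ 2 ≠ 0) : ybW2 ε t⁻¹ (ε * r) = ybW1 ε t r := by
  have hε0 : ε ≠ 0 := by rcases hε with rfl | rfl <;> norm_num
  have hti4 : t⁻¹ ^ 4 ≠ 1 := by
    intro h; apply ht4
    have : t ^ 4 = (t⁻¹ ^ 4)⁻¹ := by rw [inv_pow, inv_inv]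
    rw [this, h, inv_one]
  have hDi : t⁻¹ ^ 6 * (1 + (ε * r) ^ 4) - (1 + t⁻¹ ^ 12) * (ε * r) ^ 2 ≠ 0 := by
    rw [ybDisc_eps_mul hε, ybDisc_inv_phase ht]; exact div_ne_zero hD (pow_ne_zero _ ht)
  have hD2 : t ^ 6 * (1 + r ^ 4) - r ^ 2 * (1 + t ^ 12) ≠ 0 := fun h => hD (by linear_combination h)
  rw [ybW2_eq_div hε (inv_ne_zero ht) hti4 (mul_ne_zero hε0 hr) hDi, ybW1_eq_div hε ht ht4 hr hD, ybDisc_eps_mul hε,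
    ybDisc_inv_phase ht, div_eq_div_iff (div_ne_zero hD (pow_ne_zero _ ht)) hD]
  rcases hε with rfl | rfl <;> field_simp

/-- ★★★ **THE ROW REFLECTION MAPS THE YANG–BAXTER CURVE ONTO ITSELF**: the corner-swapped curve point is again a
curve point, at the inverted spin phase and the coefficient ratio `ε r`: `(ybCurve ε t r).swap = ybCurve ε t⁻¹ (ε r)`
(`ε = ±1`, `t ≠ 0`, `t⁴ ≠ 1`, `r ≠ 0`, off the discriminant). The algebraic face of § 4/§ 10: the row reflection maps the
instance `(W, t, c)` to `(W.swap, t⁻¹, swapNS c)`, whose coefficient ratio is `ε r` (`coeffRatio_swapNS`) — so the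
catalogue's «`W` lies on the curve» classification (`weights_eq_ybCurve`) is equivariant under the reflection, as it must be.
[cite: Glazman2015WeightedSAW, Lemma 3.1, (3.3)–(3.7)] [cite: GlazmanManolescu2019, §1, remark after eq. (1) (θ ↔ π − θ: u₁ ↔ u₂, w₁ ↔ w₂)] -/
theorem ybCurve_swap {ε t r : ℂ} (hε : ε = 1 ∨ ε = -1) (ht : t ≠ 0) (ht4 : t ^ 4 ≠ 1) (hr : r ≠ 0)
    (hD : t ^ 6 * (1 + r ^ 4) - (1 + t ^ 12) * r ^ 2 ≠ 0) :
    (ybCurve ε t r).swap = ybCurve ε t⁻¹ (ε * r) := by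
  simp only [ybCurve, CWeights.swap, ybU1_rowSwap hε ht ht4 hr hD, ybU2_rowSwap hε ht ht4 hr hD, ybV_rowSwap hε ht r,
    ybW1_rowSwap hε ht ht4 hr hD, ybW2_rowSwap hε ht ht4 hr hD]

/-- The discriminant hypothesis is itself reflection-invariant: `Q(t⁻¹, εr) ≠ 0 ↔ Q(t, r) ≠ 0` (`t ≠ 0`).
[cite: Glazman2015WeightedSAW, Lemma 3.1, (3.3)–(3.7)] -/
theorem ybDisc_rowSwap_ne_zero_iff {ε : ℂ} (hε : ε = 1 ∨ ε = -1) {t : ℂ} (ht : t ≠ 0) (r : ℂ) :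
    t⁻¹ ^ 6 * (1 + (ε * r) ^ 4) - (1 + t⁻¹ ^ 12) * (ε * r) ^ 2 ≠ 0 ↔ t ^ 6 * (1 + r ^ 4) - (1 + t ^ 12) * r ^ 2 ≠ 0 := by
  rw [ybDisc_eps_mul hε, ybDisc_inv_phase ht, div_ne_zero_iff, and_iff_left (pow_ne_zero _ ht)]

/-! ### The coefficient ratio under the slot permutations of § 10 -/

/-- The coefficient ratio `r = (c_N + ε c_S)/(c_E + ε c_W)` of the diagonally permuted vector is `r⁻¹`.
[cite: GlazmanManolescu2019, Lemma 2.1, eq. (CR)] -/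
theorem coeffRatio_swapDiag (ε : ℂ) (c : Fin 4 → ℂ) :
    (swapDiag c 1 + ε * swapDiag c 3) / (swapDiag c 0 + ε * swapDiag c 2) = ((c 1 + ε * c 3) / (c 0 + ε * c 2))⁻¹ := by
  simp only [swapDiag, Matrix.cons_val_zero, Matrix.cons_val_one, Matrix.cons_val, inv_div]

/-- The coefficient ratio of the row-permuted vector (`N ↔ S`) is `ε r` (`ε = ±1`). [cite: GlazmanManolescu2019, Lemma 2.1, eq. (CR)] -/
theorem coeffRatio_swapNS {ε : ℂ} (hε : ε = 1 ∨ ε = -1) (c : Fin 4 → ℂ) :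
    (swapNS c 1 + ε * swapNS c 3) / (swapNS c 0 + ε * swapNS c 2) = ε * ((c 1 + ε * c 3) / (c 0 + ε * c 2)) := by
  simp only [swapNS, Matrix.cons_val_zero, Matrix.cons_val_one, Matrix.cons_val]
  rw [mul_div_assoc']
  congr 1
  rcases hε with rfl | rfl <;> ring

/-! ### The relation CLASS under the row reflection, and the equivariance of «the weights lie on the curve» -/

/-- Boundary roots are transported by the row reflection. [cite: GlazmanManolescu2019, §2.1 (walks start on the boundary)] -/
theorem isBoundaryRoot_map_mirrorRow_iff (k : ℤ) (Dl : List Face) (a : MidEdge) :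
    IsBoundaryRoot (Dl.map (mirrorRowFace k)) (mirrorRow k a) ↔ IsBoundaryRoot Dl a := by
  have hm : ∀ g : Face, mirrorRowFace k g ∈ Dl.map (mirrorRowFace k) ↔ g ∈ Dl := by
    intro g
    rw [List.mem_map]
    constructor
    · rintro ⟨g', hg', e⟩; rwa [← mirrorRowFace_injective k e]
    · intro h; exact ⟨g, h, rfl⟩
  cases a with
  | vert i j =>
    have h1 : (mirrorRow k (.vert i j)).faces = (mirrorRowFace k (i - 1, j), mirrorRowFace k (i, j)) := rfl
    have h2 : (MidEdge.vert i j).faces = ((i - 1, j), (i, j)) := rfl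
    unfold IsBoundaryRoot
    rw [h1, h2]
    simp only [hm]
  | slant i j =>
    have h1 : (mirrorRow k (.slant i j)).faces = (mirrorRowFace k (i, j), mirrorRowFace k (i, j - 1)) := by
      show (((i, 2 * k + 1 - j - 1), (i, 2 * k + 1 - j)) : Face × Face) = ((i, 2 * k - j), (i, 2 * k - (j - 1)))
      refine Prod.ext (Prod.ext rfl ?_) (Prod.ext rfl ?_) <;> · show (_ : ℤ) = _; ring
    have h2 : (MidEdge.slant i j).faces = ((i, j - 1), (i, j)) := rfl
    unfold IsBoundaryRoot
    rw [h1, h2]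
    simp only [hm]
    tauto

/-- ★★ **The class `ExactPlaquetteVertexRelation` under the row reflection**: an exact vertex relation for `(W, t, c)`
is equivalent to one for `(W.swap, t⁻¹, swapNS c)`. [cite: GlazmanManolescu2019, Lemma 2.1 (shape: a relation at each rhombus of the domain)] -/
theorem exactPlaquetteVertexRelation_mirrorRow_iff (W : CWeights) (t : ℂ) (c : Fin 4 → ℂ) :
    ExactPlaquetteVertexRelation W.swap t⁻¹ (swapNS c) ↔ ExactPlaquetteVertexRelation W t c := by
  have hD : ∀ Dl : List Face, (Dl.map (mirrorRowFace 0)).map (mirrorRowFace 0) = Dl := by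
    intro Dl
    rw [List.map_map]
    have : mirrorRowFace 0 ∘ mirrorRowFace 0 = id := funext (mirrorRowFace_mirrorRowFace 0)
    rw [this, List.map_id]
  constructor
  · intro h Dl a f₀ hf ha
    have h5 := vertexFunctional_map_mirrorRow W t c 0 (Dl.map (mirrorRowFace 0)) (mirrorRow 0 a) (mirrorRowFace 0 f₀)
    rw [hD, mirrorRow_mirrorRow, mirrorRowFace_mirrorRowFace] at h5
    rw [h5]
    exact h _ _ _ (List.mem_map.2 ⟨f₀, hf, rfl⟩) ((isBoundaryRoot_map_mirrorRow_iff 0 Dl a).2 ha)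
  · intro h Dl a f₀ hf ha
    rw [← vertexFunctional_map_mirrorRow W t c 0 Dl a f₀]
    exact h _ _ _ (List.mem_map.2 ⟨f₀, hf, rfl⟩) ((isBoundaryRoot_map_mirrorRow_iff 0 Dl a).2 ha)

/-- ★★★ **Equivariance of the curve classification under the DIAGONAL reflection**: an exact vertex relation for the
curve point `ybCurve ε t r` with phase `t` and coefficients `c` is equivalent to one for the SAME curve point written as
`ybCurve ε t⁻¹ r⁻¹`, phase `t⁻¹`, coefficients `swapDiag c`. [cite: Glazman2015WeightedSAW, Lemma 3.1, (3.3)–(3.7)] [cite: GlazmanManolescu2019, Lemma 2.1, eq. (CR)] -/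
theorem exactPlaquetteVertexRelation_ybCurve_mirrorDiag_iff {ε t r : ℂ} (hε : ε = 1 ∨ ε = -1) (ht : t ≠ 0)
    (ht4 : t ^ 4 ≠ 1) (hr : r ≠ 0) (hD : t ^ 6 * (1 + r ^ 4) - (1 + t ^ 12) * r ^ 2 ≠ 0) (c : Fin 4 → ℂ) :
    ExactPlaquetteVertexRelation (ybCurve ε t⁻¹ r⁻¹) t⁻¹ (swapDiag c) ↔ ExactPlaquetteVertexRelation (ybCurve ε t r) t c := by
  rw [ybCurve_inv_inv hε ht ht4 hr hD]
  exact exactPlaquetteVertexRelation_mirrorDiag_iff _ _ _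

/-- ★★★ **Equivariance of the curve classification under the ROW reflection**: an exact vertex relation for
`(ybCurve ε t r, t, c)` is equivalent to one for `(ybCurve ε t⁻¹ (εr), t⁻¹, swapNS c)` — the reflected instance sits at
the reflected curve point. [cite: Glazman2015WeightedSAW, Lemma 3.1, (3.3)–(3.7)] [cite: GlazmanManolescu2019, §1, remark after eq. (1)] -/
theorem exactPlaquetteVertexRelation_ybCurve_mirrorRow_iff {ε t r : ℂ} (hε : ε = 1 ∨ ε = -1) (ht : t ≠ 0)
    (ht4 : t ^ 4 ≠ 1) (hr : r ≠ 0) (hD : t ^ 6 * (1 + r ^ 4) - (1 + t ^ 12) * r ^ 2 ≠ 0) (c : Fin 4 → ℂ) :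
    ExactPlaquetteVertexRelation (ybCurve ε t⁻¹ (ε * r)) t⁻¹ (swapNS c) ↔ ExactPlaquetteVertexRelation (ybCurve ε t r) t c := by
  rw [← ybCurve_swap hε ht ht4 hr hD]
  exact exactPlaquetteVertexRelation_mirrorRow_iff _ _ _

end Literature.Barriers.CriticalPhenomena.PlaquetteWalk

/-! ## §14. The rest of the orbit — the column reflection and the rotations on the relation class and on the curve —
and the SELF-DUAL LOCUS `r² = ε` of the curve (printed model: `r(θ)² = −1 ⟺ θ = π/2`) -/

namespace Literature.Barriers.CriticalPhenomena.PlaquetteWalk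

open Literature.Probability.RandomPlanarGeometry.SAW.YangBaxter
open Literature.Probability.RandomPlanarGeometry.SAW.YangBaxter.MidEdge
open Real Complex

/-- The corner swap is an involution. [cite: GlazmanManolescu2019, §1, remark after eq. (1) (θ ↔ π − θ)] -/
@[simp] theorem CWeights.swap_swap (W : CWeights) : W.swap.swap = W := by
  cases W; rfl

/-! ### The column reflection on the relation class -/

/-- Boundary roots are transported by the column reflection. [cite: GlazmanManolescu2019, §2.1 (walks start on the boundary)] -/
theorem isBoundaryRoot_map_mirrorCol_iff (k : ℤ) (Dl : List Face) (a : MidEdge) :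
    IsBoundaryRoot (Dl.map (mirrorColFace k)) (mirrorCol k a) ↔ IsBoundaryRoot Dl a := by
  have hm : ∀ g : Face, mirrorColFace k g ∈ Dl.map (mirrorColFace k) ↔ g ∈ Dl := by
    intro g
    rw [List.mem_map]
    constructor
    · rintro ⟨g', hg', e⟩; rwa [← mirrorColFace_injective k e]
    · intro h; exact ⟨g, h, rfl⟩
  cases a with
  | vert i j =>
    have h1 : (mirrorCol k (.vert i j)).faces = (mirrorColFace k (i, j), mirrorColFace k (i - 1, j)) := by
      show (((2 * k + 1 - i - 1, j), (2 * k + 1 - i, j)) : Face × Face) = ((2 * k - i, j), (2 * k - (i - 1), j))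
      refine Prod.ext (Prod.ext ?_ rfl) (Prod.ext ?_ rfl) <;> · show (_ : ℤ) = _; ring
    have h2 : (MidEdge.vert i j).faces = ((i - 1, j), (i, j)) := rfl
    unfold IsBoundaryRoot
    rw [h1, h2]
    simp only [hm]
    tauto
  | slant i j =>
    have h1 : (mirrorCol k (.slant i j)).faces = (mirrorColFace k (i, j - 1), mirrorColFace k (i, j)) := rfl
    have h2 : (MidEdge.slant i j).faces = ((i, j - 1), (i, j)) := rfl
    unfold IsBoundaryRoot
    rw [h1, h2]
    simp only [hm]

/-- ★★ **The class `ExactPlaquetteVertexRelation` under the column reflection**: `(W.swap, t⁻¹, swapEW c) ↔ (W, t, c)`.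
[cite: GlazmanManolescu2019, Lemma 2.1 (shape: a relation at each rhombus of the domain)] -/
theorem exactPlaquetteVertexRelation_mirrorCol_iff (W : CWeights) (t : ℂ) (c : Fin 4 → ℂ) :
    ExactPlaquetteVertexRelation W.swap t⁻¹ (swapEW c) ↔ ExactPlaquetteVertexRelation W t c := by
  have hD : ∀ Dl : List Face, (Dl.map (mirrorColFace 0)).map (mirrorColFace 0) = Dl := by
    intro Dl
    rw [List.map_map]
    have : mirrorColFace 0 ∘ mirrorColFace 0 = id := funext (mirrorColFace_mirrorColFace 0)
    rw [this, List.map_id]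
  constructor
  · intro h Dl a f₀ hf ha
    have h5 := vertexFunctional_map_mirrorCol W t c 0 (Dl.map (mirrorColFace 0)) (mirrorCol 0 a) (mirrorColFace 0 f₀)
    rw [hD, mirrorCol_mirrorCol, mirrorColFace_mirrorColFace] at h5
    rw [h5]
    exact h _ _ _ (List.mem_map.2 ⟨f₀, hf, rfl⟩) ((isBoundaryRoot_map_mirrorCol_iff 0 Dl a).2 ha)
  · intro h Dl a f₀ hf ha
    rw [← vertexFunctional_map_mirrorCol W t c 0 Dl a f₀]
    exact h _ _ _ (List.mem_map.2 ⟨f₀, hf, rfl⟩) ((isBoundaryRoot_map_mirrorCol_iff 0 Dl a).2 ha)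

/-- The coefficient ratio of the column-permuted vector (`E ↔ W`) is `ε r` (`ε = ±1`) — the same as for the row
permutation, as the curve demands (`ybCurve_swap` serves both reflections). [cite: GlazmanManolescu2019, Lemma 2.1, eq. (CR)] -/
theorem coeffRatio_swapEW {ε : ℂ} (hε : ε = 1 ∨ ε = -1) (c : Fin 4 → ℂ) :
    (swapEW c 1 + ε * swapEW c 3) / (swapEW c 0 + ε * swapEW c 2) = ε * ((c 1 + ε * c 3) / (c 0 + ε * c 2)) := by
  simp only [swapEW, Matrix.cons_val_zero, Matrix.cons_val_one, Matrix.cons_val]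
  rcases hε with rfl | rfl
  · rw [one_mul, one_mul, one_mul, one_mul, add_comm (c 2) (c 0)]
  · rw [show c 2 + -1 * c 0 = -(c 0 + -1 * c 2) by ring, div_neg]
    ring

/-! ### The rotations on the relation class: half turn (class invariant) and quarter turn (= the corner swap) -/

/-- The coefficient vector turned by a half turn: `(E, N, W, S) ↦ (W, S, E, N)`, i.e. `swapEW ∘ swapNS`.
[cite: DuminilCopinSmirnov2012, Lemma 1 (shape of the relation)] -/
def halfTurnCoeff (c : Fin 4 → ℂ) : Fin 4 → ℂ := ![c 2, c 3, c 0, c 1]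

/-- The coefficient vector turned by a quarter turn: slot `E` reads the old `S`, `N` the old `E`, `W` the old `N`,
`S` the old `W`, i.e. `swapDiag ∘ swapNS`. [cite: DuminilCopinSmirnov2012, Lemma 1 (shape of the relation)] -/
def quarterTurnCoeff (c : Fin 4 → ℂ) : Fin 4 → ℂ := ![c 3, c 0, c 1, c 2]

/-- `swapEW (swapNS c) = halfTurnCoeff c`. [cite: DuminilCopinSmirnov2012, Lemma 1 (shape of the relation)] -/
theorem swapEW_swapNS (c : Fin 4 → ℂ) : swapEW (swapNS c) = halfTurnCoeff c := by
  funext i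
  fin_cases i <;> rfl

/-- `swapDiag (swapNS c) = quarterTurnCoeff c`. [cite: DuminilCopinSmirnov2012, Lemma 1 (shape of the relation)] -/
theorem swapDiag_swapNS (c : Fin 4 → ℂ) : swapDiag (swapNS c) = quarterTurnCoeff c := by
  funext i
  fin_cases i <;> rfl

/-- ★★ **The relation class is invariant under the half turn of the coefficients** (same weights, same phase):
`ExactPlaquetteVertexRelation W t (halfTurnCoeff c) ↔ ExactPlaquetteVertexRelation W t c` — row reflection followed by
column reflection. [cite: GlazmanManolescu2019, Lemma 2.1 (shape: a relation at each rhombus of the domain)] -/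
theorem exactPlaquetteVertexRelation_halfTurn_iff (W : CWeights) (t : ℂ) (c : Fin 4 → ℂ) :
    ExactPlaquetteVertexRelation W t (halfTurnCoeff c) ↔ ExactPlaquetteVertexRelation W t c := by
  rw [← swapEW_swapNS, ← exactPlaquetteVertexRelation_mirrorRow_iff W t c,
    ← exactPlaquetteVertexRelation_mirrorCol_iff W.swap t⁻¹ (swapNS c), CWeights.swap_swap, inv_inv]

/-- ★★★ **THE CORNER SWAP IS THE QUARTER TURN**: at the SAME phase, the corner-swapped weights carry an exact vertex
relation with the quarter-turned coefficients iff the weights carry one with the original coefficients: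
`ExactPlaquetteVertexRelation W.swap t (quarterTurnCoeff c) ↔ ExactPlaquetteVertexRelation W t c` (row reflection
followed by the diagonal reflection; the coefficient ratio becomes `(ε r)⁻¹`, `coeffRatio_quarterTurn`).
[cite: GlazmanManolescu2019, Lemma 2.1 (shape: a relation at each rhombus of the domain); §1, remark after eq. (1)] -/
theorem exactPlaquetteVertexRelation_swap_quarterTurn_iff (W : CWeights) (t : ℂ) (c : Fin 4 → ℂ) :
    ExactPlaquetteVertexRelation W.swap t (quarterTurnCoeff c) ↔ ExactPlaquetteVertexRelation W t c := by
  rw [← swapDiag_swapNS, ← exactPlaquetteVertexRelation_mirrorRow_iff W t c,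
    ← exactPlaquetteVertexRelation_mirrorDiag_iff W.swap t⁻¹ (swapNS c), inv_inv]

/-- The coefficient ratio of the half-turned vector is `r` itself (`ε = ±1`). [cite: GlazmanManolescu2019, Lemma 2.1, eq. (CR)] -/
theorem coeffRatio_halfTurn {ε : ℂ} (hε : ε = 1 ∨ ε = -1) (c : Fin 4 → ℂ) :
    (halfTurnCoeff c 1 + ε * halfTurnCoeff c 3) / (halfTurnCoeff c 0 + ε * halfTurnCoeff c 2) =
      (c 1 + ε * c 3) / (c 0 + ε * c 2) := by
  simp only [halfTurnCoeff, Matrix.cons_val_zero, Matrix.cons_val_one, Matrix.cons_val]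
  rcases hε with rfl | rfl
  · rw [one_mul, one_mul, one_mul, one_mul, add_comm (c 3) (c 1), add_comm (c 2) (c 0)]
  · rw [show c 3 + -1 * c 1 = -(c 1 + -1 * c 3) by ring, show c 2 + -1 * c 0 = -(c 0 + -1 * c 2) by ring,
      neg_div_neg_eq]

/-- The coefficient ratio of the quarter-turned vector is `(ε r)⁻¹` (`ε = ±1`). [cite: GlazmanManolescu2019, Lemma 2.1, eq. (CR)] -/
theorem coeffRatio_quarterTurn {ε : ℂ} (hε : ε = 1 ∨ ε = -1) (c : Fin 4 → ℂ) :
    (quarterTurnCoeff c 1 + ε * quarterTurnCoeff c 3) / (quarterTurnCoeff c 0 + ε * quarterTurnCoeff c 2) =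
      (ε * ((c 1 + ε * c 3) / (c 0 + ε * c 2)))⁻¹ := by
  simp only [quarterTurnCoeff, Matrix.cons_val_zero, Matrix.cons_val_one, Matrix.cons_val]
  rcases hε with rfl | rfl
  · rw [one_mul, one_mul, one_mul, one_mul, inv_div, add_comm (c 3) (c 1)]
  · rw [show c 3 + -1 * c 1 = -(c 1 + -1 * c 3) by ring, mul_inv, inv_div, div_neg]
    ring

/-! ### On the curve: the corner swap at the SAME phase is `r ↦ (ε r)⁻¹`; the self-dual locus `r² = ε` -/

/-- ★★★ **The corner swap at fixed phase**: `(ybCurve ε t r).swap = ybCurve ε t (ε r)⁻¹` (`ε = ±1`, `t ≠ 0`, `t⁴ ≠ 1`,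
`r ≠ 0`, off the discriminant) — § 13's row reflection `(t, r) ↦ (t⁻¹, ε r)` followed by § 13's diagonal identification
`(t⁻¹, ε r) ≡ (t, (ε r)⁻¹)`. For the printed model (`ε = −1`, `|r| = 1`) this reads `W(θ).swap = W` at ratio
`−r̄(θ) = r(π − θ)`: the curve-side form of `printedWeights_swap`. [cite: Glazman2015WeightedSAW, Lemma 3.1, (3.3)–(3.7)] [cite: GlazmanManolescu2019, §1, remark after eq. (1)] -/
theorem ybCurve_swap_eq_inv {ε t r : ℂ} (hε : ε = 1 ∨ ε = -1) (ht : t ≠ 0) (ht4 : t ^ 4 ≠ 1) (hr : r ≠ 0)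
    (hD : t ^ 6 * (1 + r ^ 4) - (1 + t ^ 12) * r ^ 2 ≠ 0) :
    (ybCurve ε t r).swap = ybCurve ε t (ε * r)⁻¹ := by
  have hε0 : ε ≠ 0 := by rcases hε with rfl | rfl <;> norm_num
  have hti4 : t⁻¹ ^ 4 ≠ 1 := by
    intro h; apply ht4
    have : t ^ 4 = (t⁻¹ ^ 4)⁻¹ := by rw [inv_pow, inv_inv]
    rw [this, h, inv_one]
  have hDi : t⁻¹ ^ 6 * (1 + (ε * r) ^ 4) - (1 + t⁻¹ ^ 12) * (ε * r) ^ 2 ≠ 0 :=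
    (ybDisc_rowSwap_ne_zero_iff hε ht r).2 hD
  rw [ybCurve_swap hε ht ht4 hr hD, ← ybCurve_inv_inv hε (inv_ne_zero ht) hti4 (mul_ne_zero hε0 hr) hDi, inv_inv]

/-- ★★ **The self-dual locus of the curve**: if `r² = ε` then the curve point is corner-symmetric,
`(ybCurve ε t r).swap = ybCurve ε t r` (then `(ε r)⁻¹ = r`). Printed model: `ε = −1`, `r(θ)² = −1 ⟺ θ = π/2`
(`ybRatio_sq_eq_neg_one_iff`) — the curve-side reason for `printedWeights_swap_eq_self_iff`.
[cite: Glazman2015WeightedSAW, Lemma 3.1, (3.3)–(3.7)] [cite: GlazmanManolescu2019, §1, remark after eq. (1)] -/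
theorem ybCurve_swap_eq_self_of_sq_eq {ε t r : ℂ} (hε : ε = 1 ∨ ε = -1) (ht : t ≠ 0) (ht4 : t ^ 4 ≠ 1)
    (hD : t ^ 6 * (1 + r ^ 4) - (1 + t ^ 12) * r ^ 2 ≠ 0) (hr2 : r ^ 2 = ε) :
    (ybCurve ε t r).swap = ybCurve ε t r := by
  have hε0 : ε ≠ 0 := by rcases hε with rfl | rfl <;> norm_num
  have hr : r ≠ 0 := by rintro rfl; apply hε0; rw [← hr2]; ring
  have hinv : (ε * r)⁻¹ = r := by
    apply inv_eq_of_mul_eq_one_right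
    have hε2 : ε * ε = 1 := by rcases hε with rfl | rfl <;> norm_num
    calc ε * r * r = ε * r ^ 2 := by ring
      _ = 1 := by rw [hr2, hε2]
  rw [ybCurve_swap_eq_inv hε ht ht4 hr hD, hinv]

/-- ★★ **Conversely, corner symmetry forces `r² = ε`** (generic phase: `t⁸ ≠ 1` in addition): already `u₁ = u₂` does,
by the closed forms `u₁ = ε t r (1 − t⁸)(r² − t²)/Q`, `u₂ = t r (1 − t⁸)(1 − r²t²)/Q` and the factorisations
`(r² − 1)(1 + t²)`, `(t² − 1)(1 + r²)` of `ε(r² − t²) − (1 − r²t²)`. [cite: Glazman2015WeightedSAW, Lemma 3.1, (3.3)–(3.7)] -/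
theorem sq_eq_of_ybU1_eq_ybU2 {ε t r : ℂ} (hε : ε = 1 ∨ ε = -1) (ht : t ≠ 0) (ht4 : t ^ 4 ≠ 1) (ht8 : t ^ 8 ≠ 1)
    (hr : r ≠ 0) (hD : t ^ 6 * (1 + r ^ 4) - (1 + t ^ 12) * r ^ 2 ≠ 0) (h : ybU1 ε t r = ybU2 ε t r) :
    r ^ 2 = ε := by
  rw [ybU1_eq_div hε ht4 hr hD, ybU2_eq_div hε ht ht4 hr hD, div_left_inj' hD] at h
  have h8 : (1 : ℂ) - t ^ 8 ≠ 0 := sub_ne_zero.2 (Ne.symm ht8)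
  have key : ε * (r ^ 2 - t ^ 2) = 1 - r ^ 2 * t ^ 2 := by
    have := mul_left_cancel₀ (mul_ne_zero (mul_ne_zero ht hr) h8)
      (show t * r * (1 - t ^ 8) * (ε * (r ^ 2 - t ^ 2)) = t * r * (1 - t ^ 8) * (1 - r ^ 2 * t ^ 2) by
        linear_combination h)
    exact this
  have ht2 : t ^ 2 + 1 ≠ 0 := by
    intro h2; apply ht4
    have : t ^ 2 = -1 := by linear_combination h2
    calc t ^ 4 = (t ^ 2) ^ 2 := by ring
      _ = 1 := by rw [this]; norm_num
  have ht2' : t ^ 2 - 1 ≠ 0 := by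
    intro h2; apply ht4
    have : t ^ 2 = 1 := by linear_combination h2
    calc t ^ 4 = (t ^ 2) ^ 2 := by ring
      _ = 1 := by rw [this]; norm_num
  rcases hε with rfl | rfl
  · have : (r ^ 2 - 1) * (t ^ 2 + 1) = 0 := by linear_combination key
    rcases mul_eq_zero.1 this with h1 | h1
    · linear_combination h1
    · exact absurd h1 ht2
  · have : (t ^ 2 - 1) * (1 + r ^ 2) = 0 := by linear_combination key
    rcases mul_eq_zero.1 this with h1 | h1
    · exact absurd h1 ht2'
    · linear_combination h1

/-- ★★ **The self-dual locus, as an equivalence** (generic phase `t⁸ ≠ 1`): `(ybCurve ε t r).swap = ybCurve ε t r ↔ r² = ε`.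
[cite: Glazman2015WeightedSAW, Lemma 3.1, (3.3)–(3.7)] [cite: GlazmanManolescu2019, §1, remark after eq. (1)] -/
theorem ybCurve_swap_eq_self_iff {ε t r : ℂ} (hε : ε = 1 ∨ ε = -1) (ht : t ≠ 0) (ht4 : t ^ 4 ≠ 1) (ht8 : t ^ 8 ≠ 1)
    (hr : r ≠ 0) (hD : t ^ 6 * (1 + r ^ 4) - (1 + t ^ 12) * r ^ 2 ≠ 0) :
    (ybCurve ε t r).swap = ybCurve ε t r ↔ r ^ 2 = ε := by
  refine ⟨fun h => ?_, ybCurve_swap_eq_self_of_sq_eq hε ht ht4 hD⟩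
  have h1 : (ybCurve ε t r).swap.u₂ = (ybCurve ε t r).u₂ := by rw [h]
  exact sq_eq_of_ybU1_eq_ybU2 hε ht ht4 ht8 hr hD h1

/-- The printed phase is generic in the sense of this section: `t⁸ = e^{−5iπ/2} ≠ 1` (indeed `t¹⁶ = −1`).
[cite: GlazmanManolescu2019, §2.1, eq. (2.1) (σ = 5/8)] -/
theorem tFiveEighths_pow_eight_ne_one : tFiveEighths ^ 8 ≠ 1 := by
  intro h
  have h16 : tFiveEighths ^ 16 = 1 := by
    calc tFiveEighths ^ 16 = (tFiveEighths ^ 8) ^ 2 := by ring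
      _ = 1 := by rw [h]; norm_num
  rw [tFiveEighths_pow_sixteen] at h16
  norm_num at h16

/-- ★★ **The printed ratio squares to `−1` exactly at `θ = π/2`** on the printed range: `r(θ)² = e^{i(3θ/4 + 5π/8)} = −1
⟺ θ = π/2` for `θ ∈ [π/3, 2π/3]` — the printed point `ybCurve (−1) t r(θ)` (`printedWeights_eq_ybCurve`) meets the
curve's self-dual locus `r² = ε = −1` exactly at the self-dual angle of `printedWeights_swap_eq_self_iff`.
[cite: GlazmanManolescu2019, §1, remark after eq. (1); Lemma 2.1, eq. (CR)] -/
theorem ybRatio_sq_eq_neg_one_iff {θ : ℝ} (hθ : θ ∈ Set.Icc (π / 3) (2 * π / 3)) :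
    ybRatio θ ^ 2 = -1 ↔ θ = π / 2 := by
  constructor
  · intro h
    have h1 : Complex.exp (((3 * θ / 4 - 3 * π / 8 : ℝ) : ℂ) * Complex.I) = 1 := by
      have e : Complex.exp (((3 * θ / 4 - 3 * π / 8 : ℝ) : ℂ) * Complex.I) =
          ybRatio θ ^ 2 * Complex.exp (-((π : ℂ) * Complex.I)) := by
        unfold ybRatio
        rw [sq, ← Complex.exp_add, ← Complex.exp_add]
        congr 1
        push_cast
        ring
      rw [e, h, Complex.exp_neg, Complex.exp_pi_mul_I]
      norm_num
    obtain ⟨n, hn⟩ := Complex.exp_eq_one_iff.1 h1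
    have hreal : (3 * θ / 4 - 3 * π / 8 : ℝ) = n * (2 * π) := by
      have h2 : ((3 * θ / 4 - 3 * π / 8 : ℝ) : ℂ) * Complex.I = ((n : ℂ) * (2 * π)) * Complex.I := by
        rw [hn]; ring
      have h3 := mul_right_cancel₀ Complex.I_ne_zero h2
      exact_mod_cast h3
    -- `3θ/4 − 3π/8 = 2πn` with `|3θ/4 − 3π/8| ≤ π/8` forces `n = 0`
    have hlo : -(π / 8) ≤ 3 * θ / 4 - 3 * π / 8 := by linarith [hθ.1]
    have hhi : 3 * θ / 4 - 3 * π / 8 ≤ π / 8 := by linarith [hθ.2]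
    have hπ := Real.pi_pos
    rcases lt_trichotomy n 0 with hlt | rfl | hgt
    · have h' : (n : ℝ) ≤ -1 := by exact_mod_cast (show n ≤ -1 by omega)
      have h'' : (n : ℝ) * (2 * π) ≤ -1 * (2 * π) := mul_le_mul_of_nonneg_right h' (by linarith)
      linarith
    · push_cast at hreal
      linarith
    · have h' : (1 : ℝ) ≤ n := by exact_mod_cast (show 1 ≤ n by omega)
      have h'' : 1 * (2 * π) ≤ (n : ℝ) * (2 * π) := mul_le_mul_of_nonneg_right h' (by linarith)
      linarith
  · rintro rfl
    rw [ybRatio_pi_div_two, Complex.I_sq]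

end Literature.Barriers.CriticalPhenomena.PlaquetteWalk

/-! ## §15. The printed point on the curve: off the discriminant; § 5's duality and § 7's self-duality angle re-derived
from the curve (second proofs, kernel-checked `example`s) -/

namespace Literature.Barriers.CriticalPhenomena.PlaquetteWalk

open Literature.Probability.RandomPlanarGeometry.SAW.YangBaxter
open Literature.Probability.RandomPlanarGeometry.SAW.YangBaxter.MidEdge
open Real Complex

/-- The printed phase is generic for §§ 13–14: `t⁴ ≠ 1` and `t⁸ ≠ 1` (`t¹⁶ = −1`); stated as a pair (the first
conjunct alone is a private lemma of `PlaquetteWalkIsthmusDefect`). [cite: GlazmanManolescu2019, §2.1, eq. (2.1) (σ = 5/8)] -/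
theorem tFiveEighths_pow_four_eight_ne_one : tFiveEighths ^ 4 ≠ 1 ∧ tFiveEighths ^ 8 ≠ 1 := by
  refine ⟨fun h => ?_, tFiveEighths_pow_eight_ne_one⟩
  have h16 : tFiveEighths ^ 16 = 1 := by
    calc tFiveEighths ^ 16 = (tFiveEighths ^ 4) ^ 4 := by ring
      _ = 1 := by rw [h]; norm_num
  rw [tFiveEighths_pow_sixteen] at h16
  norm_num at h16

/-- `t⁶ = e^{−15iπ/8}` for the printed phase. [cite: GlazmanManolescu2019, §2.1, eq. (2.1) (σ = 5/8)] -/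
theorem tFiveEighths_pow_six : tFiveEighths ^ 6 = Complex.exp (((-(15 * π / 8) : ℝ) : ℂ) * Complex.I) := by
  unfold tFiveEighths
  rw [← Complex.exp_nat_mul]
  congr 1
  push_cast
  ring

/-- `r(θ)² = e^{i(3θ/4 + 5π/8)}`. [cite: GlazmanManolescu2019, Lemma 2.1, eq. (CR)] -/
theorem ybRatio_sq (θ : ℝ) : ybRatio θ ^ 2 = Complex.exp (((3 * θ / 4 + 5 * π / 8 : ℝ) : ℂ) * Complex.I) := by
  unfold ybRatio
  rw [sq, ← Complex.exp_add]
  congr 1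
  push_cast
  ring

/-- `r(θ)⁻¹ = r̄(θ)` (`|r| = 1`). [cite: GlazmanManolescu2019, Lemma 2.1, eq. (CR)] -/
theorem ybRatio_inv (θ : ℝ) : (ybRatio θ)⁻¹ = (starRingEnd ℂ) (ybRatio θ) :=
  inv_eq_of_mul_eq_one_left (conj_ybRatio_mul_ybRatio θ)

/-- `e^{ix} + e^{−ix} = 2 cos x` in the form used below. [cite: GlazmanManolescu2019, §1, eq. (1)] -/
private theorem exp_add_exp_neg_mul_I (x : ℝ) :
    Complex.exp ((x : ℂ) * Complex.I) + (Complex.exp ((x : ℂ) * Complex.I))⁻¹ = ((2 * Real.cos x : ℝ) : ℂ) := by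
  rw [← Complex.exp_neg, Complex.ofReal_mul, Complex.ofReal_cos, Complex.ofReal_ofNat, Complex.cos, ← neg_mul]
  field_simp

/-- ★★ **The printed point is off the discriminant**: `Q(t, r(θ)) = t⁶(1 + r⁴) − (1 + t¹²) r² ≠ 0` for every
`θ ∈ [π/3, 2π/3]` — indeed `Q = t⁶ r² (2cos(3θ/4 + 5π/8) − 2cos(15π/8))` with `cos(3θ/4 + 5π/8) < 0 < cos(15π/8)`.
So §§ 13–14 apply to `printedWeights θ = ybCurve (−1) t r(θ)` (`printedWeights_eq_ybCurve`) on the whole printed range.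
[cite: GlazmanManolescu2019, §1, eq. (1); Lemma 2.1, eq. (CR)] [cite: Glazman2015WeightedSAW, Lemma 3.1, (3.3)–(3.7)] -/
theorem ybDisc_printed_ne_zero {θ : ℝ} (hθ : θ ∈ Set.Icc (π / 3) (2 * π / 3)) :
    tFiveEighths ^ 6 * (1 + ybRatio θ ^ 4) - (1 + tFiveEighths ^ 12) * ybRatio θ ^ 2 ≠ 0 := by
  have ht : tFiveEighths ≠ 0 := tFiveEighths_ne_zero
  have hr : ybRatio θ ≠ 0 := ybRatio_ne_zero θ
  have ht6 : tFiveEighths ^ 6 ≠ 0 := pow_ne_zero _ ht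
  have hr2 : ybRatio θ ^ 2 ≠ 0 := pow_ne_zero _ hr
  -- factor `Q = t⁶ r² ((r² + r⁻²) − (t⁶ + t⁻⁶))`
  have key : tFiveEighths ^ 6 * (1 + ybRatio θ ^ 4) - (1 + tFiveEighths ^ 12) * ybRatio θ ^ 2 =
      tFiveEighths ^ 6 * ybRatio θ ^ 2 *
        ((ybRatio θ ^ 2 + (ybRatio θ ^ 2)⁻¹) - (tFiveEighths ^ 6 + (tFiveEighths ^ 6)⁻¹)) := by
    field_simp
    ring
  have hc : (ybRatio θ ^ 2 + (ybRatio θ ^ 2)⁻¹) - (tFiveEighths ^ 6 + (tFiveEighths ^ 6)⁻¹) =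
      ((2 * Real.cos (3 * θ / 4 + 5 * π / 8) - 2 * Real.cos (-(15 * π / 8)) : ℝ) : ℂ) := by
    rw [ybRatio_sq, tFiveEighths_pow_six, exp_add_exp_neg_mul_I, exp_add_exp_neg_mul_I]
    push_cast
    ring
  have hneg : Real.cos (3 * θ / 4 + 5 * π / 8) < 0 := by
    apply Real.cos_neg_of_pi_div_two_lt_of_lt
    · linarith [hθ.1, Real.pi_pos]
    · linarith [hθ.2, Real.pi_pos]
  have hpos : 0 < Real.cos (-(15 * π / 8)) := by
    rw [Real.cos_neg, show 15 * π / 8 = 2 * π - π / 8 by ring, Real.cos_two_pi_sub]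
    exact Real.cos_pos_of_mem_Ioo ⟨by linarith [Real.pi_pos], by linarith [Real.pi_pos]⟩
  have hreal : (2 * Real.cos (3 * θ / 4 + 5 * π / 8) - 2 * Real.cos (-(15 * π / 8)) : ℝ) ≠ 0 := by
    intro h; linarith
  rw [key, hc]
  exact mul_ne_zero (mul_ne_zero ht6 hr2) (Complex.ofReal_ne_zero.2 hreal)

/-- ★★ **§ 5's weight duality re-derived from the curve** (second proof, on the printed range): by § 14,
`W(θ).swap = (ybCurve (−1) t r(θ)).swap = ybCurve (−1) t (−r(θ))⁻¹`, and `(−r(θ))⁻¹ = −r̄(θ) = r(π − θ)`, the ratio of the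
printed point at `π − θ`. [cite: GlazmanManolescu2019, §1, remark after eq. (1) (θ ↔ π − θ)] [cite: Glazman2015WeightedSAW, Lemma 3.1, (3.3)–(3.7)] -/
example {θ : ℝ} (hθ : θ ∈ Set.Icc (π / 3) (2 * π / 3)) : (printedWeights θ).swap = printedWeights (π - θ) := by
  have hθ' : θ ∈ Set.Ioo 0 π := ⟨by linarith [hθ.1, Real.pi_pos], by linarith [hθ.2, Real.pi_pos]⟩
  have hπθ' : π - θ ∈ Set.Ioo 0 π := ⟨by linarith [hθ.2, Real.pi_pos], by linarith [hθ.1, Real.pi_pos]⟩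
  rw [printedWeights_eq_ybCurve θ (weightDen_ne_zero_of_mem_Ioo hθ'),
    printedWeights_eq_ybCurve (π - θ) (weightDen_ne_zero_of_mem_Ioo hπθ'),
    ybCurve_swap_eq_inv (Or.inr rfl) tFiveEighths_ne_zero tFiveEighths_pow_four_eight_ne_one.1 (ybRatio_ne_zero θ)
      (ybDisc_printed_ne_zero hθ)]
  congr 1
  rw [mul_inv, ybRatio_inv, conj_ybRatio]
  norm_num

/-- ★★ **§ 7's self-duality angle re-derived from the curve** (second proof): `W(θ).swap = W(θ) ⟺ r(θ)² = −1 ⟺ θ = π/2`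
on the printed range, by § 14's self-dual locus `r² = ε` and `ybRatio_sq_eq_neg_one_iff`.
[cite: GlazmanManolescu2019, §1, remark after eq. (1) (θ ↔ π − θ)] [cite: Glazman2015WeightedSAW, Lemma 3.1, (3.3)–(3.7)] -/
example {θ : ℝ} (hθ : θ ∈ Set.Icc (π / 3) (2 * π / 3)) : (printedWeights θ).swap = printedWeights θ ↔ θ = π / 2 := by
  have hθ' : θ ∈ Set.Ioo 0 π := ⟨by linarith [hθ.1, Real.pi_pos], by linarith [hθ.2, Real.pi_pos]⟩
  rw [printedWeights_eq_ybCurve θ (weightDen_ne_zero_of_mem_Ioo hθ'),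
    ybCurve_swap_eq_self_iff (Or.inr rfl) tFiveEighths_ne_zero tFiveEighths_pow_four_eight_ne_one.1 tFiveEighths_pow_four_eight_ne_one.2
      (ybRatio_ne_zero θ) (ybDisc_printed_ne_zero hθ),
    ybRatio_sq_eq_neg_one_iff hθ]

end Literature.Barriers.CriticalPhenomena.PlaquetteWalk
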